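import Literature.Analysis.FluidPDE.PlanarNashInequalityWholeSpace
import Literature.Analysis.FluidPDE.PlanarSobolevExplicitConstants
import Literature.Analysis.FluidPDE.PlanarVorticityMoments
import Literature.Analysis.FluidPDE.PlanarVorticityMaxPrinciple
import Literature.Analysis.FluidPDE.DecayingScalarIntegrationByParts
import HarnessLib

/-!
# `Lᵖ` smoothing of a planar viscous vorticity: the `L²`, `L⁴` and `L^∞` decay estimates
# (Gallay–Wayne 2005, Thm. 1.1, eq. (1.2); after Ben-Artzi 1994, Kato 1994, Carlen–Loss 1995)

Literature file (topic `Analysis/FluidPDE`), all results proved, no definitions, no named facts.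
The printed statement (Gallay–Wayne 2005, Thm. 1.1, materialised text p. 3):

> For all initial data `ω₀ ∈ L¹(ℝ²)`, [the vorticity equation] has a unique global solution
> `ω ∈ C⁰([0,∞), L¹) ∩ C⁰((0,∞), L^∞)` such that `ω(0) = ω₀`. Moreover, for all `p ∈ [1, +∞]`,
> there exists `C_p > 0` such that `|ω(·,t)|_p ≤ C_p |ω₀|₁ / t^{1 − 1/p}`, `t > 0`. (1.2)

(attributed there to Ben-Artzi 1994, Brezis 1994 and Kato 1994; the optimal constants are
Carlen–Loss 1995, by the `L^p` energy identities of the vorticity equation and the sharp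
logarithmic Sobolev / Nash inequalities). This file proves the estimate (1.2) for `p = 2`,
`p = 4` and (v2, §6) `p = ∞`, with explicit constants, and (v3, §7) the `L¹` contraction
`‖ω(s)‖₁ ≤ ‖ω(t₀)‖₁` for signed data, for CLASSICAL solutions of the planar Navier–Stokes equations in
the tree's sense (`IsClassicalNSSolutionOn` on `ℝ² = EuclideanSpace ℝ (Fin 2)`, scalar vorticity
`PlanarEigenmode.vorticity`, its equation `IsClassicalNSSolutionOn.planarVorticity_eq` = MB (2.6),
uniform decay class `HasUniformRapidDecayOn`), by J. Nash's original argument: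

* §0 Green's first identity for a pair of decaying scalars (`∫ φ Δθ = −∫ ⟪∇φ, ∇θ⟫`, the tree had
  only `φ = θ`) and its power form `∫ ω^{q+1} Δω = −(q+1) ∫ ω^q ‖∇ω‖²`;
* §1 the comparison lemma: `y ≥ 0`, `y' ≤ −k y²` on `[a, b]` ⇒ `y(s) ≤ 1/(k (s − a))`;
* §2 the `L^{q+2}` balance at a fixed time,
  `∫ (q+2) ω^{q+1} ∂ₜω = −ν (q+2)(q+1) ∫ ω^q ‖∇ω‖² + (q+2) ∫ ω^{q+1} curl f`
  (transport term `∫ (u·∇) ω^{q+2} = 0` by `div u = 0`; force kept as in the tree's (2.6));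
* §3 the `L^{q+2}` laws within a CONVEX time set (one-sided derivatives at endpoints), and the
  cases `q = 0` (enstrophy: `d/dt ∫ω² = −2ν ∫‖∇ω‖² + 2∫ ω curl f`) and `q = 2`
  (`d/dt ∫ω⁴ = −12ν ∫ ω²‖∇ω‖² + 4 ∫ ω³ curl f`);
* §4 **the decay estimates under a running `L¹` bound** `‖ω(s)‖₁ ≤ m` on `[t₀, t]` (curl-free
  force, `ν > 0`, signed vorticity):
  `‖ω(t)‖₂² ≤ 2 C_GNS m² / (ν (t − t₀))` (Nash's inequality without compact support,
  `PlanarNashInequalityWholeSpace`, `(∫ω²)² ≤ 4 C_GNS (∫|ω|)² ∫‖∇ω‖²`, turns the enstrophy law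
  into `y' ≤ −(ν/2C_GNS m²) y²`) and, by the same step for `ω²` on `[(t₀+t)/2, t]`,
  `‖ω(t)‖₄⁴ ≤ (128/3) C_GNS³ m⁴ / (ν (t − t₀))³`; here `C_GNS = lintegralPowLePowLIntegralFDerivConst volume 2`
  is Mathlib's Gagliardo–Nirenberg–Sobolev constant of `ℝ²`;
* §5 for NON-NEGATIVE vorticity the `L¹` norm is the conserved circulation `Γ = ∫ ω(t₀)`
  (minimum principle `planarVorticity_ge_of_ge` + flux conservation, MB Prop. 1.14 (i)), giving
  (1.2) in the printed shape: `‖ω(t)‖₂² ≤ 2 C_GNS Γ²/(ν (t−t₀))`,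
  `‖ω(t)‖₄⁴ ≤ (128/3) C_GNS³ Γ⁴/(ν (t−t₀))³`;
* §6 (v2) **the full Nash–Moser iteration and the `L^∞` endpoint**: the general step
  (`∫|ω(s)|^q ≤ Y` on `[t₁, t]` ⇒ `∫ω(t)^{2q} ≤ 2 C_GNS Y²/(ν (t − t₁))`, every `q ≥ 1`,
  `integral_pow_two_mul_planarVorticity_le_of_integral_abs_pow_le`), the dyadic iteration
  (`∫|ω(s)|^{2^j} ≤ m (8 m C_GNS/(ν(t−t₀)))^{2^j−1}/2^j` on `[t − (t−t₀)/2^j, t]`,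
  `integral_abs_pow_two_pow_planarVorticity_le`), and the limit `j → ∞`:
  **`‖ω(t)‖_∞ ≤ 8 C_GNS m/(ν (t − t₀))`** (`abs_planarVorticity_le_of_integral_abs_le`), `= 8 C_GNS Γ/(ν(t−t₀))`
  for non-negative data (`planarVorticity_le_of_nonneg`);
* §7 (v3) **the `L¹` contraction for SIGNED data** (Ben-Artzi 1994; the `L¹` half of Thm. 1.1):
  with the smoothed absolute value `φ_ε(y) = (y² + ε²)^{1/2}` — its balance
  `∫ φ_ε'(ω)∂ₜω = −ν∫φ_ε''(ω)‖∇ω‖² + ∫φ_ε'(ω) curl f`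
  (`integral_smoothSign_mul_timeDerivWithin_planarVorticity_eq`), its law within a convex time set
  (`hasDerivWithinAt_integral_smoothAbs_planarVorticity`), monotonicity and `ε → 0` by dominated
  convergence: **`∫|ω(s)| ≤ ∫|ω(t₀)|`** for `t₀ ≤ s`, `ν ≥ 0`, curl-free force
  (`integral_abs_planarVorticity_le`); hence (1.2) for signed data with `m = ‖ω(t₀)‖₁`:
  `integral_sq_planarVorticity_le`, `integral_pow_four_planarVorticity_le`, `abs_planarVorticity_le`,
  and (v4) for EVERY real exponent `r ≥ 1` by interpolation:
  `∫|ω(t)|^r ≤ (8 C_GNS ‖ω(t₀)‖₁/(ν(t−t₀)))^{r−1} ‖ω(t₀)‖₁` (`integral_abs_rpow_planarVorticity_le`).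
* §8 (v5) **generic and EXPLICIT constants**: every constant-carrying theorem of §4/§6/§7 is now
  an instance of a `…_of_nashConst` twin taking ANY constant `Cg ≥ 0` with the planar Nash
  inequality `(∫g²)² ≤ 4 Cg (∫|g|)² ∫‖∇g‖²` on decaying `C¹` functions as a hypothesis (the proofs
  are unchanged — Nash's argument never used which constant it was); the `C_GNS` statements above
  are the instances at Mathlib's constant, and the `…_explicit` theorems are the instances at
  `Cg = 1/8` (`PlanarSobolev.sq_integral_sq_le_half_of_decay`, the tree's planar Nash inequality with
  the explicit constant `1/2`): **`‖ω(t)‖₂² ≤ m²/(4ν(t−t₀))`, `‖ω(t)‖₄⁴ ≤ m⁴/(12(ν(t−t₀))³)`,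
  `‖ω(t)‖_∞ ≤ m/(ν(t−t₀))`**, `∫|ω(t)|^r ≤ (m/(ν(t−t₀)))^{r−1} m` (`m` = running `L¹` bound,
  `= Γ` for `ω(t₀) ≥ 0`, `= ‖ω(t₀)‖₁` for signed data).

## What is typed, and what is NOT here

* The hypotheses are those of the tree's planar cluster (`PlanarVorticityMoments`,
  `PlanarVorticityMaxPrinciple`): a convex time set `S`, uniform rapid decay of the VORTICITY (the
  velocity of a planar flow with `Γ ≠ 0` is not even `L²`), `u(s)` bounded at each time (true for
  `u = K₂ ∗ ω`, `exists_norm_le_of_eq_biotSavart2D`), curl-free force for the decay statements.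
* The running `L¹` bound is a HYPOTHESIS in §4 and §6; it is discharged with `m = ‖ω(t₀)‖₁` for
  signed data in §7 (`L¹` contraction) and with `m = Γ` for `ω(t₀) ≥ 0` in §5.
* The constants (`2 C_GNS`, `(128/3) C_GNS³`, `8 C_GNS`) are those of Nash's argument with Mathlib's
  (non-sharp, not numerically evaluated) `C_GNS`; the v5 `…_explicit` twins carry the NUMBERS
  `1/4`, `1/12`, `1` instead (heat-kernel values: `1/(8π)`, `1/(256π³)·‖G‖₄⁴`-shape, `1/(4π)`); the
  optimal `L^∞` constant `1/(4π)` of Carlen–Loss (logarithmic Sobolev inequality) is NOT reached.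
* Mild / measure-valued data (the existence half of Thm. 1.1) are not touched.

HONEST FRAMING (cell `ns-blowup`, bears_on LADDER-NS N1 crux `HeredityFromTwo`, upper half):
a-priori SMOOTHING bounds of planar viscous vorticity dynamics; used in the cell only through
Lundgren's transformation to bound a stretched tube's cross-section UNIFORMLY in time. Nothing
here asserts anything about Navier–Stokes regularity or blow-up in 3-D.

## References

* [GallayWayne2005] Th. Gallay, C. E. Wayne, *Global stability of vortex solutions of the
  two-dimensional Navier–Stokes equation*, Comm. Math. Phys. 255 (2005) 97–129 =
  arXiv:math/0402449 — Thm. 1.1, eq. (1.2) (materialised text p. 3).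
* [CarlenLoss1995] E. A. Carlen, M. Loss, *Optimal smoothing and decay estimates for viscously
  damped conservation laws, with applications to the 2-D Navier–Stokes equation*, Duke Math. J.
  81 (1995) 135–157 — optimal `L^p` smoothing via the `p`-norm identities (paywalled, acq-04011;
  cited here through GallayWayne2005 §1 and §2.2).
* [Nash1958] J. Nash, *Continuity of solutions of parabolic and elliptic equations*, Amer. J.
  Math. 80 (1958) 931–954 — the inequality and the ODE argument.
* [MajdaBertozziCUP2002] A. J. Majda, A. L. Bertozzi, *Vorticity and Incompressible Flow*, CUP
  2002 — §2.1 eq. (2.6), §1.7 Prop. 1.14 (i), §3.3 (maximum principle).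
-/

noncomputable section

open MeasureTheory Set Function Filter InnerProductSpace
open _root_.Topology
open scoped ContDiff Laplacian RealInnerProductSpace Topology

namespace Literature.Analysis.FluidPDE

/-! ### §0 Green's first identity for a pair of decaying scalars, and for powers -/

section Green

variable {E : Type*} [NormedAddCommGroup E] [InnerProductSpace ℝ E] [FiniteDimensional ℝ E]
  [MeasurableSpace E] [BorelSpace E]

/-- **Green's first identity for two decaying scalars, in an orthonormal frame.** For a `C²`
scalar `θ` and a `C¹` scalar `φ` on a finite-dimensional inner product space `E`, with
`‖Dθ‖, ‖D²θ‖, |φ|, ‖Dφ‖ ≤ C (1 + ‖x‖)^{-r}`, `dim E < r`, and any orthonormal basis `b`: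
`∫ φ Δθ = -∑ᵢ ∫ (Dφ bᵢ)(Dθ bᵢ)` (integration by parts coordinatewise, no boundary terms; the case
`φ = θ` is the tree's `integral_mul_laplacian_self_eq_neg_sum_integral_sq`) — Green's first
identity on the whole space under decay.
[cite: Evans2010, App. C.2 Thm. 3 (i) (Green's formulas; whole-space form under decay)] -/
theorem integral_mul_laplacian_eq_neg_sum_integral_fderiv_mul_fderiv {θ φ : E → ℝ}
    (hθ2 : ContDiff ℝ 2 θ) (hφ1 : ContDiff ℝ 1 φ) {C r : ℝ} (hC : 0 ≤ C)
    (hr : (Module.finrank ℝ E : ℝ) < r)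
    (h1 : ∀ x, ‖fderiv ℝ θ x‖ ≤ C * (1 + ‖x‖) ^ (-r))
    (h2 : ∀ x, ‖fderiv ℝ (fderiv ℝ θ) x‖ ≤ C * (1 + ‖x‖) ^ (-r))
    (g0 : ∀ x, ‖φ x‖ ≤ C * (1 + ‖x‖) ^ (-r)) (g1 : ∀ x, ‖fderiv ℝ φ x‖ ≤ C * (1 + ‖x‖) ^ (-r))
    {ι : Type*} [Fintype ι] (b : OrthonormalBasis ι ℝ E) :
    ∫ x, φ x * (Δ θ) x = -∑ i, ∫ x, fderiv ℝ φ x (b i) * fderiv ℝ θ x (b i) := by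
  have hφc : Continuous φ := hφ1.continuous
  have hDφc : Continuous (fderiv ℝ φ) := hφ1.continuous_fderiv one_ne_zero
  have hDθc : Continuous (fderiv ℝ θ) := hθ2.continuous_fderiv two_ne_zero
  have hD2 : ContDiff ℝ 1 (fderiv ℝ θ) := hθ2.fderiv_right (m := 1) (by norm_num)
  have hD2c : Continuous (fderiv ℝ (fderiv ℝ θ)) := hD2.continuous_fderiv one_ne_zero
  have hr0 : 0 ≤ r := (Nat.cast_nonneg _).trans hr.le
  have hw : ∀ x : E, 0 ≤ C * (1 + ‖x‖) ^ (-r) := fun x =>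
    mul_nonneg hC (Real.rpow_nonneg (by positivity) _)
  -- derivative of `y ↦ Dθ(y) bᵢ`
  have hf : ∀ i x, HasFDerivAt (fun y => fderiv ℝ θ y (b i))
      ((ContinuousLinearMap.apply ℝ ℝ (b i)).comp (fderiv ℝ (fderiv ℝ θ) x)) x :=
    fun i x => (ContinuousLinearMap.apply ℝ ℝ (b i)).hasFDerivAt.comp x
      (hD2.differentiable one_ne_zero x).hasFDerivAt
  -- integrability of the three products
  have hI1 : ∀ i, Integrable (fun x => fderiv ℝ (fderiv ℝ θ) x (b i) (b i) * φ x)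
      (volume : Measure E) := by
    intro i
    refine integrable_of_norm_le_decay_mul_decay (C₁ := C) (C₂ := C) (r' := r)
      (((hD2c.clm_apply continuous_const).clm_apply continuous_const).mul hφc) hr hr0 hC hC
      fun x => ?_
    rw [norm_mul]
    exact mul_le_mul (((norm_apply_orthonormalBasis_le b i _).trans
      (norm_apply_orthonormalBasis_le b i _)).trans (h2 x)) (g0 x) (norm_nonneg _) (hw x)
  have hI2 : ∀ i, Integrable (fun x => fderiv ℝ θ x (b i) * fderiv ℝ φ x (b i))
      (volume : Measure E) := by
    intro i
    refine integrable_of_norm_le_decay_mul_decay (C₁ := C) (C₂ := C) (r' := r)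
      ((hDθc.clm_apply continuous_const).mul (hDφc.clm_apply continuous_const)) hr hr0 hC hC
      fun x => ?_
    rw [norm_mul]
    exact mul_le_mul ((norm_apply_orthonormalBasis_le b i _).trans (h1 x))
      ((norm_apply_orthonormalBasis_le b i _).trans (g1 x)) (norm_nonneg _) (hw x)
  have hI3 : ∀ i, Integrable (fun x => fderiv ℝ θ x (b i) * φ x) (volume : Measure E) := by
    intro i
    refine integrable_of_norm_le_decay_mul_decay (C₁ := C) (C₂ := C) (r' := r)
      ((hDθc.clm_apply continuous_const).mul hφc) hr hr0 hC hC fun x => ?_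
    rw [norm_mul]
    exact mul_le_mul ((norm_apply_orthonormalBasis_le b i _).trans (h1 x)) (g0 x) (norm_nonneg _)
      (hw x)
  -- integration by parts, one coordinate at a time
  have hibp : ∀ i, ∫ x, fderiv ℝ θ x (b i) * fderiv ℝ φ x (b i) =
      -∫ x, fderiv ℝ (fderiv ℝ θ) x (b i) (b i) * φ x := by
    intro i
    exact integral_bilinear_hasFDerivAt_right_eq_neg_left_of_integrable
      (μ := (volume : Measure E)) (f := fun y => fderiv ℝ θ y (b i))
      (f' := fun x => (ContinuousLinearMap.apply ℝ ℝ (b i)).comp (fderiv ℝ (fderiv ℝ θ) x))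
      (g := φ) (g' := fderiv ℝ φ) (v := b i) (B := ContinuousLinearMap.mul ℝ ℝ)
      (hI1 i) (hI2 i) (hI3 i)
      (fun x _ => hf i x) (fun x _ => (hφ1.differentiable one_ne_zero x).hasFDerivAt)
  calc ∫ x, φ x * (Δ θ) x
      = ∫ x, ∑ i, fderiv ℝ (fderiv ℝ θ) x (b i) (b i) * φ x := by
        refine integral_congr_ae (Eventually.of_forall fun x => ?_)
        simp only [laplacian_apply_eq_sum_fderiv_fderiv b, Finset.mul_sum]
        exact Finset.sum_congr rfl fun i _ => mul_comm _ _
    _ = ∑ i, ∫ x, fderiv ℝ (fderiv ℝ θ) x (b i) (b i) * φ x :=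
        integral_finsetSum _ fun i _ => hI1 i
    _ = -∑ i, ∫ x, fderiv ℝ φ x (b i) * fderiv ℝ θ x (b i) := by
        rw [← Finset.sum_neg_distrib]
        refine Finset.sum_congr rfl fun i _ => ?_
        have e : ∫ x, fderiv ℝ φ x (b i) * fderiv ℝ θ x (b i) =
            ∫ x, fderiv ℝ θ x (b i) * fderiv ℝ φ x (b i) :=
          integral_congr_ae (Eventually.of_forall fun x => mul_comm _ _)
        rw [e, hibp i, neg_neg]

/-- **Green's first identity for two decaying scalars**: `∫ φ Δθ = -∫ Dφ(∇θ)`, i.e.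
`-∫ ⟪∇φ, ∇θ⟫`, written with the Fréchet derivatives as `-∫ ∑ᵢ (Dφ eᵢ)(Dθ eᵢ)` in the standard
frame; hypotheses as in `integral_mul_laplacian_eq_neg_sum_integral_fderiv_mul_fderiv`.
[cite: Evans2010, App. C.2 Thm. 3 (i) (Green's formulas; whole-space form under decay)] -/
theorem integral_mul_laplacian_eq_neg_integral_sum_fderiv_mul_fderiv {θ φ : E → ℝ}
    (hθ2 : ContDiff ℝ 2 θ) (hφ1 : ContDiff ℝ 1 φ) {C r : ℝ} (hC : 0 ≤ C)
    (hr : (Module.finrank ℝ E : ℝ) < r)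
    (h1 : ∀ x, ‖fderiv ℝ θ x‖ ≤ C * (1 + ‖x‖) ^ (-r))
    (h2 : ∀ x, ‖fderiv ℝ (fderiv ℝ θ) x‖ ≤ C * (1 + ‖x‖) ^ (-r))
    (g0 : ∀ x, ‖φ x‖ ≤ C * (1 + ‖x‖) ^ (-r)) (g1 : ∀ x, ‖fderiv ℝ φ x‖ ≤ C * (1 + ‖x‖) ^ (-r))
    {ι : Type*} [Fintype ι] (b : OrthonormalBasis ι ℝ E) :
    ∫ x, φ x * (Δ θ) x = -∫ x, ∑ i, fderiv ℝ φ x (b i) * fderiv ℝ θ x (b i) := by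
  have hDφc : Continuous (fderiv ℝ φ) := hφ1.continuous_fderiv one_ne_zero
  have hDθc : Continuous (fderiv ℝ θ) := hθ2.continuous_fderiv two_ne_zero
  have hr0 : 0 ≤ r := (Nat.cast_nonneg _).trans hr.le
  have hI : ∀ i, Integrable (fun x => fderiv ℝ φ x (b i) * fderiv ℝ θ x (b i))
      (volume : Measure E) := by
    intro i
    refine integrable_of_norm_le_decay_mul_decay (C₁ := C) (C₂ := C) (r' := r)
      ((hDφc.clm_apply continuous_const).mul (hDθc.clm_apply continuous_const)) hr hr0 hC hC
      fun x => ?_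
    rw [norm_mul]
    exact mul_le_mul ((norm_apply_orthonormalBasis_le b i _).trans (g1 x))
      ((norm_apply_orthonormalBasis_le b i _).trans (h1 x)) (norm_nonneg _)
      (mul_nonneg hC (Real.rpow_nonneg (by positivity) _))
  rw [integral_mul_laplacian_eq_neg_sum_integral_fderiv_mul_fderiv hθ2 hφ1 hC hr h1 h2 g0 g1 b,
    integral_finsetSum _ fun i _ => hI i]

/-- The derivative of a power of a scalar field: `D(ω^{q+1})(x) = ((q+1) ω(x)^q) • Dw(x)`.
[folklore] -/
private theorem fderiv_pow_succ_apply {X : Type*} [NormedAddCommGroup X] [NormedSpace ℝ X]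
    {w : X → ℝ} (hw : Differentiable ℝ w) (q : ℕ) (x : X) :
    fderiv ℝ (fun y => w y ^ (q + 1)) x = (((q : ℝ) + 1) * w x ^ q) • fderiv ℝ w x := by
  have h := ((hw x).hasFDerivAt).pow (q + 1)
  rw [h.fderiv]
  simp only [Nat.add_sub_cancel, nsmul_eq_mul, Nat.cast_add, Nat.cast_one]

omit [FiniteDimensional ℝ E] [MeasurableSpace E] [BorelSpace E] in
/-- `∑ᵢ (Dw eᵢ)² = ‖Dw‖²` in an orthonormal frame (`OrthonormalBasis.norm_dual`). [folklore] -/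
private theorem sum_sq_fderiv_apply_eq_norm_sq {w : E → ℝ} {ι : Type*} [Fintype ι]
    (b : OrthonormalBasis ι ℝ E) (x : E) :
    ∑ i, fderiv ℝ w x (b i) ^ 2 = ‖fderiv ℝ w x‖ ^ 2 :=
  (b.norm_dual (fderiv ℝ w x)).symm

/-- **`∫ ω^{q+1} Δω = -(q+1) ∫ ω^q ‖Dw‖²` for a decaying scalar.** For a `C²` scalar `ω` with
`|ω|, ‖Dw‖, ‖D²ω‖ ≤ C (1 + ‖x‖)^{-r}`, `dim E < r`, and every `q : ℕ`: Green's first identity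
with `φ = ω^{q+1}`, `∇φ = (q+1) ω^q ∇ω` (the viscous term of the `L^{q+2}` energy method;
Carlen–Loss 1995, §1; the case `q = 0` is `∫ ω Δω = -∫ ‖∇ω‖²`).
[cite: Evans2010, App. C.2 Thm. 3 (i) (Green's first formula with the test function ω^{q+1})] -/
theorem integral_pow_succ_mul_laplacian_eq {w : E → ℝ} (hw2 : ContDiff ℝ 2 w) {C r : ℝ}
    (hC : 0 ≤ C) (hr : (Module.finrank ℝ E : ℝ) < r)
    (h0 : ∀ x, |w x| ≤ C * (1 + ‖x‖) ^ (-r)) (h1 : ∀ x, ‖fderiv ℝ w x‖ ≤ C * (1 + ‖x‖) ^ (-r))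
    (h2 : ∀ x, ‖fderiv ℝ (fderiv ℝ w) x‖ ≤ C * (1 + ‖x‖) ^ (-r)) (q : ℕ) :
    ∫ x, w x ^ (q + 1) * (Δ w) x = -(((q : ℝ) + 1) * ∫ x, w x ^ q * ‖fderiv ℝ w x‖ ^ 2) := by
  haveI : CompleteSpace E := FiniteDimensional.complete ℝ E
  set b := stdOrthonormalBasis ℝ E
  have hr0 : 0 ≤ r := (Nat.cast_nonneg _).trans hr.le
  have hw1 : ContDiff ℝ 1 w := hw2.of_le one_le_two
  have hwd : Differentiable ℝ w := hw1.differentiable one_ne_zero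
  have hφ1 : ContDiff ℝ 1 (fun y => w y ^ (q + 1)) := hw1.pow (q + 1)
  -- `|ω| ≤ C`; one constant `K` dominating the decay of `ω`, `Dw`, `D²ω`, `ω^{q+1}`, `D(ω^{q+1})`
  have hB : ∀ x, |w x| ≤ C := fun x =>
    (h0 x).trans (mul_le_of_le_one_right hC (rpow_neg_le_one x hr0))
  set K : ℝ := C + ((q : ℝ) + 1) * C ^ q * C with hK
  have hK0 : 0 ≤ K := by positivity
  have hCK : C ≤ K := by rw [hK]; exact le_add_of_nonneg_right (by positivity)
  have hC'K : ((q : ℝ) + 1) * C ^ q * C ≤ K := by rw [hK]; linarith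
  have hCqK : C ^ q * C ≤ K := by
    refine le_trans ?_ hC'K
    have : (1 : ℝ) * (C ^ q * C) ≤ ((q : ℝ) + 1) * (C ^ q * C) :=
      mul_le_mul_of_nonneg_right (by linarith [(Nat.cast_nonneg q : (0 : ℝ) ≤ q)])
        (by positivity)
    linarith
  have hw0 : ∀ x : E, 0 ≤ (1 + ‖x‖) ^ (-r) := fun x => Real.rpow_nonneg (by positivity) _
  have hpowq : ∀ x, |w x| ^ q ≤ C ^ q := fun x => pow_le_pow_left₀ (abs_nonneg _) (hB x) q
  have g0 : ∀ x, ‖w x ^ (q + 1)‖ ≤ K * (1 + ‖x‖) ^ (-r) := by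
    intro x
    rw [Real.norm_eq_abs, abs_pow, pow_succ]
    calc |w x| ^ q * |w x| ≤ C ^ q * (C * (1 + ‖x‖) ^ (-r)) :=
          mul_le_mul (hpowq x) (h0 x) (abs_nonneg _) (pow_nonneg hC q)
      _ = (C ^ q * C) * (1 + ‖x‖) ^ (-r) := by ring
      _ ≤ K * (1 + ‖x‖) ^ (-r) := mul_le_mul_of_nonneg_right hCqK (hw0 x)
  have g1 : ∀ x, ‖fderiv ℝ (fun y => w y ^ (q + 1)) x‖ ≤ K * (1 + ‖x‖) ^ (-r) := by
    intro x
    rw [fderiv_pow_succ_apply hwd q x, norm_smul, Real.norm_eq_abs, abs_mul,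
      abs_of_nonneg (by positivity : (0 : ℝ) ≤ (q : ℝ) + 1), abs_pow]
    calc ((q : ℝ) + 1) * |w x| ^ q * ‖fderiv ℝ w x‖
        ≤ ((q : ℝ) + 1) * C ^ q * (C * (1 + ‖x‖) ^ (-r)) := by
          gcongr
          · exact hB x
          · exact h1 x
      _ = (((q : ℝ) + 1) * C ^ q * C) * (1 + ‖x‖) ^ (-r) := by ring
      _ ≤ K * (1 + ‖x‖) ^ (-r) := mul_le_mul_of_nonneg_right hC'K (hw0 x)
  have h1K : ∀ x, ‖fderiv ℝ w x‖ ≤ K * (1 + ‖x‖) ^ (-r) := fun x =>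
    le_decay_of_le_decay x (h1 x) hCK
  have h2K : ∀ x, ‖fderiv ℝ (fderiv ℝ w) x‖ ≤ K * (1 + ‖x‖) ^ (-r) := fun x =>
    le_decay_of_le_decay x (h2 x) hCK
  rw [integral_mul_laplacian_eq_neg_integral_sum_fderiv_mul_fderiv hw2 hφ1 hK0 hr h1K h2K g0 g1 b,
    ← integral_const_mul]
  congr 1
  refine integral_congr_ae (Eventually.of_forall fun x => ?_)
  simp only [fderiv_pow_succ_apply hwd q x, _root_.smul_apply,
    smul_eq_mul]
  rw [← sum_sq_fderiv_apply_eq_norm_sq b x, Finset.mul_sum, Finset.mul_sum]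
  exact Finset.sum_congr rfl fun i _ => by ring

end Green

/-! ### §1 The comparison lemma: `y' ≤ -k y²` forces `y(s) ≤ 1/(k (s − a))` -/

section ODE

/-- **Nash's ODE comparison.** Let `y ≥ 0` on `[a, b]` have one-sided derivatives `y'` within
`[a, b]` with `y' ≤ -k y²` for some `k > 0`. Then `y(s) ≤ 1 / (k (s − a))` for every
`s ∈ (a, b]` — independently of `y(a)` (`y` is nonincreasing; where `y > 0`, `1/y − k s` is
nondecreasing). This is the step turning `d/dt ‖ω‖₂² ≤ −c ‖ω‖₂⁴` into `‖ω(t)‖₂² ≤ 1/(c t)`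
(Nash 1958; Carlen–Loss 1995, §1). [folklore] -/
private theorem le_one_div_of_hasDerivWithinAt_le_neg_mul_sq {y y' : ℝ → ℝ} {a b k : ℝ}
    (hk : 0 < k) (hy : ∀ s ∈ Icc a b, HasDerivWithinAt y (y' s) (Icc a b) s) (h0 : ∀ s ∈ Icc a b, 0 ≤ y s)
    (hle : ∀ s ∈ Icc a b, y' s ≤ -(k * y s ^ 2)) {s : ℝ} (hs : s ∈ Ioc a b) :
    y s ≤ 1 / (k * (s - a)) := by
  have hab : a < b := hs.1.trans_le hs.2
  have hsI : s ∈ Icc a b := Ioc_subset_Icc_self hs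
  have hsa : 0 < s - a := sub_pos.2 hs.1
  have hcont : ContinuousOn y (Icc a b) := fun σ hσ => (hy σ hσ).continuousWithinAt
  -- `y` is nonincreasing on `[a, b]`
  have hanti : AntitoneOn y (Icc a b) := by
    refine antitoneOn_of_hasDerivWithinAt_nonpos (f' := y') (convex_Icc a b) hcont
      (fun σ hσ => ?_) fun σ hσ => ?_
    · rw [interior_Icc] at hσ ⊢
      exact (hy σ (Ioo_subset_Icc_self hσ)).mono Ioo_subset_Icc_self
    · rw [interior_Icc] at hσ
      have h := hle σ (Ioo_subset_Icc_self hσ)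
      nlinarith [sq_nonneg (y σ)]
  have hbound : 0 < 1 / (k * (s - a)) := by positivity
  by_cases hys : y s = 0
  · rw [hys]; exact hbound.le
  have hys' : 0 < y s := lt_of_le_of_ne (h0 s hsI) (Ne.symm hys)
  -- on `[a, s]` the function is positive, so `g = 1/y − k·σ` is differentiable and nondecreasing
  have hsub : Icc a s ⊆ Icc a b := Icc_subset_Icc_right hs.2
  have hpos : ∀ σ ∈ Icc a s, 0 < y σ := fun σ hσ =>
    hys'.trans_le (hanti (hsub hσ) hsI hσ.2)
  have hg : ∀ σ ∈ Icc a s,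
      HasDerivWithinAt (fun τ => (y τ)⁻¹ - k * τ) (-(y' σ) / y σ ^ 2 - k * 1) (Icc a s) σ :=
    fun σ hσ => (((hy σ (hsub hσ)).mono hsub).inv (hpos σ hσ).ne').sub
      ((hasDerivWithinAt_id σ (Icc a s)).const_mul k)
  have hmono : MonotoneOn (fun τ => (y τ)⁻¹ - k * τ) (Icc a s) := by
    refine monotoneOn_of_hasDerivWithinAt_nonneg (f' := fun σ => -(y' σ) / y σ ^ 2 - k * 1)
      (convex_Icc a s) (fun σ hσ => (hg σ hσ).continuousWithinAt) (fun σ hσ => ?_) fun σ hσ => ?_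
    · rw [interior_Icc] at hσ ⊢
      exact (hg σ (Ioo_subset_Icc_self hσ)).mono Ioo_subset_Icc_self
    · rw [interior_Icc] at hσ
      have hσ' : σ ∈ Icc a s := Ioo_subset_Icc_self hσ
      have hyσ := hpos σ hσ'
      have h := hle σ (hsub hσ')
      rw [mul_one, sub_nonneg, le_div_iff₀ (pow_pos hyσ 2)]
      linarith
  have hga := hmono (left_mem_Icc.2 hs.1.le) (right_mem_Icc.2 hs.1.le) hs.1.le
  have hya : 0 ≤ (y a)⁻¹ := inv_nonneg.2 (h0 a (left_mem_Icc.2 hab.le))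
  have hmain : k * (s - a) ≤ (y s)⁻¹ := by
    dsimp only at hga
    nlinarith
  calc y s = ((y s)⁻¹)⁻¹ := (inv_inv _).symm
    _ ≤ (k * (s - a))⁻¹ := inv_anti₀ (by positivity) hmain
    _ = 1 / (k * (s - a)) := (one_div _).symm

end ODE

/-! ### §2 The `L^{q+2}` balance of a classical planar vorticity at a fixed time -/

section Planar

variable {S : Set ℝ} {ν : ℝ} {f u : ℝ → EuclideanSpace ℝ (Fin 2) → EuclideanSpace ℝ (Fin 2)}
  {p : ℝ → EuclideanSpace ℝ (Fin 2) → ℝ}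

/-- The uniform decay package of the vorticity `ω(t) = curl u(t)` of a jointly smooth planar field,
at the weight exponent `dim + 1 = 3`: ONE constant `C ≥ 0` with
`|ω|, ‖∇ω‖, ‖∇²ω‖, |∂ₜω| ≤ C (1 + ‖x‖)^{-3}` on `S × ℝ²` (`RapidDecayLemmas`). [folklore] -/
private theorem exists_planarVorticity_decay_const₃ (hu : IsSmoothSpaceTimeOn S u)
    (hU : UniqueDiffOn ℝ S)
    (hω : HasUniformRapidDecayOn S (fun t x => PlanarEigenmode.vorticity (u t) x)) :
    ∃ C : ℝ, 0 ≤ C ∧ ∀ t ∈ S, ∀ x : EuclideanSpace ℝ (Fin 2),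
      |PlanarEigenmode.vorticity (u t) x| ≤ C * (1 + ‖x‖) ^
          (-((0 + (Module.finrank ℝ (EuclideanSpace ℝ (Fin 2)) + 1) : ℕ) : ℝ)) ∧
        ‖fderiv ℝ (PlanarEigenmode.vorticity (u t)) x‖ ≤ C * (1 + ‖x‖) ^
          (-((0 + (Module.finrank ℝ (EuclideanSpace ℝ (Fin 2)) + 1) : ℕ) : ℝ)) ∧
        ‖fderiv ℝ (fderiv ℝ (PlanarEigenmode.vorticity (u t))) x‖ ≤ C * (1 + ‖x‖) ^
          (-((0 + (Module.finrank ℝ (EuclideanSpace ℝ (Fin 2)) + 1) : ℕ) : ℝ)) ∧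
        |timeDerivWithin S (fun s y => PlanarEigenmode.vorticity (u s) y) t x| ≤ C * (1 + ‖x‖) ^
          (-((0 + (Module.finrank ℝ (EuclideanSpace ℝ (Fin 2)) + 1) : ℕ) : ℝ)) := by
  have hsm := PlanarEigenmode.isSmoothSpaceTimeOn_vorticity hu hU
  set K : ℕ := 0 + (Module.finrank ℝ (EuclideanSpace ℝ (Fin 2)) + 1) with hK
  obtain ⟨A0, hA0, hA0b⟩ := hω.norm_le_rpow K
  obtain ⟨A1, hA1, hA1b⟩ := hω.norm_fderiv_le_rpow hsm hU K
  obtain ⟨A2, hA2, hA2b⟩ := hω.norm_fderiv_fderiv_le_rpow hsm hU K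
  obtain ⟨A3, hA3, hA3b⟩ := hω.norm_timeDerivWithin_le_rpow hsm hU K
  refine ⟨A0 + A1 + A2 + A3, by positivity, fun t ht x => ⟨?_, ?_, ?_, ?_⟩⟩
  · have h := hA0b t ht x
    rw [Real.norm_eq_abs] at h
    exact le_decay_of_le_decay x h (by linarith)
  · exact le_decay_of_le_decay x (hA1b t ht x) (by linarith)
  · exact le_decay_of_le_decay x (hA2b t ht x) (by linarith)
  · have h := hA3b t ht x
    rw [Real.norm_eq_abs] at h
    exact le_decay_of_le_decay x h (by linarith)

/-- The weight exponent `dim ℝ² + 1 = 3` exceeds the dimension (as a real inequality). [folklore] -/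
private theorem finrank_lt_weightExp :
    (Module.finrank ℝ (EuclideanSpace ℝ (Fin 2)) : ℝ) <
      ((0 + (Module.finrank ℝ (EuclideanSpace ℝ (Fin 2)) + 1) : ℕ) : ℝ) := by
  push_cast; linarith

/-- **The `L^{q+2}` balance at a fixed time.** Let `(u, p)` be a classical solution of the planar
Navier–Stokes equations with force `f` on a time set `S` of unique differentiability, whose
scalar vorticity `ω(t) = curl u(t)` has uniform rapid decay on `S`, and let `u(t)` be bounded.
Then for every `q : ℕ`, `ω(t)^{q+1} curl f(t) ∈ L¹` and
`∫ (q+2) ω^{q+1} ∂ₜω = −ν (q+2)(q+1) ∫ ω^q ‖∇ω‖² + (q+2) ∫ ω^{q+1} curl f`: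
the vorticity equation `∂ₜω + (u·∇)ω = νΔω + curl f` (MB (2.6)) integrated against
`(q+2) ω^{q+1}`; the transport term is `∫ (u·∇)(ω^{q+2}) = 0` (`div u = 0`, decay) and the viscous
term is `∫ ω^{q+1} Δω = −(q+1) ∫ ω^q ‖∇ω‖²` (Green). For `q = 0` this is the enstrophy balance,
for `q = 2` the `L⁴` balance (Carlen–Loss 1995, the `p`-norm computation of their
introduction; Gallay–Wayne 2005, Thm. 1.1 (1.2)).
[cite: CarlenLoss1995, §1 (L^p energy identity for the 2-D vorticity equation); MajdaBertozziCUP2002, §2.1 eq. (2.6)] -/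
theorem IsClassicalNSSolutionOn.integral_pow_mul_timeDerivWithin_planarVorticity_eq
    (h : IsClassicalNSSolutionOn S ν f u p) (hU : UniqueDiffOn ℝ S)
    (hω : HasUniformRapidDecayOn S (fun t x => PlanarEigenmode.vorticity (u t) x)) {t : ℝ}
    (ht : t ∈ S) {M : ℝ} (hM : ∀ x, ‖u t x‖ ≤ M) (q : ℕ) :
    Integrable (fun x => PlanarEigenmode.vorticity (u t) x ^ (q + 1) *
        PlanarEigenmode.vorticity (f t) x) (volume : Measure (EuclideanSpace ℝ (Fin 2))) ∧
      ∫ x, ((q : ℝ) + 2) * PlanarEigenmode.vorticity (u t) x ^ (q + 1) *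
          timeDerivWithin S (fun s y => PlanarEigenmode.vorticity (u s) y) t x =
        -(ν * (((q : ℝ) + 2) * ((q : ℝ) + 1)) *
            ∫ x, PlanarEigenmode.vorticity (u t) x ^ q *
              ‖fderiv ℝ (PlanarEigenmode.vorticity (u t)) x‖ ^ 2) +
          ((q : ℝ) + 2) * ∫ x, PlanarEigenmode.vorticity (u t) x ^ (q + 1) *
            PlanarEigenmode.vorticity (f t) x := by
  obtain ⟨C, hC, hdec⟩ := exists_planarVorticity_decay_const₃ h.smooth_velocity hU hω
  set K : ℕ := 0 + (Module.finrank ℝ (EuclideanSpace ℝ (Fin 2)) + 1) with hK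
  have hKr : (Module.finrank ℝ (EuclideanSpace ℝ (Fin 2)) : ℝ) < (K : ℝ) := finrank_lt_weightExp
  have hK0 : (0 : ℝ) ≤ (K : ℝ) := Nat.cast_nonneg _
  -- abbreviations and the decay bounds at time `t`
  set w : EuclideanSpace ℝ (Fin 2) → ℝ := PlanarEigenmode.vorticity (u t) with hw
  set wt : EuclideanSpace ℝ (Fin 2) → ℝ :=
    timeDerivWithin S (fun s y => PlanarEigenmode.vorticity (u s) y) t with hwt
  set g : EuclideanSpace ℝ (Fin 2) → ℝ := PlanarEigenmode.vorticity (f t) with hg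
  have h0 : ∀ x, |w x| ≤ C * (1 + ‖x‖) ^ (-(K : ℝ)) := fun x => (hdec t ht x).1
  have h1 : ∀ x, ‖fderiv ℝ w x‖ ≤ C * (1 + ‖x‖) ^ (-(K : ℝ)) := fun x => (hdec t ht x).2.1
  have h2 : ∀ x, ‖fderiv ℝ (fderiv ℝ w) x‖ ≤ C * (1 + ‖x‖) ^ (-(K : ℝ)) := fun x =>
    (hdec t ht x).2.2.1
  have h3 : ∀ x, |wt x| ≤ C * (1 + ‖x‖) ^ (-(K : ℝ)) := fun x => (hdec t ht x).2.2.2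
  have hwle : ∀ x : EuclideanSpace ℝ (Fin 2), (1 + ‖x‖) ^ (-(K : ℝ)) ≤ 1 := fun x =>
    rpow_neg_le_one x hK0
  have hw0 : ∀ x : EuclideanSpace ℝ (Fin 2), 0 ≤ (1 + ‖x‖) ^ (-(K : ℝ)) := fun x =>
    Real.rpow_nonneg (by positivity) _
  have hB : ∀ x, |w x| ≤ C := fun x => (h0 x).trans (mul_le_of_le_one_right hC (hwle x))
  have hBq : ∀ n : ℕ, ∀ x, |w x| ^ n ≤ C ^ n := fun n x => pow_le_pow_left₀ (abs_nonneg _) (hB x) n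
  -- regularity of the slices
  have hsm := PlanarEigenmode.isSmoothSpaceTimeOn_vorticity h.smooth_velocity hU
  have hw2 : ContDiff ℝ 2 w := contDiff_infty.1 (hsm.contDiff_slice ht) 2
  have hw1 : ContDiff ℝ 1 w := contDiff_infty.1 (hsm.contDiff_slice ht) 1
  have hwd : Differentiable ℝ w := hw1.differentiable one_ne_zero
  have hu1 : ContDiff ℝ 1 (u t) := contDiff_infty.1 (h.contDiff_velocity ht) 1
  have huc : Continuous (u t) := hu1.continuous
  have hwc : Continuous w := hw1.continuous
  have hDwc : Continuous (fderiv ℝ w) := hw1.continuous_fderiv one_ne_zero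
  have hwtc : Continuous wt := hsm.continuous_timeDerivWithin hU ht
  -- integrability of the four products (bounded `ω^{q+1}` against decaying factors)
  have hpow_bdd : ∀ x, |w x ^ (q + 1)| ≤ C ^ (q + 1) := fun x => by
    rw [abs_pow]; exact hBq (q + 1) x
  have hIt : Integrable (fun x => w x ^ (q + 1) * wt x)
      (volume : Measure (EuclideanSpace ℝ (Fin 2))) := by
    refine integrable_of_norm_le_rpow_neg ((hwc.pow (q + 1)).mul hwtc) (C := C ^ (q + 1) * C)
      hKr fun x => ?_
    rw [norm_mul, Real.norm_eq_abs, Real.norm_eq_abs, mul_assoc]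
    exact mul_le_mul (hpow_bdd x) (h3 x) (abs_nonneg _) (pow_nonneg hC _)
  have hIc : Integrable (fun x => w x ^ (q + 1) * fderiv ℝ w x (u t x))
      (volume : Measure (EuclideanSpace ℝ (Fin 2))) := by
    have hM0 : 0 ≤ M := (norm_nonneg _).trans (hM 0)
    refine integrable_of_norm_le_rpow_neg ((hwc.pow (q + 1)).mul (hDwc.clm_apply huc))
      (C := C ^ (q + 1) * (C * M)) hKr fun x => ?_
    rw [norm_mul, Real.norm_eq_abs, Real.norm_eq_abs]
    have hD : |fderiv ℝ w x (u t x)| ≤ C * M * (1 + ‖x‖) ^ (-(K : ℝ)) := by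
      rw [← Real.norm_eq_abs]
      calc ‖fderiv ℝ w x (u t x)‖ ≤ ‖fderiv ℝ w x‖ * ‖u t x‖ := ContinuousLinearMap.le_opNorm _ _
        _ ≤ C * (1 + ‖x‖) ^ (-(K : ℝ)) * M :=
            mul_le_mul (h1 x) (hM x) (norm_nonneg _) (mul_nonneg hC (hw0 x))
        _ = C * M * (1 + ‖x‖) ^ (-(K : ℝ)) := by ring
    calc |w x ^ (q + 1)| * |fderiv ℝ w x (u t x)|
        ≤ C ^ (q + 1) * (C * M * (1 + ‖x‖) ^ (-(K : ℝ))) :=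
          mul_le_mul (hpow_bdd x) hD (abs_nonneg _) (pow_nonneg hC _)
      _ = C ^ (q + 1) * (C * M) * (1 + ‖x‖) ^ (-(K : ℝ)) := by ring
  have hIΔ : Integrable (fun x => w x ^ (q + 1) * (Δ w) x)
      (volume : Measure (EuclideanSpace ℝ (Fin 2))) := by
    refine integrable_of_norm_le_rpow_neg ((hwc.pow (q + 1)).mul (continuous_laplacian hw2))
      (C := C ^ (q + 1) * (Module.finrank ℝ (EuclideanSpace ℝ (Fin 2)) * C)) hKr fun x => ?_
    rw [norm_mul, Real.norm_eq_abs]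
    have hL : ‖(Δ w) x‖ ≤ Module.finrank ℝ (EuclideanSpace ℝ (Fin 2)) * C * (1 + ‖x‖) ^ (-(K : ℝ)) :=
      calc ‖(Δ w) x‖ ≤ Module.finrank ℝ (EuclideanSpace ℝ (Fin 2)) * ‖fderiv ℝ (fderiv ℝ w) x‖ :=
            norm_laplacian_le w x
        _ ≤ Module.finrank ℝ (EuclideanSpace ℝ (Fin 2)) * (C * (1 + ‖x‖) ^ (-(K : ℝ))) := by
            gcongr; exact h2 x
        _ = Module.finrank ℝ (EuclideanSpace ℝ (Fin 2)) * C * (1 + ‖x‖) ^ (-(K : ℝ)) := by ring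
    calc |w x ^ (q + 1)| * ‖(Δ w) x‖
        ≤ C ^ (q + 1) * (Module.finrank ℝ (EuclideanSpace ℝ (Fin 2)) * C * (1 + ‖x‖) ^ (-(K : ℝ))) :=
          mul_le_mul (hpow_bdd x) hL (norm_nonneg _) (pow_nonneg hC _)
      _ = C ^ (q + 1) * (Module.finrank ℝ (EuclideanSpace ℝ (Fin 2)) * C) *
            (1 + ‖x‖) ^ (-(K : ℝ)) := by ring
  -- the vorticity equation (2.6), weighted by `(q+2) ω^{q+1}`
  have hpt : ∀ x, ((q : ℝ) + 2) * w x ^ (q + 1) * g x =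
      ((q : ℝ) + 2) * w x ^ (q + 1) * wt x + ((q : ℝ) + 2) * (w x ^ (q + 1) * fderiv ℝ w x (u t x)) -
        ν * ((q : ℝ) + 2) * (w x ^ (q + 1) * (Δ w) x) := by
    intro x
    have he := h.planarVorticity_eq hU ht x
    rw [convect_apply] at he
    linear_combination (-(((q : ℝ) + 2) * w x ^ (q + 1))) * he
  have hIf : Integrable (fun x => w x ^ (q + 1) * g x)
      (volume : Measure (EuclideanSpace ℝ (Fin 2))) := by
    have hI : Integrable (fun x =>
        ((q : ℝ) + 2) * w x ^ (q + 1) * wt x + ((q : ℝ) + 2) * (w x ^ (q + 1) * fderiv ℝ w x (u t x)) -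
          ν * ((q : ℝ) + 2) * (w x ^ (q + 1) * (Δ w) x))
        (volume : Measure (EuclideanSpace ℝ (Fin 2))) := by
      have e : (fun x => ((q : ℝ) + 2) * w x ^ (q + 1) * wt x) =
          fun x => ((q : ℝ) + 2) * (w x ^ (q + 1) * wt x) := by funext x; ring
      have hIt' : Integrable (fun x => ((q : ℝ) + 2) * w x ^ (q + 1) * wt x)
          (volume : Measure (EuclideanSpace ℝ (Fin 2))) := by
        rw [e]; exact hIt.const_mul _
      exact (hIt'.add (hIc.const_mul _)).sub (hIΔ.const_mul _)
    have hI' : Integrable (fun x => ((q : ℝ) + 2) * w x ^ (q + 1) * g x)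
        (volume : Measure (EuclideanSpace ℝ (Fin 2))) :=
      hI.congr (Eventually.of_forall fun x => (hpt x).symm)
    have e2 : (fun x => w x ^ (q + 1) * g x) =
        fun x => ((q : ℝ) + 2)⁻¹ * (((q : ℝ) + 2) * w x ^ (q + 1) * g x) := by
      funext x
      have hq : ((q : ℝ) + 2) ≠ 0 := by positivity
      field_simp
    rw [e2]
    exact hI'.const_mul _
  refine ⟨hIf, ?_⟩
  -- the transport term vanishes: `∫ D(ω^{q+2})(u) = 0`
  have htrans : ∫ x, w x ^ (q + 1) * fderiv ℝ w x (u t x) = 0 := by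
    have hθ : ContDiff ℝ 1 (fun y => w y ^ (q + 2)) := hw1.pow (q + 2)
    have hθ0 : ∀ x, |w x ^ (q + 2)| ≤ C ^ (q + 1) * C * (1 + ‖x‖) ^ (-(K : ℝ)) := by
      intro x
      rw [pow_succ, abs_mul, mul_assoc]
      exact mul_le_mul (hpow_bdd x) (h0 x) (abs_nonneg _) (pow_nonneg hC _)
    have hθ1 : ∀ x, ‖fderiv ℝ (fun y => w y ^ (q + 2)) x‖ ≤
        ((q : ℝ) + 2) * C ^ (q + 1) * C * (1 + ‖x‖) ^ (-(K : ℝ)) := by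
      intro x
      rw [show q + 2 = (q + 1) + 1 from rfl, fderiv_pow_succ_apply hwd (q + 1) x, norm_smul,
        Real.norm_eq_abs, abs_mul, abs_pow, Nat.cast_add, Nat.cast_one,
        abs_of_nonneg (by positivity : (0 : ℝ) ≤ (q : ℝ) + 1 + 1)]
      calc ((q : ℝ) + 1 + 1) * |w x| ^ (q + 1) * ‖fderiv ℝ w x‖
          ≤ ((q : ℝ) + 1 + 1) * C ^ (q + 1) * (C * (1 + ‖x‖) ^ (-(K : ℝ))) := by
            gcongr
            · exact hB x
            · exact h1 x
        _ = ((q : ℝ) + 2) * C ^ (q + 1) * C * (1 + ‖x‖) ^ (-(K : ℝ)) := by ring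
    -- one constant for `θ = ω^{q+2}` and `Dθ`
    set C' : ℝ := ((q : ℝ) + 2) * C ^ (q + 1) * C with hC'
    have hle' : C ^ (q + 1) * C ≤ C' := by
      rw [hC']
      have : (1 : ℝ) * (C ^ (q + 1) * C) ≤ ((q : ℝ) + 2) * (C ^ (q + 1) * C) :=
        mul_le_mul_of_nonneg_right (by linarith [(Nat.cast_nonneg q : (0 : ℝ) ≤ q)])
          (by positivity)
      linarith
    have hθ0' : ∀ x, |w x ^ (q + 2)| ≤ C' * (1 + ‖x‖) ^ (-(K : ℝ)) := fun x =>
      le_decay_of_le_decay x (hθ0 x) hle'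
    have hone : ContDiff ℝ 1 (fun _ : EuclideanSpace ℝ (Fin 2) => (1 : ℝ)) := contDiff_const
    have hone0 : ∀ x : EuclideanSpace ℝ (Fin 2), |(1 : ℝ)| ≤ 1 * (1 + ‖x‖) ^ (0 : ℕ) := fun x => by
      simp
    have hone1 : ∀ x : EuclideanSpace ℝ (Fin 2),
        ‖gradient (fun _ : EuclideanSpace ℝ (Fin 2) => (1 : ℝ)) x‖ ≤ 1 * (1 + ‖x‖) ^ (0 : ℕ) := by
      intro x
      rw [gradient, fderiv_const_apply, map_zero, norm_zero, pow_zero, mul_one]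
      exact zero_le_one
    have H := integral_mul_fderiv_apply_eq_neg_of_decay (hu1) hθ hone (h.divFree t ht) hM
      hone0 hone1 hθ0' hθ1
    have hzero : ∫ x, (1 : ℝ) * fderiv ℝ (fun y => w y ^ (q + 2)) x (u t x) = 0 := by
      rw [H]
      simp [gradient, fderiv_const_apply]
    have e : ∫ x, (1 : ℝ) * fderiv ℝ (fun y => w y ^ (q + 2)) x (u t x) =
        ((q : ℝ) + 2) * ∫ x, w x ^ (q + 1) * fderiv ℝ w x (u t x) := by
      rw [← integral_const_mul]
      refine integral_congr_ae (Eventually.of_forall fun x => ?_)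
      dsimp only
      rw [one_mul, show q + 2 = (q + 1) + 1 from rfl, fderiv_pow_succ_apply hwd (q + 1) x,
        _root_.smul_apply, smul_eq_mul, Nat.cast_add, Nat.cast_one]
      ring
    rw [e] at hzero
    have hq : ((q : ℝ) + 2) ≠ 0 := by positivity
    exact (mul_eq_zero.1 hzero).resolve_left hq
  -- the viscous term: `∫ ω^{q+1} Δω = −(q+1) ∫ ω^q ‖∇ω‖²`
  have hvisc : ∫ x, w x ^ (q + 1) * (Δ w) x =
      -(((q : ℝ) + 1) * ∫ x, w x ^ q * ‖fderiv ℝ w x‖ ^ 2) :=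
    integral_pow_succ_mul_laplacian_eq hw2 hC hKr h0 h1 h2 q
  -- assemble
  have hkey : ∀ x, ((q : ℝ) + 2) * w x ^ (q + 1) * wt x =
      -(((q : ℝ) + 2) * (w x ^ (q + 1) * fderiv ℝ w x (u t x))) +
          ν * ((q : ℝ) + 2) * (w x ^ (q + 1) * (Δ w) x) +
        ((q : ℝ) + 2) * (w x ^ (q + 1) * g x) := fun x => by
    linear_combination (-1 : ℝ) * hpt x
  have hI1 : Integrable (fun x => -(((q : ℝ) + 2) * (w x ^ (q + 1) * fderiv ℝ w x (u t x))))
      (volume : Measure (EuclideanSpace ℝ (Fin 2))) := (hIc.const_mul _).neg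
  have hI2 : Integrable (fun x => ν * ((q : ℝ) + 2) * (w x ^ (q + 1) * (Δ w) x))
      (volume : Measure (EuclideanSpace ℝ (Fin 2))) := hIΔ.const_mul _
  have hI3 : Integrable (fun x => ((q : ℝ) + 2) * (w x ^ (q + 1) * g x))
      (volume : Measure (EuclideanSpace ℝ (Fin 2))) := hIf.const_mul _
  have hI12 : Integrable (fun x => -(((q : ℝ) + 2) * (w x ^ (q + 1) * fderiv ℝ w x (u t x))) +
      ν * ((q : ℝ) + 2) * (w x ^ (q + 1) * (Δ w) x))
      (volume : Measure (EuclideanSpace ℝ (Fin 2))) := hI1.add hI2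
  have eI : ∫ x, ((q : ℝ) + 2) * w x ^ (q + 1) * wt x =
      -(((q : ℝ) + 2) * ∫ x, w x ^ (q + 1) * fderiv ℝ w x (u t x)) +
          ν * ((q : ℝ) + 2) * (∫ x, w x ^ (q + 1) * (Δ w) x) +
        ((q : ℝ) + 2) * ∫ x, w x ^ (q + 1) * g x := by
    rw [integral_congr_ae (Eventually.of_forall hkey), integral_add hI12 hI3,
      integral_add hI1 hI2, integral_neg, integral_const_mul, integral_const_mul,
      integral_const_mul]
  rw [eI, htrans, hvisc]
  ring

/-! ### §3 The `L^{q+2}` laws: differentiation under the integral sign within the time set -/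

/-- **The `L^{q+2}` law.** On a CONVEX time set `S`, for a classical planar solution whose
vorticity has uniform rapid decay on `S`, with `u(t)` bounded: for every `q : ℕ` the function
`s ↦ ∫ ω(s)^{q+2}` has within `S` at `t` the derivative
`−ν (q+2)(q+1) ∫ ω(t)^q ‖∇ω(t)‖² + (q+2) ∫ ω(t)^{q+1} curl f(t)` (differentiation under the
integral sign, dominated by the uniform decay of `∂ₜω` and the uniform bound on `ω`; then the
fixed-time balance). For `q = 0`: `d/dt ∫ ω² = −2ν ∫ ‖∇ω‖² + 2 ∫ ω curl f` (enstrophy);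
`q = 2`: `d/dt ∫ ω⁴ = −12ν ∫ ω² ‖∇ω‖² + 4 ∫ ω³ curl f`.
[cite: CarlenLoss1995, §1 (L^p energy identity for the 2-D vorticity equation); GallayWayne2005, Thm. 1.1 eq. (1.2) (proof ingredients)] -/
theorem IsClassicalNSSolutionOn.hasDerivWithinAt_integral_pow_planarVorticity
    (h : IsClassicalNSSolutionOn S ν f u p) (hS : Convex ℝ S)
    (hω : HasUniformRapidDecayOn S (fun t x => PlanarEigenmode.vorticity (u t) x)) {t : ℝ}
    (ht : t ∈ S) {M : ℝ} (hM : ∀ x, ‖u t x‖ ≤ M) (q : ℕ) :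
    HasDerivWithinAt (fun s => ∫ x, PlanarEigenmode.vorticity (u s) x ^ (q + 2))
      (-(ν * (((q : ℝ) + 2) * ((q : ℝ) + 1)) *
            ∫ x, PlanarEigenmode.vorticity (u t) x ^ q *
              ‖fderiv ℝ (PlanarEigenmode.vorticity (u t)) x‖ ^ 2) +
          ((q : ℝ) + 2) * ∫ x, PlanarEigenmode.vorticity (u t) x ^ (q + 1) *
            PlanarEigenmode.vorticity (f t) x) S t := by
  -- isolated points of `S`: the statement is empty
  by_cases hacc : AccPt t (𝓟 S)
  swap
  · exact hasDerivWithinAt_iff_hasFDerivWithinAt.2 (HasFDerivWithinAt.of_not_accPt hacc)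
  have hU : UniqueDiffOn ℝ S := uniqueDiffOn_of_convex_of_accPt hS ht hacc
  have hsm := PlanarEigenmode.isSmoothSpaceTimeOn_vorticity h.smooth_velocity hU
  obtain ⟨C, hC, hdec⟩ := exists_planarVorticity_decay_const₃ h.smooth_velocity hU hω
  set K : ℕ := 0 + (Module.finrank ℝ (EuclideanSpace ℝ (Fin 2)) + 1) with hK
  have hKr : (Module.finrank ℝ (EuclideanSpace ℝ (Fin 2)) : ℝ) < (K : ℝ) := finrank_lt_weightExp
  have hK0 : (0 : ℝ) ≤ (K : ℝ) := Nat.cast_nonneg _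
  have hw0 : ∀ x : EuclideanSpace ℝ (Fin 2), 0 ≤ (1 + ‖x‖) ^ (-(K : ℝ)) := fun x =>
    Real.rpow_nonneg (by positivity) _
  -- the uniform bound `|ω| ≤ C` on `S × ℝ²`
  have hB : ∀ s ∈ S, ∀ x, |PlanarEigenmode.vorticity (u s) x| ≤ C := fun s hs x =>
    (hdec s hs x).1.trans (mul_le_of_le_one_right hC (rpow_neg_le_one x hK0))
  have hBq : ∀ s ∈ S, ∀ x, |PlanarEigenmode.vorticity (u s) x ^ (q + 1)| ≤ C ^ (q + 1) :=
    fun s hs x => by rw [abs_pow]; exact pow_le_pow_left₀ (abs_nonneg _) (hB s hs x) _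
  -- the dominating function
  set bound : EuclideanSpace ℝ (Fin 2) → ℝ := fun x =>
    ((q : ℝ) + 2) * C ^ (q + 1) * (C * (1 + ‖x‖) ^ (-(K : ℝ))) with hbound
  have hbc : Continuous bound := by
    have h1 : Continuous fun x : EuclideanSpace ℝ (Fin 2) => (1 + ‖x‖) := by fun_prop
    exact continuous_const.mul (continuous_const.mul (h1.rpow_const fun x => Or.inl (by positivity)))
  have hbi : Integrable bound (volume : Measure (EuclideanSpace ℝ (Fin 2))) :=
    integrable_of_norm_le_rpow_neg hbc (C := ((q : ℝ) + 2) * C ^ (q + 1) * C) hKr fun x => by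
      rw [Real.norm_of_nonneg (by positivity)]
      exact le_of_eq (by rw [hbound]; ring)
  -- differentiate under the integral sign within `S`
  have hF_meas : ∀ s ∈ S, AEStronglyMeasurable (fun x => PlanarEigenmode.vorticity (u s) x ^ (q + 2))
      (volume : Measure (EuclideanSpace ℝ (Fin 2))) :=
    fun s hs => ((hsm.continuous_slice hs).pow _).aestronglyMeasurable
  have hF_int : Integrable (fun x => PlanarEigenmode.vorticity (u t) x ^ (q + 2))
      (volume : Measure (EuclideanSpace ℝ (Fin 2))) := by
    refine integrable_of_norm_le_rpow_neg ((hsm.continuous_slice ht).pow _) (C := C ^ (q + 1) * C)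
      hKr fun x => ?_
    rw [Real.norm_eq_abs, pow_succ, abs_mul, mul_assoc]
    exact mul_le_mul (hBq t ht x) (hdec t ht x).1 (abs_nonneg _) (pow_nonneg hC _)
  have h_bound : ∀ s ∈ S, ∀ x,
      ‖((q : ℝ) + 2) * PlanarEigenmode.vorticity (u s) x ^ (q + 1) *
        timeDerivWithin S (fun r y => PlanarEigenmode.vorticity (u r) y) s x‖ ≤ bound x := by
    intro s hs x
    have hq2 : (0 : ℝ) ≤ (q : ℝ) + 2 := by positivity
    rw [hbound, norm_mul, norm_mul, Real.norm_of_nonneg hq2, Real.norm_eq_abs, Real.norm_eq_abs]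
    dsimp only
    have hprod := mul_le_mul (hBq s hs x) (hdec s hs x).2.2.2 (abs_nonneg _) (pow_nonneg hC _)
    calc ((q : ℝ) + 2) * |PlanarEigenmode.vorticity (u s) x ^ (q + 1)| *
          |timeDerivWithin S (fun r y => PlanarEigenmode.vorticity (u r) y) s x|
        = ((q : ℝ) + 2) * (|PlanarEigenmode.vorticity (u s) x ^ (q + 1)| *
          |timeDerivWithin S (fun r y => PlanarEigenmode.vorticity (u r) y) s x|) := mul_assoc _ _ _
      _ ≤ ((q : ℝ) + 2) * (C ^ (q + 1) * (C * (1 + ‖x‖) ^ (-(K : ℝ)))) :=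
          mul_le_mul_of_nonneg_left hprod hq2
      _ = ((q : ℝ) + 2) * C ^ (q + 1) * (C * (1 + ‖x‖) ^ (-(K : ℝ))) := by ring
  have h_diff : ∀ s ∈ S, ∀ x, HasDerivWithinAt (fun r => PlanarEigenmode.vorticity (u r) x ^ (q + 2))
      (((q : ℝ) + 2) * PlanarEigenmode.vorticity (u s) x ^ (q + 1) *
        timeDerivWithin S (fun r y => PlanarEigenmode.vorticity (u r) y) s x) S s := by
    intro s hs x
    have hpow := (hsm.hasDerivWithinAt_timeDerivWithin hU hs x).fun_pow (q + 2)
    have e : (((q + 2 : ℕ) : ℝ)) * PlanarEigenmode.vorticity (u s) x ^ (q + 2 - 1) *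
        timeDerivWithin S (fun r y => PlanarEigenmode.vorticity (u r) y) s x =
        ((q : ℝ) + 2) * PlanarEigenmode.vorticity (u s) x ^ (q + 1) *
          timeDerivWithin S (fun r y => PlanarEigenmode.vorticity (u r) y) s x := by
      rw [show q + 2 - 1 = q + 1 by omega]
      push_cast
      ring
    rw [e] at hpow
    exact hpow
  have hD := hasDerivWithinAt_integral_of_dominated_convex hS ht
    (F := fun s x => PlanarEigenmode.vorticity (u s) x ^ (q + 2))
    (F' := fun s x => ((q : ℝ) + 2) * PlanarEigenmode.vorticity (u s) x ^ (q + 1) *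
      timeDerivWithin S (fun r y => PlanarEigenmode.vorticity (u r) y) s x)
    hF_meas hF_int h_bound hbi h_diff
  exact hD.congr_deriv (h.integral_pow_mul_timeDerivWithin_planarVorticity_eq hU hω ht hM q).2

/-- **The enstrophy law** (`q = 0`): within a convex time set,
`d/dt ∫ ω² = −2ν ∫ ‖∇ω‖² + 2 ∫ ω curl f` (Majda–Bertozzi §3.1.1 energy method applied to the
scalar vorticity; Carlen–Loss 1995, §1).
[cite: CarlenLoss1995, §1 (L^p energy identity for the 2-D vorticity equation)] -/
theorem IsClassicalNSSolutionOn.hasDerivWithinAt_integral_sq_planarVorticity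
    (h : IsClassicalNSSolutionOn S ν f u p) (hS : Convex ℝ S)
    (hω : HasUniformRapidDecayOn S (fun t x => PlanarEigenmode.vorticity (u t) x)) {t : ℝ}
    (ht : t ∈ S) {M : ℝ} (hM : ∀ x, ‖u t x‖ ≤ M) :
    HasDerivWithinAt (fun s => ∫ x, PlanarEigenmode.vorticity (u s) x ^ 2)
      (-(2 * ν * ∫ x, ‖fderiv ℝ (PlanarEigenmode.vorticity (u t)) x‖ ^ 2) +
          2 * ∫ x, PlanarEigenmode.vorticity (u t) x * PlanarEigenmode.vorticity (f t) x) S t := by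
  have hD := h.hasDerivWithinAt_integral_pow_planarVorticity hS hω ht hM 0
  simp only [pow_zero, one_mul, Nat.cast_zero, zero_add, pow_one] at hD
  convert hD using 2
  ring

/-- **The `L⁴` law** (`q = 2`): within a convex time set,
`d/dt ∫ ω⁴ = −12ν ∫ ω² ‖∇ω‖² + 4 ∫ ω³ curl f` (Carlen–Loss 1995, §1).
[cite: CarlenLoss1995, §1 (L^p energy identity for the 2-D vorticity equation)] -/
theorem IsClassicalNSSolutionOn.hasDerivWithinAt_integral_pow_four_planarVorticity
    (h : IsClassicalNSSolutionOn S ν f u p) (hS : Convex ℝ S)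
    (hω : HasUniformRapidDecayOn S (fun t x => PlanarEigenmode.vorticity (u t) x)) {t : ℝ}
    (ht : t ∈ S) {M : ℝ} (hM : ∀ x, ‖u t x‖ ≤ M) :
    HasDerivWithinAt (fun s => ∫ x, PlanarEigenmode.vorticity (u s) x ^ 4)
      (-(12 * ν * ∫ x, PlanarEigenmode.vorticity (u t) x ^ 2 *
            ‖fderiv ℝ (PlanarEigenmode.vorticity (u t)) x‖ ^ 2) +
          4 * ∫ x, PlanarEigenmode.vorticity (u t) x ^ 3 * PlanarEigenmode.vorticity (f t) x)
      S t := by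
  have hD := h.hasDerivWithinAt_integral_pow_planarVorticity hS hω ht hM 2
  convert hD using 2
  · push_cast; ring
  · norm_num

/-! ### §4 The `L²` and `L⁴` decay estimates under an `L¹` bound (signed vorticity) -/

/-- A convex time set containing two distinct times is a set of unique differentiability.
[folklore] -/
private theorem uniqueDiffOn_of_convex_of_lt (hS : Convex ℝ S) {t₀ t : ℝ} (ht₀ : t₀ ∈ S)
    (ht : t ∈ S) (htt : t₀ < t) : UniqueDiffOn ℝ S :=
  uniqueDiffOn_convex hS ⟨(t₀ + t) / 2, interior_mono (hS.ordConnected.out ht₀ ht) (by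
    rw [interior_Icc]; exact ⟨by linarith, by linarith⟩)⟩

/-- The weight exponent `dim ℝ² + 1 = 3` exceeds `2`. [folklore] -/
private theorem two_lt_weightExp :
    (2 : ℝ) < ((0 + (Module.finrank ℝ (EuclideanSpace ℝ (Fin 2)) + 1) : ℕ) : ℝ) := by
  rw [finrank_euclideanSpace_fin]; push_cast; norm_num

/-- The derivative of the square of a scalar field: `D(ω²)(x) = (2 ω(x)) • Dω(x)`. [folklore] -/
private theorem fderiv_sq_apply {X : Type*} [NormedAddCommGroup X] [NormedSpace ℝ X]
    {w : X → ℝ} (hw : Differentiable ℝ w) (x : X) :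
    fderiv ℝ (fun y => w y ^ 2) x = (2 * w x) • fderiv ℝ w x := by
  have h := ((hw x).hasFDerivAt).pow 2
  rw [h.fderiv, show (2 - 1 : ℕ) = 1 from rfl, pow_one, nsmul_eq_mul, Nat.cast_ofNat]

/-- `‖D(ω²)(x)‖² = 4 ω(x)² ‖Dω(x)‖²`. [folklore] -/
private theorem norm_fderiv_sq_pow_two {X : Type*} [NormedAddCommGroup X] [NormedSpace ℝ X]
    {w : X → ℝ} (hw : Differentiable ℝ w) (x : X) :
    ‖fderiv ℝ (fun y => w y ^ 2) x‖ ^ 2 = 4 * w x ^ 2 * ‖fderiv ℝ w x‖ ^ 2 := by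
  rw [fderiv_sq_apply hw x, norm_smul, mul_pow, Real.norm_eq_abs, sq_abs]
  ring

/-- Mathlib's planar Nash inequality for decaying `C¹` functions (`PlanarNashInequalityWholeSpace`,
constant `4 C_GNS`) in the shape of the generic hypothesis `hNash` of the `_of_nashConst` theorems
below (v5). [folklore] -/
private theorem nash_of_decay_mathlib ⦃g : EuclideanSpace ℝ (Fin 2) → ℝ⦄ (hg : ContDiff ℝ 1 g)
    ⦃A r : ℝ⦄ (hr : 2 < r) (h0 : ∀ x, |g x| ≤ A * (1 + ‖x‖) ^ (-r))
    (h1 : ∀ x, ‖fderiv ℝ g x‖ ≤ A * (1 + ‖x‖) ^ (-r)) :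
    (∫ x, g x ^ 2) ^ 2 ≤
      4 * (lintegralPowLePowLIntegralFDerivConst (volume : Measure (EuclideanSpace ℝ (Fin 2))) 2 : ℝ) *
        (∫ x, |g x|) ^ 2 * ∫ x, ‖fderiv ℝ g x‖ ^ 2 :=
  sq_integral_sq_le_nash_of_decay hg hr h0 h1

/-- The EXPLICIT planar Nash inequality `(∫g²)² ≤ ½ (∫|g|)² ∫‖∇g‖²` of
`PlanarSobolev.sq_integral_sq_le_half_of_decay` (cell `ns-blowup`, lit3 g9, p491674) in the shape of
the generic hypothesis `hNash` with `Cg = 1/8` (`4 · (1/8) = 1/2`). [cite: Nash1958, the inequality (planar case, constant made explicit)] -/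
private theorem nash_of_decay_eighth ⦃g : EuclideanSpace ℝ (Fin 2) → ℝ⦄ (hg : ContDiff ℝ 1 g)
    ⦃A r : ℝ⦄ (hr : 2 < r) (h0 : ∀ x, |g x| ≤ A * (1 + ‖x‖) ^ (-r))
    (h1 : ∀ x, ‖fderiv ℝ g x‖ ≤ A * (1 + ‖x‖) ^ (-r)) :
    (∫ x, g x ^ 2) ^ 2 ≤ 4 * (1 / 8 : ℝ) * (∫ x, |g x|) ^ 2 * ∫ x, ‖fderiv ℝ g x‖ ^ 2 := by
  have h := PlanarSobolev.sq_integral_sq_le_half_of_decay hg hr h0 h1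
  linarith

/-- **`L²` decay under an `L¹` bound, generic Nash constant** (v5). The statement of
`integral_sq_planarVorticity_le_of_integral_abs_le` with Mathlib's `C_GNS` replaced by ANY constant
`Cg ≥ 0` for which the planar Nash inequality `(∫g²)² ≤ 4 Cg (∫|g|)² ∫‖∇g‖²` holds on decaying `C¹`
functions (hypothesis `hNash`; e.g. `Cg = 1/8`, `PlanarSobolev.sq_integral_sq_le_half_of_decay`):
`‖ω(t)‖²_{L²} ≤ 2 Cg m² / (ν (t − t₀))`. Same proof (Nash's argument).
[cite: GallayWayne2005, Thm. 1.1 eq. (1.2) (p = 2; after Ben-Artzi 1994, Kato 1994); Nash1958, the inequality and the ODE argument] -/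
theorem IsClassicalNSSolutionOn.integral_sq_planarVorticity_le_of_integral_abs_le_of_nashConst
    (h : IsClassicalNSSolutionOn S ν f u p) (hS : Convex ℝ S) (hν : 0 < ν)
    (hcurl : ∀ t ∈ S, ∀ x, PlanarEigenmode.vorticity (f t) x = 0)
    (hω : HasUniformRapidDecayOn S (fun t x => PlanarEigenmode.vorticity (u t) x))
    (hbdd : ∀ t ∈ S, ∃ M : ℝ, ∀ x, ‖u t x‖ ≤ M) {Cg : ℝ} (hCg0 : 0 ≤ Cg)
    (hNash : ∀ ⦃g : EuclideanSpace ℝ (Fin 2) → ℝ⦄, ContDiff ℝ 1 g → ∀ ⦃A r : ℝ⦄, 2 < r →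
      (∀ x, |g x| ≤ A * (1 + ‖x‖) ^ (-r)) → (∀ x, ‖fderiv ℝ g x‖ ≤ A * (1 + ‖x‖) ^ (-r)) →
      (∫ x, g x ^ 2) ^ 2 ≤ 4 * Cg * (∫ x, |g x|) ^ 2 * ∫ x, ‖fderiv ℝ g x‖ ^ 2)
    {t₀ t : ℝ} (ht₀ : t₀ ∈ S) (ht : t ∈ S)
    (htt : t₀ < t) {m : ℝ}
    (hm : ∀ s ∈ Icc t₀ t, ∫ x, |PlanarEigenmode.vorticity (u s) x| ≤ m) :
    ∫ x, PlanarEigenmode.vorticity (u t) x ^ 2 ≤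
      2 * Cg *
        m ^ 2 / (ν * (t - t₀)) := by
  have hsub : Icc t₀ t ⊆ S := hS.ordConnected.out ht₀ ht
  have hU : UniqueDiffOn ℝ S := uniqueDiffOn_of_convex_of_lt hS ht₀ ht htt
  have hsm := PlanarEigenmode.isSmoothSpaceTimeOn_vorticity h.smooth_velocity hU
  obtain ⟨C, hC, hdec⟩ := exists_planarVorticity_decay_const₃ h.smooth_velocity hU hω
  set K : ℕ := 0 + (Module.finrank ℝ (EuclideanSpace ℝ (Fin 2)) + 1) with hK
  have hK2 : (2 : ℝ) < (K : ℝ) := two_lt_weightExp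
  -- the two functionals
  set y : ℝ → ℝ := fun s => ∫ x, PlanarEigenmode.vorticity (u s) x ^ 2 with hy_def
  set D : ℝ → ℝ := fun s => ∫ x, ‖fderiv ℝ (PlanarEigenmode.vorticity (u s)) x‖ ^ 2 with hD_def
  have hy0 : ∀ s ∈ Icc t₀ t, 0 ≤ y s := fun s _ => integral_nonneg fun x => sq_nonneg _
  have hD0 : ∀ s ∈ Icc t₀ t, 0 ≤ D s := fun s _ => integral_nonneg fun x => sq_nonneg _
  -- the enstrophy law, force-free, restricted to `[t₀, t]`
  have hy : ∀ s ∈ Icc t₀ t, HasDerivWithinAt y (-(2 * ν * D s)) (Icc t₀ t) s := by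
    intro s hs
    obtain ⟨M, hM⟩ := hbdd s (hsub hs)
    have h1 := h.hasDerivWithinAt_integral_sq_planarVorticity hS hω (hsub hs) hM
    have e0 : ∫ x, PlanarEigenmode.vorticity (u s) x * PlanarEigenmode.vorticity (f s) x = 0 := by
      simp [hcurl s (hsub hs)]
    rw [e0, mul_zero, add_zero] at h1
    exact h1.mono hsub
  -- Nash at each time
  have hN : ∀ s ∈ Icc t₀ t, y s ^ 2 ≤ 4 * Cg * m ^ 2 * D s := by
    intro s hs
    have hsS := hsub hs
    have hw1 : ContDiff ℝ 1 (PlanarEigenmode.vorticity (u s)) :=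
      contDiff_infty.1 (hsm.contDiff_slice hsS) 1
    have hn := hNash hw1 hK2 (fun x => (hdec s hsS x).1)
      (fun x => (hdec s hsS x).2.1)
    have h0m : 0 ≤ ∫ x, |PlanarEigenmode.vorticity (u s) x| := integral_nonneg fun x => abs_nonneg _
    calc y s ^ 2 ≤ 4 * Cg * (∫ x, |PlanarEigenmode.vorticity (u s) x|) ^ 2 * D s := hn
      _ ≤ 4 * Cg * m ^ 2 * D s := by
          have := hm s hs
          have hD := hD0 s hs
          gcongr
  have hRHS : 0 ≤ 2 * Cg * m ^ 2 / (ν * (t - t₀)) := by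
    have : 0 < t - t₀ := sub_pos.2 htt
    positivity
  have htI : t ∈ Icc t₀ t := right_mem_Icc.2 htt.le
  by_cases hKm : 4 * Cg * m ^ 2 = 0
  · -- degenerate constant: Nash forces `y(t) = 0`
    have h1 := hN t htI
    rw [hKm, zero_mul] at h1
    have hyt : y t = 0 := pow_eq_zero_iff (two_ne_zero) |>.1 (le_antisymm h1 (sq_nonneg _))
    exact hyt.le.trans hRHS
  · have hKm' : 0 < 4 * Cg * m ^ 2 := lt_of_le_of_ne (by positivity) (Ne.symm hKm)
    set k : ℝ := 2 * ν / (4 * Cg * m ^ 2) with hk_def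
    have hk : 0 < k := by positivity
    have hle : ∀ s ∈ Icc t₀ t, -(2 * ν * D s) ≤ -(k * y s ^ 2) := by
      intro s hs
      rw [neg_le_neg_iff, hk_def, div_mul_eq_mul_div, div_le_iff₀ hKm']
      have h1 := hN s hs
      nlinarith [hν.le]
    have hODE := le_one_div_of_hasDerivWithinAt_le_neg_mul_sq hk hy hy0 hle (s := t) ⟨htt, le_rfl⟩
    calc y t ≤ 1 / (k * (t - t₀)) := hODE
      _ = 2 * Cg * m ^ 2 / (ν * (t - t₀)) := by
          rw [hk_def]
          have h1 : (t - t₀) ≠ 0 := (sub_pos.2 htt).ne'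
          field_simp
          ring

/-- **`L²` decay of a planar viscous vorticity under an `L¹` bound (Gallay–Wayne 2005, (1.2),
`p = 2`).** Let `(u, p)` be a classical planar Navier–Stokes solution on a convex time set `S` with
`ν > 0` and curl-free force, whose vorticity `ω` has uniform rapid decay on `S`, with `u(s)`
bounded at each time. If `‖ω(s)‖_{L¹} ≤ m` for all `s ∈ [t₀, t] ⊆ S` (`t₀ < t`), then
`‖ω(t)‖²_{L²} ≤ 2 C_GNS m² / (ν (t − t₀))` — Nash's argument: `d/ds ‖ω‖₂² = −2ν ‖∇ω‖₂²` and
`‖ω‖₂⁴ ≤ 4 C_GNS ‖ω‖₁² ‖∇ω‖₂²` give `y' ≤ −(ν / 2 C_GNS m²) y²`. The printed statement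
(`ω₀ ∈ L¹`, mild solutions, `‖ω(t)‖_p ≤ C_p ‖ω₀‖₁ t^{−(1−1/p)}`) is typed for classical rapidly
decaying solutions with the running `L¹` bound as the hypothesis (for signed data
`‖ω(s)‖₁ ≤ ‖ω(t₀)‖₁`; for `ω(t₀) ≥ 0` it is the conserved circulation, §5).
[cite: GallayWayne2005, Thm. 1.1 eq. (1.2) (p = 2; after Ben-Artzi 1994, Kato 1994); CarlenLoss1995, Introduction (optimal L^p smoothing of the 2-D vorticity equation, cited via GallayWayne2005 §1)] -/
theorem IsClassicalNSSolutionOn.integral_sq_planarVorticity_le_of_integral_abs_le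
    (h : IsClassicalNSSolutionOn S ν f u p) (hS : Convex ℝ S) (hν : 0 < ν)
    (hcurl : ∀ t ∈ S, ∀ x, PlanarEigenmode.vorticity (f t) x = 0)
    (hω : HasUniformRapidDecayOn S (fun t x => PlanarEigenmode.vorticity (u t) x))
    (hbdd : ∀ t ∈ S, ∃ M : ℝ, ∀ x, ‖u t x‖ ≤ M) {t₀ t : ℝ} (ht₀ : t₀ ∈ S) (ht : t ∈ S)
    (htt : t₀ < t) {m : ℝ}
    (hm : ∀ s ∈ Icc t₀ t, ∫ x, |PlanarEigenmode.vorticity (u s) x| ≤ m) :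
    ∫ x, PlanarEigenmode.vorticity (u t) x ^ 2 ≤
      2 * (lintegralPowLePowLIntegralFDerivConst (volume : Measure (EuclideanSpace ℝ (Fin 2))) 2 : ℝ) *
        m ^ 2 / (ν * (t - t₀))  :=
  h.integral_sq_planarVorticity_le_of_integral_abs_le_of_nashConst hS hν hcurl hω hbdd (NNReal.coe_nonneg _)
    nash_of_decay_mathlib ht₀ ht htt hm

/-- **`L⁴` decay under an `L¹` bound, generic Nash constant** (v5):
`‖ω(t)‖⁴_{L⁴} ≤ (128/3) Cg³ m⁴ / (ν (t − t₀))³` for any admissible Nash constant `Cg` (hypothesis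
`hNash`), by the second Nash–Moser step of `integral_pow_four_planarVorticity_le_of_integral_abs_le`.
[cite: GallayWayne2005, Thm. 1.1 eq. (1.2) (p = 4; after Ben-Artzi 1994, Kato 1994); Nash1958, the inequality and the ODE argument] -/
theorem IsClassicalNSSolutionOn.integral_pow_four_planarVorticity_le_of_integral_abs_le_of_nashConst
    (h : IsClassicalNSSolutionOn S ν f u p) (hS : Convex ℝ S) (hν : 0 < ν)
    (hcurl : ∀ t ∈ S, ∀ x, PlanarEigenmode.vorticity (f t) x = 0)
    (hω : HasUniformRapidDecayOn S (fun t x => PlanarEigenmode.vorticity (u t) x))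
    (hbdd : ∀ t ∈ S, ∃ M : ℝ, ∀ x, ‖u t x‖ ≤ M) {Cg : ℝ} (hCg0 : 0 ≤ Cg)
    (hNash : ∀ ⦃g : EuclideanSpace ℝ (Fin 2) → ℝ⦄, ContDiff ℝ 1 g → ∀ ⦃A r : ℝ⦄, 2 < r →
      (∀ x, |g x| ≤ A * (1 + ‖x‖) ^ (-r)) → (∀ x, ‖fderiv ℝ g x‖ ≤ A * (1 + ‖x‖) ^ (-r)) →
      (∫ x, g x ^ 2) ^ 2 ≤ 4 * Cg * (∫ x, |g x|) ^ 2 * ∫ x, ‖fderiv ℝ g x‖ ^ 2)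
    {t₀ t : ℝ} (ht₀ : t₀ ∈ S) (ht : t ∈ S)
    (htt : t₀ < t) {m : ℝ}
    (hm : ∀ s ∈ Icc t₀ t, ∫ x, |PlanarEigenmode.vorticity (u s) x| ≤ m) :
    ∫ x, PlanarEigenmode.vorticity (u t) x ^ 4 ≤
      128 / 3 * Cg ^ 3 * m ^ 4 / (ν * (t - t₀)) ^ 3 := by
  have hsub : Icc t₀ t ⊆ S := hS.ordConnected.out ht₀ ht
  have hU : UniqueDiffOn ℝ S := uniqueDiffOn_of_convex_of_lt hS ht₀ ht htt
  have hsm := PlanarEigenmode.isSmoothSpaceTimeOn_vorticity h.smooth_velocity hU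
  obtain ⟨C, hC, hdec⟩ := exists_planarVorticity_decay_const₃ h.smooth_velocity hU hω
  set K : ℕ := 0 + (Module.finrank ℝ (EuclideanSpace ℝ (Fin 2)) + 1) with hK
  have hK2 : (2 : ℝ) < (K : ℝ) := two_lt_weightExp
  have hK0 : (0 : ℝ) ≤ (K : ℝ) := Nat.cast_nonneg _
  have hτ : 0 < t - t₀ := sub_pos.2 htt
  -- the midpoint and the `L²` level there
  set t₁ : ℝ := (t₀ + t) / 2 with ht₁
  have ht₀₁ : t₀ < t₁ := by rw [ht₁]; linarith
  have ht₁t : t₁ < t := by rw [ht₁]; linarith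
  have hsub₁ : Icc t₁ t ⊆ Icc t₀ t := Icc_subset_Icc_left ht₀₁.le
  set Y : ℝ := 4 * Cg * m ^ 2 / (ν * (t - t₀)) with hY_def
  have hY0 : 0 ≤ Y := by positivity
  set y : ℝ → ℝ := fun s => ∫ x, PlanarEigenmode.vorticity (u s) x ^ 2 with hy_def
  have hyY : ∀ s ∈ Icc t₁ t, y s ≤ Y := by
    intro s hs
    have hs₀ : t₀ < s := ht₀₁.trans_le hs.1
    have h2 := h.integral_sq_planarVorticity_le_of_integral_abs_le_of_nashConst hS hν hcurl hω hbdd hCg0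
      hNash ht₀
      (hsub (hsub₁ hs)) hs₀ (m := m) fun σ hσ => hm σ ⟨hσ.1, hσ.2.trans hs.2⟩
    refine h2.trans ?_
    -- `2Cg m²/(ν (s − t₀)) ≤ 4Cg m²/(ν (t − t₀))` since `s − t₀ ≥ (t − t₀)/2`
    rw [hY_def, div_le_div_iff₀ (by nlinarith) (by positivity)]
    have hs1 : (t - t₀) ≤ 2 * (s - t₀) := by rw [ht₁] at hs; linarith [hs.1]
    have : 0 ≤ 2 * Cg * m ^ 2 * ν := by positivity
    nlinarith
  -- the `L⁴` functional and its dissipation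
  set z : ℝ → ℝ := fun s => ∫ x, PlanarEigenmode.vorticity (u s) x ^ 4 with hz_def
  set E : ℝ → ℝ := fun s => ∫ x, PlanarEigenmode.vorticity (u s) x ^ 2 *
    ‖fderiv ℝ (PlanarEigenmode.vorticity (u s)) x‖ ^ 2 with hE_def
  have hz0 : ∀ s ∈ Icc t₁ t, 0 ≤ z s := fun s _ => integral_nonneg fun x => by positivity
  have hE0 : ∀ s ∈ Icc t₁ t, 0 ≤ E s := fun s _ => integral_nonneg fun x => by positivity
  have hz : ∀ s ∈ Icc t₁ t, HasDerivWithinAt z (-(12 * ν * E s)) (Icc t₁ t) s := by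
    intro s hs
    have hsS := hsub (hsub₁ hs)
    obtain ⟨M, hM⟩ := hbdd s hsS
    have h1 := h.hasDerivWithinAt_integral_pow_four_planarVorticity hS hω hsS hM
    have e0 : ∫ x, PlanarEigenmode.vorticity (u s) x ^ 3 * PlanarEigenmode.vorticity (f s) x = 0 := by
      simp [hcurl s hsS]
    rw [e0, mul_zero, add_zero] at h1
    exact h1.mono (hsub₁.trans hsub)
  -- Nash for `ω²` at each time: `z² ≤ 16 Cg y² E`
  have hN : ∀ s ∈ Icc t₁ t, z s ^ 2 ≤ 16 * Cg * Y ^ 2 * E s := by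
    intro s hs
    have hsS := hsub (hsub₁ hs)
    have hw1 : ContDiff ℝ 1 (PlanarEigenmode.vorticity (u s)) :=
      contDiff_infty.1 (hsm.contDiff_slice hsS) 1
    have hwd : Differentiable ℝ (PlanarEigenmode.vorticity (u s)) := hw1.differentiable one_ne_zero
    have hB : ∀ x, |PlanarEigenmode.vorticity (u s) x| ≤ C := fun x =>
      (hdec s hsS x).1.trans (mul_le_of_le_one_right hC (rpow_neg_le_one x hK0))
    have hw0 : ∀ x : EuclideanSpace ℝ (Fin 2), 0 ≤ (1 + ‖x‖) ^ (-(K : ℝ)) := fun x =>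
      Real.rpow_nonneg (by positivity) _
    -- decay of `ω²` and `D(ω²)` with the constant `2 C²`
    have g0 : ∀ x, |PlanarEigenmode.vorticity (u s) x ^ 2| ≤ 2 * C * C * (1 + ‖x‖) ^ (-(K : ℝ)) := by
      intro x
      rw [abs_pow, sq]
      calc |PlanarEigenmode.vorticity (u s) x| * |PlanarEigenmode.vorticity (u s) x|
          ≤ C * (C * (1 + ‖x‖) ^ (-(K : ℝ))) :=
            mul_le_mul (hB x) (hdec s hsS x).1 (abs_nonneg _) hC
        _ ≤ 2 * C * C * (1 + ‖x‖) ^ (-(K : ℝ)) := by nlinarith [hw0 x, mul_nonneg hC hC]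
    have g1 : ∀ x, ‖fderiv ℝ (fun y => PlanarEigenmode.vorticity (u s) y ^ 2) x‖ ≤
        2 * C * C * (1 + ‖x‖) ^ (-(K : ℝ)) := by
      intro x
      rw [fderiv_sq_apply hwd x, norm_smul, Real.norm_eq_abs, abs_mul, abs_of_pos two_pos]
      calc 2 * |PlanarEigenmode.vorticity (u s) x| * ‖fderiv ℝ (PlanarEigenmode.vorticity (u s)) x‖
          ≤ 2 * C * (C * (1 + ‖x‖) ^ (-(K : ℝ))) := by
            gcongr
            · exact hB x
            · exact (hdec s hsS x).2.1
        _ = 2 * C * C * (1 + ‖x‖) ^ (-(K : ℝ)) := by ring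
    have hn := hNash (hw1.pow 2) hK2 g0 g1
    -- rewrite the three integrals
    have e1 : ∫ x, (PlanarEigenmode.vorticity (u s) x ^ 2) ^ 2 = z s :=
      integral_congr_ae (Eventually.of_forall fun x => by dsimp only; ring)
    have e2 : ∫ x, |PlanarEigenmode.vorticity (u s) x ^ 2| = y s :=
      integral_congr_ae (Eventually.of_forall fun x => by dsimp only; rw [abs_of_nonneg (sq_nonneg _)])
    have e3 : ∫ x, ‖fderiv ℝ (fun y => PlanarEigenmode.vorticity (u s) y ^ 2) x‖ ^ 2 = 4 * E s := by
      rw [hE_def]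
      dsimp only
      rw [← integral_const_mul]
      exact integral_congr_ae (Eventually.of_forall fun x => by
        dsimp only; rw [norm_fderiv_sq_pow_two hwd x]; ring)
    rw [e1, e2, e3] at hn
    have hy0 : 0 ≤ y s := integral_nonneg fun x => sq_nonneg _
    have hE := hE0 s hs
    calc z s ^ 2 ≤ 4 * Cg * y s ^ 2 * (4 * E s) := hn
      _ ≤ 4 * Cg * Y ^ 2 * (4 * E s) := by
          have := hyY s hs
          gcongr
      _ = 16 * Cg * Y ^ 2 * E s := by ring
  have hRHS : 0 ≤ 128 / 3 * Cg ^ 3 * m ^ 4 / (ν * (t - t₀)) ^ 3 := by positivity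
  have htI : t ∈ Icc t₁ t := right_mem_Icc.2 ht₁t.le
  by_cases hKY : 16 * Cg * Y ^ 2 = 0
  · have h1 := hN t htI
    rw [hKY, zero_mul] at h1
    have hzt : z t = 0 := pow_eq_zero_iff (two_ne_zero) |>.1 (le_antisymm h1 (sq_nonneg _))
    exact hzt.le.trans hRHS
  · have hKY' : 0 < 16 * Cg * Y ^ 2 := lt_of_le_of_ne (by positivity) (Ne.symm hKY)
    set k : ℝ := 12 * ν / (16 * Cg * Y ^ 2) with hk_def
    have hk : 0 < k := by positivity
    have hle : ∀ s ∈ Icc t₁ t, -(12 * ν * E s) ≤ -(k * z s ^ 2) := by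
      intro s hs
      rw [neg_le_neg_iff, hk_def, div_mul_eq_mul_div, div_le_iff₀ hKY']
      have h1 := hN s hs
      nlinarith [hν.le]
    have hODE := le_one_div_of_hasDerivWithinAt_le_neg_mul_sq hk hz hz0 hle (s := t) ⟨ht₁t, le_rfl⟩
    -- `1/(k (t − t₁)) = 16 Cg Y²/(12 ν (t − t₀)/2) = (128/3) Cg³ m⁴/(ν (t − t₀))³`
    have hCgne : Cg ≠ 0 := by
      rintro h0; rw [h0] at hKY'; simp at hKY'
    have hYne : Y ≠ 0 := by
      rintro h0; rw [h0] at hKY'; simp at hKY'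
    have hmne : m ≠ 0 := by
      rintro h0; apply hYne; rw [hY_def, h0]; simp
    calc z t ≤ 1 / (k * (t - t₁)) := hODE
      _ = 128 / 3 * Cg ^ 3 * m ^ 4 / (ν * (t - t₀)) ^ 3 := by
          rw [hk_def, hY_def, ht₁, show t - (t₀ + t) / 2 = (t - t₀) / 2 by ring]
          have h1 : (t - t₀) ≠ 0 := hτ.ne'
          have hν0 : ν ≠ 0 := hν.ne'
          field_simp
          ring

/-- **`L⁴` decay of a planar viscous vorticity under an `L¹` bound (Gallay–Wayne 2005, (1.2),
`p = 4`).** Under the hypotheses of `integral_sq_planarVorticity_le_of_integral_abs_le`: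
`‖ω(t)‖⁴_{L⁴} ≤ (128/3) C_GNS³ m⁴ / (ν (t − t₀))³` — the second Nash–Moser step: on
`[t₁, t]`, `t₁ = (t₀ + t)/2`, `d/ds ‖ω‖₄⁴ = −12ν ∫ ω²‖∇ω‖² = −3ν ‖∇(ω²)‖₂²`, Nash for `ω²`
gives `‖ω‖₄⁸ ≤ 16 C_GNS ‖ω‖₂⁴ ∫ ω²‖∇ω‖²`, and `‖ω(s)‖₂² ≤ 4 C_GNS m²/(ν (t − t₀))` there by the
`L²` step.
[cite: GallayWayne2005, Thm. 1.1 eq. (1.2) (p = 4; after Ben-Artzi 1994, Kato 1994); CarlenLoss1995, Introduction (optimal L^p smoothing of the 2-D vorticity equation, cited via GallayWayne2005 §1)] -/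
theorem IsClassicalNSSolutionOn.integral_pow_four_planarVorticity_le_of_integral_abs_le
    (h : IsClassicalNSSolutionOn S ν f u p) (hS : Convex ℝ S) (hν : 0 < ν)
    (hcurl : ∀ t ∈ S, ∀ x, PlanarEigenmode.vorticity (f t) x = 0)
    (hω : HasUniformRapidDecayOn S (fun t x => PlanarEigenmode.vorticity (u t) x))
    (hbdd : ∀ t ∈ S, ∃ M : ℝ, ∀ x, ‖u t x‖ ≤ M) {t₀ t : ℝ} (ht₀ : t₀ ∈ S) (ht : t ∈ S)
    (htt : t₀ < t) {m : ℝ}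
    (hm : ∀ s ∈ Icc t₀ t, ∫ x, |PlanarEigenmode.vorticity (u s) x| ≤ m) :
    ∫ x, PlanarEigenmode.vorticity (u t) x ^ 4 ≤
      128 / 3 * (lintegralPowLePowLIntegralFDerivConst
        (volume : Measure (EuclideanSpace ℝ (Fin 2))) 2 : ℝ) ^ 3 * m ^ 4 / (ν * (t - t₀)) ^ 3  :=
  h.integral_pow_four_planarVorticity_le_of_integral_abs_le_of_nashConst hS hν hcurl hω hbdd (NNReal.coe_nonneg _)
    nash_of_decay_mathlib ht₀ ht htt hm

/-! ### §5 Non-negative vorticity: the `L¹` norm is the conserved circulation -/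

/-- Uniform rapid decay gives decay of `|ω|` near spatial infinity, uniformly in time:
`|ω(t, x)| ≤ C(1 + ‖x‖)⁻¹ ≤ δ` for `‖x‖ ≥ C/δ` (the hypothesis of the maximum principle
`planarVorticity_ge_of_ge`). [folklore] -/
private theorem decay_of_hasUniformRapidDecayOn₂ {T : Set ℝ}
    {w : ℝ → EuclideanSpace ℝ (Fin 2) → ℝ} (hw : HasUniformRapidDecayOn T w) (δ : ℝ) (hδ : 0 < δ) :
    ∃ R : ℝ, ∀ t ∈ T, ∀ x : EuclideanSpace ℝ (Fin 2), R ≤ ‖x‖ → |w t x| ≤ δ := by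
  obtain ⟨C, hC0, hC⟩ := hw.norm_le_rpow 1
  refine ⟨C / δ, fun t ht x hx => ?_⟩
  have h1 := hC t ht x
  rw [Real.norm_eq_abs, Nat.cast_one, Real.rpow_neg_one] at h1
  have hx0 : 0 < 1 + ‖x‖ := by positivity
  calc |w t x| ≤ C * (1 + ‖x‖)⁻¹ := h1
    _ ≤ δ := by
        rw [← div_eq_mul_inv, div_le_iff₀ hx0]
        have : C ≤ δ * ‖x‖ := by rwa [div_le_iff₀' hδ] at hx
        nlinarith

/-- **Non-negative vorticity stays non-negative and its `L¹` norm is the conserved circulation.**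
For a classical planar Navier–Stokes solution on a convex time set `S` with `ν ≥ 0` and curl-free
force, whose vorticity has uniform rapid decay on `S`, with `u(s)` bounded at each time: if
`ω(t₀) ≥ 0` then for every later `s ∈ S`, `ω(s) ≥ 0` (minimum principle,
`planarVorticity_ge_of_ge`) and `‖ω(s)‖_{L¹} = ∫ ω(s) = ∫ ω(t₀)` (conservation of the vorticity
flux, MB Prop. 1.14 (i)). [cite: MajdaBertozziCUP2002, §1.7 Prop. 1.14 (i); §3.3 before Cor. 3.3 (held text pp. 31, 105)] -/
theorem IsClassicalNSSolutionOn.integral_abs_planarVorticity_eq_of_nonneg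
    (h : IsClassicalNSSolutionOn S ν f u p) (hS : Convex ℝ S) (hν : 0 ≤ ν)
    (hcurl : ∀ t ∈ S, ∀ x, PlanarEigenmode.vorticity (f t) x = 0)
    (hω : HasUniformRapidDecayOn S (fun t x => PlanarEigenmode.vorticity (u t) x))
    (hbdd : ∀ t ∈ S, ∃ M : ℝ, ∀ x, ‖u t x‖ ≤ M) {t₀ : ℝ} (ht₀ : t₀ ∈ S)
    (h0 : ∀ x, 0 ≤ PlanarEigenmode.vorticity (u t₀) x) {s : ℝ} (hs : s ∈ S) (hts : t₀ ≤ s) :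
    (∀ x, 0 ≤ PlanarEigenmode.vorticity (u s) x) ∧
      ∫ x, |PlanarEigenmode.vorticity (u s) x| = ∫ x, PlanarEigenmode.vorticity (u t₀) x := by
  -- non-negativity: the minimum principle on the slab `[t₀, s] ⊆ S`
  have hlo : ∀ y, 0 ≤ PlanarEigenmode.vorticity (u s) y := by
    rcases eq_or_lt_of_le hts with he | hlt
    · subst he; exact h0
    have hsub : Icc t₀ s ⊆ S := hS.ordConnected.out ht₀ hs
    have h' : IsClassicalNSSolutionOn (Icc t₀ s) ν f u p := h.mono hsub (uniqueDiffOn_Icc hlt)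
    have hdec : ∀ δ : ℝ, 0 < δ → ∃ R : ℝ, ∀ r ∈ Icc t₀ s, ∀ y : EuclideanSpace ℝ (Fin 2),
        R ≤ ‖y‖ → |PlanarEigenmode.vorticity (u r) y| ≤ δ := fun δ hδ => by
      obtain ⟨R, hR⟩ := decay_of_hasUniformRapidDecayOn₂ hω δ hδ
      exact ⟨R, fun r hr y hy => hR r (hsub hr) y hy⟩
    exact fun y => h'.planarVorticity_ge_of_ge hν (fun r hr z => (hcurl r (hsub hr) z).symm.le) hdec
      h0 (right_mem_Icc.2 hts) y
  refine ⟨hlo, ?_⟩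
  -- the flux is constant on `S` (derivative `∫ curl f = 0` within the convex set `S`)
  have hderiv : ∀ r ∈ S, HasDerivWithinAt (fun r => ∫ x, PlanarEigenmode.vorticity (u r) x) 0 S r := by
    intro r hr
    obtain ⟨M, hM⟩ := hbdd r hr
    have h1 := h.hasDerivWithinAt_integral_planarVorticity hS hω hr hM
    have e0 : ∫ x, PlanarEigenmode.vorticity (f r) x = 0 := by simp [hcurl r hr]
    rwa [e0] at h1
  have hconst := hS.norm_image_sub_le_of_norm_hasDerivWithin_le hderiv
    (fun r _ => by rw [norm_zero]) ht₀ hs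
  rw [zero_mul, norm_le_zero_iff, sub_eq_zero] at hconst
  rw [integral_congr_ae (Eventually.of_forall fun y => abs_of_nonneg (hlo y))]
  exact hconst

/-- **`L²` decay for non-negative vorticity (Gallay–Wayne 2005, (1.2), `p = 2`, with
`‖ω₀‖₁ = Γ`).** Under the hypotheses above with `ν > 0` and `ω(t₀) ≥ 0`, for every later
`t ∈ S`: `∫ ω(t)² ≤ 2 C_GNS Γ² / (ν (t − t₀))`, `Γ = ∫ ω(t₀)` the (conserved) circulation.
[cite: GallayWayne2005, Thm. 1.1 eq. (1.2) (p = 2); CarlenLoss1995, Introduction (optimal L^p smoothing of the 2-D vorticity equation, cited via GallayWayne2005 §1)] -/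
theorem IsClassicalNSSolutionOn.integral_sq_planarVorticity_le_of_nonneg
    (h : IsClassicalNSSolutionOn S ν f u p) (hS : Convex ℝ S) (hν : 0 < ν)
    (hcurl : ∀ t ∈ S, ∀ x, PlanarEigenmode.vorticity (f t) x = 0)
    (hω : HasUniformRapidDecayOn S (fun t x => PlanarEigenmode.vorticity (u t) x))
    (hbdd : ∀ t ∈ S, ∃ M : ℝ, ∀ x, ‖u t x‖ ≤ M) {t₀ t : ℝ} (ht₀ : t₀ ∈ S)
    (h0 : ∀ x, 0 ≤ PlanarEigenmode.vorticity (u t₀) x) (ht : t ∈ S) (htt : t₀ < t) :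
    ∫ x, PlanarEigenmode.vorticity (u t) x ^ 2 ≤
      2 * (lintegralPowLePowLIntegralFDerivConst (volume : Measure (EuclideanSpace ℝ (Fin 2))) 2 : ℝ) *
        (∫ x, PlanarEigenmode.vorticity (u t₀) x) ^ 2 / (ν * (t - t₀)) :=
  h.integral_sq_planarVorticity_le_of_integral_abs_le hS hν hcurl hω hbdd ht₀ ht htt
    fun _ hs => ((h.integral_abs_planarVorticity_eq_of_nonneg hS hν.le hcurl hω hbdd ht₀ h0
      (hS.ordConnected.out ht₀ ht hs) hs.1).2).le

/-- **`L⁴` decay for non-negative vorticity (Gallay–Wayne 2005, (1.2), `p = 4`, with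
`‖ω₀‖₁ = Γ`).** Under the hypotheses above with `ν > 0` and `ω(t₀) ≥ 0`, for every later
`t ∈ S`: `∫ ω(t)⁴ ≤ (128/3) C_GNS³ Γ⁴ / (ν (t − t₀))³`, `Γ = ∫ ω(t₀)`.
[cite: GallayWayne2005, Thm. 1.1 eq. (1.2) (p = 4); CarlenLoss1995, Introduction (optimal L^p smoothing of the 2-D vorticity equation, cited via GallayWayne2005 §1)] -/
theorem IsClassicalNSSolutionOn.integral_pow_four_planarVorticity_le_of_nonneg
    (h : IsClassicalNSSolutionOn S ν f u p) (hS : Convex ℝ S) (hν : 0 < ν)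
    (hcurl : ∀ t ∈ S, ∀ x, PlanarEigenmode.vorticity (f t) x = 0)
    (hω : HasUniformRapidDecayOn S (fun t x => PlanarEigenmode.vorticity (u t) x))
    (hbdd : ∀ t ∈ S, ∃ M : ℝ, ∀ x, ‖u t x‖ ≤ M) {t₀ t : ℝ} (ht₀ : t₀ ∈ S)
    (h0 : ∀ x, 0 ≤ PlanarEigenmode.vorticity (u t₀) x) (ht : t ∈ S) (htt : t₀ < t) :
    ∫ x, PlanarEigenmode.vorticity (u t) x ^ 4 ≤
      128 / 3 * (lintegralPowLePowLIntegralFDerivConst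
        (volume : Measure (EuclideanSpace ℝ (Fin 2))) 2 : ℝ) ^ 3 *
        (∫ x, PlanarEigenmode.vorticity (u t₀) x) ^ 4 / (ν * (t - t₀)) ^ 3 :=
  h.integral_pow_four_planarVorticity_le_of_integral_abs_le hS hν hcurl hω hbdd ht₀ ht htt
    fun _ hs => ((h.integral_abs_planarVorticity_eq_of_nonneg hS hν.le hcurl hω hbdd ht₀ h0
      (hS.ordConnected.out ht₀ ht hs) hs.1).2).le

/-! ### §6 The Nash–Moser iteration: `L^{2^j}` bounds for every `j` and the `L^∞` endpoint -/

/-- `D(ω^{r+1})(x) = ((r+1) ω(x)^r) • Dω(x)`, hence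
`‖D(ω^{r+1})(x)‖² = (r+1)² ω(x)^{2r} ‖Dω(x)‖²`. [folklore] -/
private theorem norm_fderiv_pow_succ_sq {X : Type*} [NormedAddCommGroup X] [NormedSpace ℝ X]
    {w : X → ℝ} (hw : Differentiable ℝ w) (r : ℕ) (x : X) :
    ‖fderiv ℝ (fun y => w y ^ (r + 1)) x‖ ^ 2 =
      ((r : ℝ) + 1) ^ 2 * w x ^ (2 * r) * ‖fderiv ℝ w x‖ ^ 2 := by
  rw [fderiv_pow_succ_apply hw r x, norm_smul, mul_pow, Real.norm_eq_abs, abs_mul,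
    abs_of_nonneg (by positivity : (0 : ℝ) ≤ (r : ℝ) + 1), mul_pow, abs_pow, ← pow_mul,
    pow_abs, show r * 2 = 2 * r from mul_comm _ _,
    abs_of_nonneg (by rw [pow_mul]; positivity : (0 : ℝ) ≤ w x ^ (2 * r))]

/-- **The general Nash–Moser step, generic Nash constant** (v5): `∫ |ω(s)|^q ≤ Y` on `[t₁, t]`
gives `∫ ω(t)^{2q} ≤ 2 Cg Y²/(ν (t − t₁))` for any admissible Nash constant `Cg` (hypothesis `hNash`).
[cite: CarlenLoss1995, §1 (L^p energy identity for the 2-D vorticity equation); GallayWayne2005, Thm. 1.1 eq. (1.2)] -/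
theorem IsClassicalNSSolutionOn.integral_pow_two_mul_planarVorticity_le_of_integral_abs_pow_le_of_nashConst
    (h : IsClassicalNSSolutionOn S ν f u p) (hS : Convex ℝ S) (hν : 0 < ν)
    (hcurl : ∀ t ∈ S, ∀ x, PlanarEigenmode.vorticity (f t) x = 0)
    (hω : HasUniformRapidDecayOn S (fun t x => PlanarEigenmode.vorticity (u t) x))
    (hbdd : ∀ t ∈ S, ∃ M : ℝ, ∀ x, ‖u t x‖ ≤ M) {Cg : ℝ} (hCg0 : 0 ≤ Cg)
    (hNash : ∀ ⦃g : EuclideanSpace ℝ (Fin 2) → ℝ⦄, ContDiff ℝ 1 g → ∀ ⦃A r : ℝ⦄, 2 < r →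
      (∀ x, |g x| ≤ A * (1 + ‖x‖) ^ (-r)) → (∀ x, ‖fderiv ℝ g x‖ ≤ A * (1 + ‖x‖) ^ (-r)) →
      (∫ x, g x ^ 2) ^ 2 ≤ 4 * Cg * (∫ x, |g x|) ^ 2 * ∫ x, ‖fderiv ℝ g x‖ ^ 2)
    {t₁ t : ℝ} (ht₁ : t₁ ∈ S) (ht : t ∈ S)
    (htt : t₁ < t) {q : ℕ} (hq : 1 ≤ q) {Y : ℝ}
    (hY : ∀ s ∈ Icc t₁ t, ∫ x, |PlanarEigenmode.vorticity (u s) x| ^ q ≤ Y) :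
    ∫ x, PlanarEigenmode.vorticity (u t) x ^ (2 * q) ≤
      2 * Cg *
        Y ^ 2 / (ν * (t - t₁)) := by
  obtain ⟨r, rfl⟩ : ∃ r, q = r + 1 := ⟨q - 1, by omega⟩
  have hsub : Icc t₁ t ⊆ S := hS.ordConnected.out ht₁ ht
  have hU : UniqueDiffOn ℝ S := uniqueDiffOn_of_convex_of_lt hS ht₁ ht htt
  have hsm := PlanarEigenmode.isSmoothSpaceTimeOn_vorticity h.smooth_velocity hU
  obtain ⟨C, hC, hdec⟩ := exists_planarVorticity_decay_const₃ h.smooth_velocity hU hω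
  set K : ℕ := 0 + (Module.finrank ℝ (EuclideanSpace ℝ (Fin 2)) + 1) with hK
  have hK2 : (2 : ℝ) < (K : ℝ) := two_lt_weightExp
  have hK0 : (0 : ℝ) ≤ (K : ℝ) := Nat.cast_nonneg _
  have hτ : 0 < t - t₁ := sub_pos.2 htt
  have hY0 : 0 ≤ Y := (integral_nonneg fun x => by positivity).trans (hY t (right_mem_Icc.2 htt.le))
  -- the functionals
  set z : ℝ → ℝ := fun s => ∫ x, PlanarEigenmode.vorticity (u s) x ^ (2 * r + 2) with hz_def
  set E : ℝ → ℝ := fun s => ∫ x, PlanarEigenmode.vorticity (u s) x ^ (2 * r) *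
    ‖fderiv ℝ (PlanarEigenmode.vorticity (u s)) x‖ ^ 2 with hE_def
  have hz0 : ∀ s ∈ Icc t₁ t, 0 ≤ z s := fun s _ => integral_nonneg fun x => by
    rw [show 2 * r + 2 = 2 * (r + 1) by ring, pow_mul]; positivity
  have hE0 : ∀ s ∈ Icc t₁ t, 0 ≤ E s := fun s _ => integral_nonneg fun x => by
    rw [pow_mul]; positivity
  -- the `L^{2r+2}` law, force-free, on `[t₁, t]`
  have hz : ∀ s ∈ Icc t₁ t, HasDerivWithinAt z
      (-(ν * ((((2 * r : ℕ) : ℝ) + 2) * (((2 * r : ℕ) : ℝ) + 1)) * E s)) (Icc t₁ t) s := by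
    intro s hs
    obtain ⟨M, hM⟩ := hbdd s (hsub hs)
    have h1 := h.hasDerivWithinAt_integral_pow_planarVorticity hS hω (hsub hs) hM (2 * r)
    have e0 : ∫ x, PlanarEigenmode.vorticity (u s) x ^ (2 * r + 1) *
        PlanarEigenmode.vorticity (f s) x = 0 := by
      simp [hcurl s (hsub hs)]
    rw [e0, mul_zero, add_zero] at h1
    exact h1.mono hsub
  -- Nash for `ω^{r+1}` at each time: `z² ≤ 4 Cg Y² (r+1)² E`
  have hN : ∀ s ∈ Icc t₁ t, z s ^ 2 ≤ 4 * Cg * Y ^ 2 * (((r : ℝ) + 1) ^ 2 * E s) := by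
    intro s hs
    have hsS := hsub hs
    have hw1 : ContDiff ℝ 1 (PlanarEigenmode.vorticity (u s)) :=
      contDiff_infty.1 (hsm.contDiff_slice hsS) 1
    have hwd : Differentiable ℝ (PlanarEigenmode.vorticity (u s)) := hw1.differentiable one_ne_zero
    have hB : ∀ x, |PlanarEigenmode.vorticity (u s) x| ≤ C := fun x =>
      (hdec s hsS x).1.trans (mul_le_of_le_one_right hC (rpow_neg_le_one x hK0))
    have hw0 : ∀ x : EuclideanSpace ℝ (Fin 2), 0 ≤ (1 + ‖x‖) ^ (-(K : ℝ)) := fun x =>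
      Real.rpow_nonneg (by positivity) _
    have hBr : ∀ x, |PlanarEigenmode.vorticity (u s) x| ^ r ≤ C ^ r := fun x =>
      pow_le_pow_left₀ (abs_nonneg _) (hB x) r
    -- decay of `ω^{r+1}` and `D(ω^{r+1})` with the constant `(r+1) C^r C`
    set A : ℝ := ((r : ℝ) + 1) * C ^ r * C with hA
    have hCrA : C ^ r * C ≤ A := by
      rw [hA]
      have : (1 : ℝ) * (C ^ r * C) ≤ ((r : ℝ) + 1) * (C ^ r * C) :=
        mul_le_mul_of_nonneg_right (by linarith [(Nat.cast_nonneg r : (0 : ℝ) ≤ r)]) (by positivity)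
      linarith
    have g0 : ∀ x, |PlanarEigenmode.vorticity (u s) x ^ (r + 1)| ≤ A * (1 + ‖x‖) ^ (-(K : ℝ)) := by
      intro x
      rw [abs_pow, pow_succ]
      calc |PlanarEigenmode.vorticity (u s) x| ^ r * |PlanarEigenmode.vorticity (u s) x|
          ≤ C ^ r * (C * (1 + ‖x‖) ^ (-(K : ℝ))) :=
            mul_le_mul (hBr x) (hdec s hsS x).1 (abs_nonneg _) (pow_nonneg hC r)
        _ = (C ^ r * C) * (1 + ‖x‖) ^ (-(K : ℝ)) := by ring
        _ ≤ A * (1 + ‖x‖) ^ (-(K : ℝ)) := mul_le_mul_of_nonneg_right hCrA (hw0 x)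
    have g1 : ∀ x, ‖fderiv ℝ (fun y => PlanarEigenmode.vorticity (u s) y ^ (r + 1)) x‖ ≤
        A * (1 + ‖x‖) ^ (-(K : ℝ)) := by
      intro x
      rw [fderiv_pow_succ_apply hwd r x, norm_smul, Real.norm_eq_abs, abs_mul,
        abs_of_nonneg (by positivity : (0 : ℝ) ≤ (r : ℝ) + 1), abs_pow]
      calc ((r : ℝ) + 1) * |PlanarEigenmode.vorticity (u s) x| ^ r *
            ‖fderiv ℝ (PlanarEigenmode.vorticity (u s)) x‖
          ≤ ((r : ℝ) + 1) * C ^ r * (C * (1 + ‖x‖) ^ (-(K : ℝ))) := by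
            gcongr
            · exact hB x
            · exact (hdec s hsS x).2.1
        _ = A * (1 + ‖x‖) ^ (-(K : ℝ)) := by rw [hA]; ring
    have hn := hNash (hw1.pow (r + 1)) hK2 g0 g1
    -- rewrite the three integrals
    have e1 : ∫ x, (PlanarEigenmode.vorticity (u s) x ^ (r + 1)) ^ 2 = z s :=
      integral_congr_ae (Eventually.of_forall fun x => by dsimp only; ring)
    have e2 : ∫ x, |PlanarEigenmode.vorticity (u s) x ^ (r + 1)| =
        ∫ x, |PlanarEigenmode.vorticity (u s) x| ^ (r + 1) :=
      integral_congr_ae (Eventually.of_forall fun x => by dsimp only; rw [abs_pow])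
    have e3 : ∫ x, ‖fderiv ℝ (fun y => PlanarEigenmode.vorticity (u s) y ^ (r + 1)) x‖ ^ 2 =
        ((r : ℝ) + 1) ^ 2 * E s := by
      rw [hE_def]
      dsimp only
      rw [← integral_const_mul]
      exact integral_congr_ae (Eventually.of_forall fun x => by
        dsimp only; rw [norm_fderiv_pow_succ_sq hwd r x]; ring)
    rw [e1, e2, e3] at hn
    have hy0 : 0 ≤ ∫ x, |PlanarEigenmode.vorticity (u s) x| ^ (r + 1) :=
      integral_nonneg fun x => by positivity
    have hE := hE0 s hs
    calc z s ^ 2 ≤ 4 * Cg * (∫ x, |PlanarEigenmode.vorticity (u s) x| ^ (r + 1)) ^ 2 *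
          (((r : ℝ) + 1) ^ 2 * E s) := hn
      _ ≤ 4 * Cg * Y ^ 2 * (((r : ℝ) + 1) ^ 2 * E s) :=
          mul_le_mul_of_nonneg_right (mul_le_mul_of_nonneg_left
            (pow_le_pow_left₀ hy0 (hY s hs) 2) (by positivity)) (mul_nonneg (sq_nonneg _) hE)
  have hRHS : 0 ≤ 2 * Cg * Y ^ 2 / (ν * (t - t₁)) := by positivity
  have htI : t ∈ Icc t₁ t := right_mem_Icc.2 htt.le
  have hgoal : z t = ∫ x, PlanarEigenmode.vorticity (u t) x ^ (2 * (r + 1)) := by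
    rw [hz_def, show 2 * (r + 1) = 2 * r + 2 by ring]
  rw [← hgoal]
  by_cases hKY : 4 * Cg * Y ^ 2 = 0
  · have h1 := hN t htI
    rw [hKY, zero_mul] at h1
    have hzt : z t = 0 := pow_eq_zero_iff (two_ne_zero) |>.1 (le_antisymm h1 (sq_nonneg _))
    exact hzt.le.trans hRHS
  · have hKY' : 0 < 4 * Cg * Y ^ 2 := lt_of_le_of_ne (by positivity) (Ne.symm hKY)
    -- the comparison constant `k = ν (2r+1) / (2 Cg Y² (r+1))`
    set k : ℝ := ν * (2 * (r : ℝ) + 1) / (2 * Cg * Y ^ 2 * ((r : ℝ) + 1)) with hk_def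
    have hr1 : (0 : ℝ) < (r : ℝ) + 1 := by positivity
    have hden : 0 < 2 * Cg * Y ^ 2 * ((r : ℝ) + 1) := mul_pos (by linarith) hr1
    have hk : 0 < k := div_pos (by positivity) hden
    have hle : ∀ s ∈ Icc t₁ t,
        -(ν * ((((2 * r : ℕ) : ℝ) + 2) * (((2 * r : ℕ) : ℝ) + 1)) * E s) ≤ -(k * z s ^ 2) := by
      intro s hs
      have h1 := hN s hs
      have hEs := hE0 s hs
      rw [neg_le_neg_iff, hk_def]
      push_cast
      rw [div_mul_eq_mul_div, div_le_iff₀ hden]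
      -- `ν(2r+1) z² ≤ ν (2r+2)(2r+1) E · 2 Cg Y² (r+1)` from `z² ≤ 4 Cg Y² (r+1)² E`
      have h2 : ν * (2 * (r : ℝ) + 1) * z s ^ 2 ≤
          ν * (2 * (r : ℝ) + 1) * (4 * Cg * Y ^ 2 * (((r : ℝ) + 1) ^ 2 * E s)) :=
        mul_le_mul_of_nonneg_left h1 (by positivity)
      refine h2.trans (le_of_eq ?_)
      ring
    have hODE := le_one_div_of_hasDerivWithinAt_le_neg_mul_sq hk hz hz0 hle (s := t) ⟨htt, le_rfl⟩
    have hCgne : Cg ≠ 0 := by rintro h0; rw [h0] at hKY'; simp at hKY'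
    have hYne : Y ≠ 0 := by rintro h0; rw [h0] at hKY'; simp at hKY'
    calc z t ≤ 1 / (k * (t - t₁)) := hODE
      _ = 2 * Cg * Y ^ 2 / (ν * (t - t₁)) * (((r : ℝ) + 1) / (2 * (r : ℝ) + 1)) := by
          rw [hk_def]
          field_simp
      _ ≤ 2 * Cg * Y ^ 2 / (ν * (t - t₁)) * 1 := by
          refine mul_le_mul_of_nonneg_left ?_ hRHS
          rw [div_le_one (by positivity)]
          linarith [(Nat.cast_nonneg r : (0 : ℝ) ≤ r)]
      _ = 2 * Cg * Y ^ 2 / (ν * (t - t₁)) := mul_one _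

/-- **The general Nash–Moser step.** Under the hypotheses of
`integral_sq_planarVorticity_le_of_integral_abs_le`, for every `q ≥ 1`: if
`∫ |ω(s)|^q ≤ Y` for all `s ∈ [t₁, t] ⊆ S` (`t₁ < t`), then
`∫ ω(t)^{2q} ≤ 2 C_GNS Y² / (ν (t − t₁))` — the `L^{2q}` law
`d/ds ∫ω^{2q} = −2ν q(2q−1) ∫ ω^{2q−2}‖∇ω‖²`, Nash for `ω^q`
(`(∫ω^{2q})² ≤ 4 C_GNS (∫|ω|^q)² q² ∫ω^{2q−2}‖∇ω‖²`) and the comparison lemma give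
`∫ω(t)^{2q} ≤ 2q C_GNS Y²/((2q−1) ν (t − t₁)) ≤ 2 C_GNS Y²/(ν (t − t₁))` (the case `q = 1` is the
`L²` estimate). [cite: CarlenLoss1995, §1 (L^p energy identity for the 2-D vorticity equation); GallayWayne2005, Thm. 1.1 eq. (1.2)] -/
theorem IsClassicalNSSolutionOn.integral_pow_two_mul_planarVorticity_le_of_integral_abs_pow_le
    (h : IsClassicalNSSolutionOn S ν f u p) (hS : Convex ℝ S) (hν : 0 < ν)
    (hcurl : ∀ t ∈ S, ∀ x, PlanarEigenmode.vorticity (f t) x = 0)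
    (hω : HasUniformRapidDecayOn S (fun t x => PlanarEigenmode.vorticity (u t) x))
    (hbdd : ∀ t ∈ S, ∃ M : ℝ, ∀ x, ‖u t x‖ ≤ M) {t₁ t : ℝ} (ht₁ : t₁ ∈ S) (ht : t ∈ S)
    (htt : t₁ < t) {q : ℕ} (hq : 1 ≤ q) {Y : ℝ}
    (hY : ∀ s ∈ Icc t₁ t, ∫ x, |PlanarEigenmode.vorticity (u s) x| ^ q ≤ Y) :
    ∫ x, PlanarEigenmode.vorticity (u t) x ^ (2 * q) ≤
      2 * (lintegralPowLePowLIntegralFDerivConst (volume : Measure (EuclideanSpace ℝ (Fin 2))) 2 : ℝ) *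
        Y ^ 2 / (ν * (t - t₁))  :=
  h.integral_pow_two_mul_planarVorticity_le_of_integral_abs_pow_le_of_nashConst hS hν hcurl hω hbdd (NNReal.coe_nonneg _)
    nash_of_decay_mathlib ht₁ ht htt hq hY

/-- **The dyadic iteration, generic Nash constant** (v5):
`∫ |ω(s)|^{2^j} ≤ m (8 m Cg/(ν (t − t₀)))^{2^j − 1}/2^j` on `[t − (t − t₀)/2^j, t]` for any admissible
Nash constant `Cg` (hypothesis `hNash`). [cite: CarlenLoss1995, §1; GallayWayne2005, Thm. 1.1 eq. (1.2)] -/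
theorem IsClassicalNSSolutionOn.integral_abs_pow_two_pow_planarVorticity_le_of_nashConst
    (h : IsClassicalNSSolutionOn S ν f u p) (hS : Convex ℝ S) (hν : 0 < ν)
    (hcurl : ∀ t ∈ S, ∀ x, PlanarEigenmode.vorticity (f t) x = 0)
    (hω : HasUniformRapidDecayOn S (fun t x => PlanarEigenmode.vorticity (u t) x))
    (hbdd : ∀ t ∈ S, ∃ M : ℝ, ∀ x, ‖u t x‖ ≤ M) {Cg : ℝ} (hCg0 : 0 ≤ Cg)
    (hNash : ∀ ⦃g : EuclideanSpace ℝ (Fin 2) → ℝ⦄, ContDiff ℝ 1 g → ∀ ⦃A r : ℝ⦄, 2 < r →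
      (∀ x, |g x| ≤ A * (1 + ‖x‖) ^ (-r)) → (∀ x, ‖fderiv ℝ g x‖ ≤ A * (1 + ‖x‖) ^ (-r)) →
      (∫ x, g x ^ 2) ^ 2 ≤ 4 * Cg * (∫ x, |g x|) ^ 2 * ∫ x, ‖fderiv ℝ g x‖ ^ 2)
    {t₀ t : ℝ} (ht₀ : t₀ ∈ S) (ht : t ∈ S)
    (htt : t₀ < t) {m : ℝ} (hm : ∀ s ∈ Icc t₀ t, ∫ x, |PlanarEigenmode.vorticity (u s) x| ≤ m)
    (j : ℕ) {s : ℝ} (hs : s ∈ Icc (t - (t - t₀) / 2 ^ j) t) :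
    ∫ x, |PlanarEigenmode.vorticity (u s) x| ^ (2 ^ j) ≤
      m * (8 * Cg * m / (ν * (t - t₀))) ^ (2 ^ j - 1) /
        2 ^ j := by
  have hτ : 0 < t - t₀ := sub_pos.2 htt
  set X : ℝ := 8 * Cg * m / (ν * (t - t₀)) with hX
  induction j generalizing s with
  | zero =>
    simp only [pow_zero, div_one, sub_sub_cancel, Nat.sub_self, pow_one, mul_one] at hs ⊢
    exact hm s hs
  | succ j ih =>
    -- the previous dyadic time `t₁ = t − (t − t₀)/2^j`
    set t₁ : ℝ := t - (t - t₀) / 2 ^ j with ht₁_def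
    have h2j : (0 : ℝ) < 2 ^ j := by positivity
    have hgap : t - (t - t₀) / 2 ^ (j + 1) - t₁ = (t - t₀) / 2 ^ (j + 1) := by
      rw [ht₁_def, pow_succ]; field_simp; ring
    have ht₁0 : t₀ ≤ t₁ := by
      rw [ht₁_def, le_sub_comm]
      exact div_le_self hτ.le (one_le_pow₀ (by norm_num))
    have ht₁t : t₁ ≤ t := by rw [ht₁_def]; exact sub_le_self _ (by positivity)
    have ht₁S : t₁ ∈ S := hS.ordConnected.out ht₀ ht ⟨ht₁0, ht₁t⟩
    have hsS : s ∈ S := hS.ordConnected.out ht₀ ht ⟨ht₁0.trans (by linarith [hs.1, hgap.le]), hs.2⟩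
    have hst₁ : t₁ < s := by
      have : 0 < (t - t₀) / 2 ^ (j + 1) := by positivity
      linarith [hs.1]
    -- the general step on `[t₁, s]` with `q = 2^j`
    have hstep := h.integral_pow_two_mul_planarVorticity_le_of_integral_abs_pow_le_of_nashConst hS hν hcurl
      hω hbdd hCg0 hNash ht₁S hsS hst₁ (Nat.one_le_two_pow) (Y := m * X ^ (2 ^ j - 1) / 2 ^ j)
      (fun s' hs' => ih ⟨hs'.1, hs'.2.trans hs.2⟩)
    -- `|ω|^{2^{j+1}} = ω^{2·2^j}`
    have heven : ∀ x, |PlanarEigenmode.vorticity (u s) x| ^ (2 ^ (j + 1)) =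
        PlanarEigenmode.vorticity (u s) x ^ (2 * 2 ^ j) := fun x => by
      rw [pow_succ', Even.pow_abs (even_two_mul _)]
    simp_rw [heven]
    refine hstep.trans ?_
    -- `s − t₁ ≥ (t − t₀)/2^{j+1}`
    have hY0 : 0 ≤ m * X ^ (2 ^ j - 1) / 2 ^ j := by
      have hm0 : 0 ≤ m := (integral_nonneg fun y => abs_nonneg _).trans (hm t (right_mem_Icc.2 htt.le))
      positivity
    have hden : ν * ((t - t₀) / 2 ^ (j + 1)) ≤ ν * (s - t₁) :=
      mul_le_mul_of_nonneg_left (by linarith [hs.1, hgap]) hν.le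
    calc 2 * Cg * (m * X ^ (2 ^ j - 1) / 2 ^ j) ^ 2 / (ν * (s - t₁))
        ≤ 2 * Cg * (m * X ^ (2 ^ j - 1) / 2 ^ j) ^ 2 / (ν * ((t - t₀) / 2 ^ (j + 1))) :=
          div_le_div_of_nonneg_left (by positivity) (by positivity) hden
      _ = m * X ^ (2 ^ (j + 1) - 1) / 2 ^ (j + 1) := by
          obtain ⟨N, hN⟩ : ∃ N, 2 ^ j - 1 = N := ⟨_, rfl⟩
          have h1 : 1 ≤ 2 ^ j := Nat.one_le_two_pow
          have hN' : 2 ^ (j + 1) - 1 = 2 * N + 1 := by rw [pow_succ]; omega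
          rw [hN, hN', pow_succ X (2 * N), pow_mul']
          set P : ℝ := X ^ N with hP
          rw [hX, pow_succ (2 : ℝ) j]
          have hτne : ν * (t - t₀) ≠ 0 := by positivity
          field_simp
          ring

/-- **The dyadic iteration.** Under the hypotheses of `integral_sq_planarVorticity_le_of_integral_abs_le`
(running bound `‖ω(s)‖_{L¹} ≤ m` on `[t₀, t]`, `t₀ < t`), for every `j` and every
`s ∈ [t − (t − t₀)/2^j, t]`:
`∫ |ω(s)|^{2^j} ≤ m · (8 m C_GNS/(ν (t − t₀)))^{2^j − 1} / 2^j`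
(induction on `j` with the general step on `[t − (t − t₀)/2^j, s]`, exponent `q = 2^j`).
[cite: CarlenLoss1995, §1; GallayWayne2005, Thm. 1.1 eq. (1.2)] -/
theorem IsClassicalNSSolutionOn.integral_abs_pow_two_pow_planarVorticity_le
    (h : IsClassicalNSSolutionOn S ν f u p) (hS : Convex ℝ S) (hν : 0 < ν)
    (hcurl : ∀ t ∈ S, ∀ x, PlanarEigenmode.vorticity (f t) x = 0)
    (hω : HasUniformRapidDecayOn S (fun t x => PlanarEigenmode.vorticity (u t) x))
    (hbdd : ∀ t ∈ S, ∃ M : ℝ, ∀ x, ‖u t x‖ ≤ M) {t₀ t : ℝ} (ht₀ : t₀ ∈ S) (ht : t ∈ S)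
    (htt : t₀ < t) {m : ℝ} (hm : ∀ s ∈ Icc t₀ t, ∫ x, |PlanarEigenmode.vorticity (u s) x| ≤ m)
    (j : ℕ) {s : ℝ} (hs : s ∈ Icc (t - (t - t₀) / 2 ^ j) t) :
    ∫ x, |PlanarEigenmode.vorticity (u s) x| ^ (2 ^ j) ≤
      m * (8 * (lintegralPowLePowLIntegralFDerivConst
        (volume : Measure (EuclideanSpace ℝ (Fin 2))) 2 : ℝ) * m / (ν * (t - t₀))) ^ (2 ^ j - 1) /
        2 ^ j  :=
  h.integral_abs_pow_two_pow_planarVorticity_le_of_nashConst hS hν hcurl hω hbdd (NNReal.coe_nonneg _)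
    nash_of_decay_mathlib ht₀ ht htt hm j hs

/-- **From `L^{2^j}` bounds to a pointwise bound.** If `g` is continuous, `|g|^{2^j}` is integrable
and `∫ |g|^{2^j} ≤ M A^{2^j − 1}` for every `j` (`A ≥ 0`), then `|g| ≤ A` everywhere: otherwise
`|g| ≥ a > A` on a ball of positive volume `V`, and `a^{2^j} V ≤ M A^{2^j − 1}` fails for large `j`.
[folklore] -/
private theorem abs_le_of_integral_abs_pow_two_pow_le {g : EuclideanSpace ℝ (Fin 2) → ℝ}
    (hg : Continuous g) (hint : ∀ j : ℕ, Integrable fun x => |g x| ^ (2 ^ j)) {M A : ℝ}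
    (hA : 0 ≤ A) (hb : ∀ j : ℕ, ∫ x, |g x| ^ (2 ^ j) ≤ M * A ^ (2 ^ j - 1))
    (x₀ : EuclideanSpace ℝ (Fin 2)) : |g x₀| ≤ A := by
  by_contra hlt
  rw [not_le] at hlt
  set a : ℝ := (A + |g x₀|) / 2 with ha_def
  have haA : A < a := by rw [ha_def]; linarith
  have ha0 : 0 < a := hA.trans_lt haA
  have hag : a < |g x₀| := by rw [ha_def]; linarith
  -- `|g| > a` on a ball about `x₀`
  obtain ⟨δ, hδ, hball⟩ : ∃ δ > 0, ∀ y, dist y x₀ < δ → a < |g y| := by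
    have hc : ContinuousAt (fun y => |g y|) x₀ := (continuous_abs.comp hg).continuousAt
    obtain ⟨δ, hδ, hδ'⟩ := Metric.continuousAt_iff.1 hc (|g x₀| - a) (by linarith)
    refine ⟨δ, hδ, fun y hy => ?_⟩
    have h1 := hδ' hy
    rw [Real.dist_eq] at h1
    have := (abs_lt.1 h1).1
    linarith
  set V : ℝ := (volume : Measure (EuclideanSpace ℝ (Fin 2))).real (Metric.ball x₀ δ) with hV_def
  have hV : 0 < V := by
    rw [hV_def, measureReal_def]
    exact ENNReal.toReal_pos (Metric.measure_ball_pos volume x₀ hδ).ne' measure_ball_lt_top.ne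
  -- `a^{2^j} V ≤ M A^{2^j − 1}` for every `j`
  have hlow : ∀ j : ℕ, a ^ (2 ^ j) * V ≤ M * A ^ (2 ^ j - 1) := by
    intro j
    calc a ^ (2 ^ j) * V = ∫ x, (Metric.ball x₀ δ).indicator (fun _ => a ^ (2 ^ j)) x := by
          rw [integral_indicator_const _ measurableSet_ball, smul_eq_mul, mul_comm]
      _ ≤ ∫ x, |g x| ^ (2 ^ j) := by
          refine integral_mono_of_nonneg (Eventually.of_forall fun x => ?_) (hint j)
            (Eventually.of_forall fun x => ?_)
          · exact Set.indicator_nonneg (fun _ _ => pow_nonneg ha0.le _) _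
          · by_cases hx : x ∈ Metric.ball x₀ δ
            · rw [Set.indicator_of_mem hx]
              exact pow_le_pow_left₀ ha0.le (hball x (Metric.mem_ball.1 hx)).le _
            · rw [Set.indicator_of_notMem hx]; positivity
      _ ≤ M * A ^ (2 ^ j - 1) := hb j
  rcases hA.eq_or_lt with hA0 | hApos
  · have h1 := hlow 1
    rw [← hA0] at h1
    norm_num at h1
    nlinarith [pow_pos ha0 2]
  · have hr : 1 < a / A := (one_lt_div hApos).2 haA
    obtain ⟨n, hn⟩ := pow_unbounded_of_one_lt (M / (A * V)) hr
    have h1 := hlow n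
    have h2 : (a / A) ^ (2 ^ n) ≤ M / (A * V) := by
      rw [div_pow, div_le_div_iff₀ (pow_pos hApos _) (mul_pos hApos hV)]
      have e : A ^ (2 ^ n - 1) * A = A ^ (2 ^ n) := by
        rw [← pow_succ]; congr 1; have := Nat.one_le_two_pow (n := n); omega
      calc a ^ (2 ^ n) * (A * V) = (a ^ (2 ^ n) * V) * A := by ring
        _ ≤ (M * A ^ (2 ^ n - 1)) * A := mul_le_mul_of_nonneg_right h1 hA
        _ = M * A ^ (2 ^ n) := by rw [mul_assoc, e]
    have h3 : (a / A) ^ n ≤ (a / A) ^ (2 ^ n) := pow_le_pow_right₀ hr.le n.lt_two_pow_self.le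
    linarith

/-- **The `L^∞` endpoint, generic Nash constant** (v5): under a running `L¹` bound `m` on
`[t₀, t]`, `|ω(t, x)| ≤ 8 Cg m / (ν (t − t₀))` for any constant `Cg ≥ 0` for which the planar Nash
inequality `(∫g²)² ≤ 4 Cg (∫|g|)² ∫‖∇g‖²` holds on decaying `C¹` functions (hypothesis `hNash`); with
`Cg = 1/8` (`PlanarSobolev.sq_integral_sq_le_half_of_decay`) this is `‖ω(t)‖_∞ ≤ m/(ν(t − t₀))`
(`abs_planarVorticity_le_of_integral_abs_le_explicit`), with Mathlib's `C_GNS` it is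
`abs_planarVorticity_le_of_integral_abs_le`. [cite: GallayWayne2005, Thm. 1.1 eq. (1.2) (p = ∞); CarlenLoss1995, Thm. 1; Nash1958] -/
theorem IsClassicalNSSolutionOn.abs_planarVorticity_le_of_integral_abs_le_of_nashConst
    (h : IsClassicalNSSolutionOn S ν f u p) (hS : Convex ℝ S) (hν : 0 < ν)
    (hcurl : ∀ t ∈ S, ∀ x, PlanarEigenmode.vorticity (f t) x = 0)
    (hω : HasUniformRapidDecayOn S (fun t x => PlanarEigenmode.vorticity (u t) x))
    (hbdd : ∀ t ∈ S, ∃ M : ℝ, ∀ x, ‖u t x‖ ≤ M) {Cg : ℝ} (hCg0 : 0 ≤ Cg)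
    (hNash : ∀ ⦃g : EuclideanSpace ℝ (Fin 2) → ℝ⦄, ContDiff ℝ 1 g → ∀ ⦃A r : ℝ⦄, 2 < r →
      (∀ x, |g x| ≤ A * (1 + ‖x‖) ^ (-r)) → (∀ x, ‖fderiv ℝ g x‖ ≤ A * (1 + ‖x‖) ^ (-r)) →
      (∫ x, g x ^ 2) ^ 2 ≤ 4 * Cg * (∫ x, |g x|) ^ 2 * ∫ x, ‖fderiv ℝ g x‖ ^ 2)
    {t₀ t : ℝ} (ht₀ : t₀ ∈ S) (ht : t ∈ S)
    (htt : t₀ < t) {m : ℝ} (hm : ∀ s ∈ Icc t₀ t, ∫ x, |PlanarEigenmode.vorticity (u s) x| ≤ m)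
    (x : EuclideanSpace ℝ (Fin 2)) :
    |PlanarEigenmode.vorticity (u t) x| ≤
      8 * Cg *
        m / (ν * (t - t₀)) := by
  have hτ : 0 < t - t₀ := sub_pos.2 htt
  have hm0 : 0 ≤ m := (integral_nonneg fun y => abs_nonneg _).trans (hm t (right_mem_Icc.2 htt.le))
  have hU : UniqueDiffOn ℝ S := uniqueDiffOn_of_convex_of_lt hS ht₀ ht htt
  have hsm := PlanarEigenmode.isSmoothSpaceTimeOn_vorticity h.smooth_velocity hU
  obtain ⟨C, hC, hdec⟩ := exists_planarVorticity_decay_const₃ h.smooth_velocity hU hω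
  set K : ℕ := 0 + (Module.finrank ℝ (EuclideanSpace ℝ (Fin 2)) + 1) with hK
  have hK0 : (0 : ℝ) ≤ (K : ℝ) := Nat.cast_nonneg _
  have hwc : Continuous (PlanarEigenmode.vorticity (u t)) := hsm.continuous_slice ht
  have hB : ∀ y, |PlanarEigenmode.vorticity (u t) y| ≤ C := fun y =>
    (hdec t ht y).1.trans (mul_le_of_le_one_right hC (rpow_neg_le_one y hK0))
  -- integrability of `|ω(t)|^{2^j}`: bounded by `C^{2^j − 1} · C (1+|x|)^{-K}`
  have hint : ∀ j : ℕ, Integrable fun y => |PlanarEigenmode.vorticity (u t) y| ^ (2 ^ j) := by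
    intro j
    obtain ⟨N, hN⟩ : ∃ N, 2 ^ j = N + 1 := ⟨2 ^ j - 1, by have := Nat.one_le_two_pow (n := j); omega⟩
    rw [hN]
    refine integrable_of_norm_le_rpow_neg ((continuous_abs.comp hwc).pow _) (C := C ^ N * C)
      (r := (K : ℝ)) finrank_lt_weightExp fun y => ?_
    rw [Real.norm_eq_abs, abs_pow, abs_abs, pow_succ, mul_assoc]
    exact mul_le_mul (pow_le_pow_left₀ (abs_nonneg _) (hB y) N) (hdec t ht y).1 (abs_nonneg _)
      (pow_nonneg hC N)
  refine abs_le_of_integral_abs_pow_two_pow_le hwc hint (M := m) (by positivity) (fun j => ?_) x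
  have hj := h.integral_abs_pow_two_pow_planarVorticity_le_of_nashConst hS hν hcurl hω hbdd hCg0 hNash
    ht₀ ht htt hm j
    (s := t) ⟨sub_le_self _ (by positivity), le_rfl⟩
  refine hj.trans (div_le_self (by positivity) (one_le_pow₀ (by norm_num)))

/-- **The `L^∞` endpoint (Gallay–Wayne (1.2), `p = ∞`; Carlen–Loss):
`‖ω(t)‖_∞ ≤ 8 C_GNS m / (ν (t − t₀))`.** Let `(u, p)` be a classical planar Navier–Stokes
solution on a convex time set `S` (`ν > 0`, curl-free force, uniformly rapidly decaying vorticity,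
bounded velocity at each time). If `‖ω(s)‖_{L¹} ≤ m` for all `s ∈ [t₀, t] ⊆ S` (`t₀ < t`), then for
every `x`: `|ω(t, x)| ≤ 8 C_GNS · m / (ν (t − t₀))` — the full Nash–Moser iteration
(`integral_abs_pow_two_pow_planarVorticity_le`: `‖ω(t)‖_{2^j} ≤ (m/2^j)^{2^{-j}} (8 m C_GNS/(ν(t−t₀)))^{1 − 2^{-j}}`)
and the passage to the limit `j → ∞` (`abs_le_of_integral_abs_pow_two_pow_le`). The constant `8 C_GNS`
is not optimal (Carlen–Loss give the sharp one). TODO(general form): signed data without a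
running `L¹` bound (`L¹`-contraction). [cite: GallayWayne2005, Thm. 1.1 eq. (1.2) (p = ∞); CarlenLoss1995, Thm. 1] -/
theorem IsClassicalNSSolutionOn.abs_planarVorticity_le_of_integral_abs_le
    (h : IsClassicalNSSolutionOn S ν f u p) (hS : Convex ℝ S) (hν : 0 < ν)
    (hcurl : ∀ t ∈ S, ∀ x, PlanarEigenmode.vorticity (f t) x = 0)
    (hω : HasUniformRapidDecayOn S (fun t x => PlanarEigenmode.vorticity (u t) x))
    (hbdd : ∀ t ∈ S, ∃ M : ℝ, ∀ x, ‖u t x‖ ≤ M) {t₀ t : ℝ} (ht₀ : t₀ ∈ S) (ht : t ∈ S)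
    (htt : t₀ < t) {m : ℝ} (hm : ∀ s ∈ Icc t₀ t, ∫ x, |PlanarEigenmode.vorticity (u s) x| ≤ m)
    (x : EuclideanSpace ℝ (Fin 2)) :
    |PlanarEigenmode.vorticity (u t) x| ≤
      8 * (lintegralPowLePowLIntegralFDerivConst (volume : Measure (EuclideanSpace ℝ (Fin 2))) 2 : ℝ) *
        m / (ν * (t - t₀))  :=
  h.abs_planarVorticity_le_of_integral_abs_le_of_nashConst hS hν hcurl hω hbdd (NNReal.coe_nonneg _)
    nash_of_decay_mathlib ht₀ ht htt hm x

/-- **Non-negative vorticity: `‖ω(t)‖_∞ ≤ 8 C_GNS Γ / (ν (t − t₀))`.** In the setting of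
`abs_planarVorticity_le_of_integral_abs_le` with `ω(t₀) ≥ 0`, the running `L¹` bound is the
conserved circulation `Γ = ∫ ω(t₀)`, so `0 ≤ ω(t, x) ≤ 8 C_GNS Γ/(ν (t − t₀))` for every later
`t ∈ S` and every `x`. [cite: GallayWayne2005, Thm. 1.1 eq. (1.2) (p = ∞); CarlenLoss1995, Thm. 1] -/
theorem IsClassicalNSSolutionOn.planarVorticity_le_of_nonneg
    (h : IsClassicalNSSolutionOn S ν f u p) (hS : Convex ℝ S) (hν : 0 < ν)
    (hcurl : ∀ t ∈ S, ∀ x, PlanarEigenmode.vorticity (f t) x = 0)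
    (hω : HasUniformRapidDecayOn S (fun t x => PlanarEigenmode.vorticity (u t) x))
    (hbdd : ∀ t ∈ S, ∃ M : ℝ, ∀ x, ‖u t x‖ ≤ M) {t₀ t : ℝ} (ht₀ : t₀ ∈ S)
    (h0 : ∀ x, 0 ≤ PlanarEigenmode.vorticity (u t₀) x) (ht : t ∈ S) (htt : t₀ < t)
    (x : EuclideanSpace ℝ (Fin 2)) :
    PlanarEigenmode.vorticity (u t) x ≤
      8 * (lintegralPowLePowLIntegralFDerivConst (volume : Measure (EuclideanSpace ℝ (Fin 2))) 2 : ℝ) *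
        (∫ y, PlanarEigenmode.vorticity (u t₀) y) / (ν * (t - t₀)) :=
  (le_abs_self _).trans (h.abs_planarVorticity_le_of_integral_abs_le hS hν hcurl hω hbdd ht₀ ht htt
    (fun _ hs => ((h.integral_abs_planarVorticity_eq_of_nonneg hS hν.le hcurl hω hbdd ht₀ h0
      (hS.ordConnected.out ht₀ ht hs) hs.1).2).le) x)

/-! ### §7 The `L¹` contraction (signed data): `‖ω(s)‖₁ ≤ ‖ω(t₀)‖₁` -/

/-! #### §7.1 Calculus of the smoothed absolute value `φ_ε(y) = (y² + ε²)^{1/2}` -/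

/-- `0 < y² + ε²`. [folklore] -/
private theorem sq_add_sq_pos' {ε : ℝ} (hε : 0 < ε) (y : ℝ) : 0 < y ^ 2 + ε ^ 2 := by positivity

/-- `ε ≤ (y² + ε²)^{1/2}`. [folklore] -/
private theorem le_sqrt_sq_add {ε : ℝ} (hε : 0 < ε) (y : ℝ) : ε ≤ Real.sqrt (y ^ 2 + ε ^ 2) :=
  calc ε = Real.sqrt (ε ^ 2) := (Real.sqrt_sq hε.le).symm
    _ ≤ Real.sqrt (y ^ 2 + ε ^ 2) := Real.sqrt_le_sqrt (by nlinarith [sq_nonneg y])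

/-- `|y| ≤ (y² + ε²)^{1/2}`. [folklore] -/
private theorem abs_le_sqrt_sq_add (ε y : ℝ) : |y| ≤ Real.sqrt (y ^ 2 + ε ^ 2) :=
  calc |y| = Real.sqrt (y ^ 2) := (Real.sqrt_sq_eq_abs y).symm
    _ ≤ Real.sqrt (y ^ 2 + ε ^ 2) := Real.sqrt_le_sqrt (by nlinarith [sq_nonneg ε])

/-- `(y² + ε²)^{1/2} ≤ |y| + ε`. [folklore] -/
private theorem sqrt_sq_add_le {ε : ℝ} (hε : 0 ≤ ε) (y : ℝ) : Real.sqrt (y ^ 2 + ε ^ 2) ≤ |y| + ε :=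
  calc Real.sqrt (y ^ 2 + ε ^ 2) ≤ Real.sqrt ((|y| + ε) ^ 2) :=
        Real.sqrt_le_sqrt (by rw [add_sq, sq_abs]; nlinarith [abs_nonneg y])
    _ = |y| + ε := Real.sqrt_sq (by positivity)

/-- `φ_ε' = y/(y²+ε²)^{1/2}`. [folklore] -/
private theorem hasDerivAt_sqrt_sq_add {ε : ℝ} (hε : 0 < ε) (y : ℝ) :
    HasDerivAt (fun z : ℝ => Real.sqrt (z ^ 2 + ε ^ 2)) (y / Real.sqrt (y ^ 2 + ε ^ 2)) y := by
  have h1 : HasDerivAt (fun z : ℝ => z ^ 2 + ε ^ 2) (2 * y) y := by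
    simpa using (hasDerivAt_pow 2 y).add_const (ε ^ 2)
  have h2 := h1.sqrt (sq_add_sq_pos' hε y).ne'
  refine h2.congr_deriv ?_
  field_simp

/-- `φ_ε'' = ε²/((y²+ε²)(y²+ε²)^{1/2})`. [folklore] -/
private theorem hasDerivAt_div_sqrt_sq_add {ε : ℝ} (hε : 0 < ε) (y : ℝ) :
    HasDerivAt (fun z : ℝ => z / Real.sqrt (z ^ 2 + ε ^ 2))
      (ε ^ 2 / ((y ^ 2 + ε ^ 2) * Real.sqrt (y ^ 2 + ε ^ 2))) y := by
  have hpos := sq_add_sq_pos' hε y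
  have hsq : 0 < Real.sqrt (y ^ 2 + ε ^ 2) := Real.sqrt_pos.2 hpos
  have h := (hasDerivAt_id' y).div (hasDerivAt_sqrt_sq_add hε y) hsq.ne'
  refine h.congr_deriv ?_
  have e2 : Real.sqrt (y ^ 2 + ε ^ 2) ^ 2 = y ^ 2 + ε ^ 2 := Real.sq_sqrt hpos.le
  set r : ℝ := Real.sqrt (y ^ 2 + ε ^ 2) with hr
  rw [← e2]
  field_simp
  linear_combination e2

/-- `φ_ε` is smooth. [folklore] -/
private theorem contDiff_sqrt_sq_add {ε : ℝ} (hε : 0 < ε) {n : WithTop ℕ∞} :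
    ContDiff ℝ n (fun z : ℝ => Real.sqrt (z ^ 2 + ε ^ 2)) :=
  ((contDiff_id.pow 2).add contDiff_const).sqrt fun z => (sq_add_sq_pos' hε z).ne'

/-- `φ_ε'` is smooth. [folklore] -/
private theorem contDiff_div_sqrt_sq_add {ε : ℝ} (hε : 0 < ε) {n : WithTop ℕ∞} :
    ContDiff ℝ n (fun z : ℝ => z / Real.sqrt (z ^ 2 + ε ^ 2)) :=
  contDiff_id.div (contDiff_sqrt_sq_add hε) fun z => (Real.sqrt_pos.2 (sq_add_sq_pos' hε z)).ne'

/-- `|φ_ε'| ≤ 1`. [folklore] -/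
private theorem abs_div_sqrt_sq_add_le_one {ε : ℝ} (hε : 0 < ε) (y : ℝ) :
    |y / Real.sqrt (y ^ 2 + ε ^ 2)| ≤ 1 := by
  have hsq : 0 < Real.sqrt (y ^ 2 + ε ^ 2) := Real.sqrt_pos.2 (sq_add_sq_pos' hε y)
  rw [abs_div, abs_of_pos hsq, div_le_one hsq]
  exact abs_le_sqrt_sq_add ε y

/-- `|φ_ε'(y)| ≤ |y|/ε`. [folklore] -/
private theorem abs_div_sqrt_sq_add_le_div {ε : ℝ} (hε : 0 < ε) (y : ℝ) :
    |y / Real.sqrt (y ^ 2 + ε ^ 2)| ≤ |y| / ε := by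
  have hsq : 0 < Real.sqrt (y ^ 2 + ε ^ 2) := Real.sqrt_pos.2 (sq_add_sq_pos' hε y)
  rw [abs_div, abs_of_pos hsq]
  exact div_le_div_of_nonneg_left (abs_nonneg _) hε (le_sqrt_sq_add hε y)

/-- `0 ≤ φ_ε'' ≤ 1/ε`. [folklore] -/
private theorem div_sq_add_mul_sqrt_nonneg_le {ε : ℝ} (hε : 0 < ε) (y : ℝ) :
    0 ≤ ε ^ 2 / ((y ^ 2 + ε ^ 2) * Real.sqrt (y ^ 2 + ε ^ 2)) ∧
      ε ^ 2 / ((y ^ 2 + ε ^ 2) * Real.sqrt (y ^ 2 + ε ^ 2)) ≤ 1 / ε := by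
  have hpos := sq_add_sq_pos' hε y
  have hsq : 0 < Real.sqrt (y ^ 2 + ε ^ 2) := Real.sqrt_pos.2 hpos
  refine ⟨by positivity, ?_⟩
  rw [div_le_div_iff₀ (by positivity) hε]
  -- `ε² · ε ≤ (y² + ε²) · √(y²+ε²)`
  have h1 : ε ^ 2 ≤ y ^ 2 + ε ^ 2 := by nlinarith [sq_nonneg y]
  have h2 := le_sqrt_sq_add hε y
  calc ε ^ 2 * ε ≤ (y ^ 2 + ε ^ 2) * Real.sqrt (y ^ 2 + ε ^ 2) :=
        mul_le_mul h1 h2 hε.le hpos.le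
    _ = 1 * ((y ^ 2 + ε ^ 2) * Real.sqrt (y ^ 2 + ε ^ 2)) := (one_mul _).symm

/-! #### §7.2 The `φ_ε` balance at a fixed time and the `φ_ε` law -/

/-- **The `φ_ε` balance at a fixed time**: with `φ_ε(y) = (y² + ε²)^{1/2}`,
`∫ φ_ε'(ω) ∂ₜω = −ν ∫ φ_ε''(ω) ‖∇ω‖² + ∫ φ_ε'(ω) curl f` — the vorticity equation integrated
against `φ_ε'(ω)`; the transport term is `∫ (u·∇)(φ_ε(ω) − ε) = 0` and the viscous term is
`∫ φ_ε'(ω) Δω = −∫ φ_ε''(ω)‖∇ω‖²` (Green, for the pair `(φ_ε'(ω), ω)`).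
[cite: MajdaBertozziCUP2002, §2.1 eq. (2.6); GallayWayne2005, Thm. 1.1 (L¹ bound, after Ben-Artzi 1994)] -/
theorem IsClassicalNSSolutionOn.integral_smoothSign_mul_timeDerivWithin_planarVorticity_eq
    (h : IsClassicalNSSolutionOn S ν f u p) (hU : UniqueDiffOn ℝ S)
    (hω : HasUniformRapidDecayOn S (fun t x => PlanarEigenmode.vorticity (u t) x)) {t : ℝ}
    (ht : t ∈ S) {M : ℝ} (hM : ∀ x, ‖u t x‖ ≤ M) {ε : ℝ} (hε : 0 < ε) :
    Integrable (fun x => PlanarEigenmode.vorticity (u t) x /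
        Real.sqrt (PlanarEigenmode.vorticity (u t) x ^ 2 + ε ^ 2) * PlanarEigenmode.vorticity (f t) x)
        (volume : Measure (EuclideanSpace ℝ (Fin 2))) ∧
      ∫ x, PlanarEigenmode.vorticity (u t) x /
          Real.sqrt (PlanarEigenmode.vorticity (u t) x ^ 2 + ε ^ 2) *
          timeDerivWithin S (fun s y => PlanarEigenmode.vorticity (u s) y) t x =
        -(ν * ∫ x, ε ^ 2 / ((PlanarEigenmode.vorticity (u t) x ^ 2 + ε ^ 2) *
            Real.sqrt (PlanarEigenmode.vorticity (u t) x ^ 2 + ε ^ 2)) *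
            ‖fderiv ℝ (PlanarEigenmode.vorticity (u t)) x‖ ^ 2) +
          ∫ x, PlanarEigenmode.vorticity (u t) x /
            Real.sqrt (PlanarEigenmode.vorticity (u t) x ^ 2 + ε ^ 2) *
            PlanarEigenmode.vorticity (f t) x := by
  obtain ⟨C, hC, hdec⟩ := exists_planarVorticity_decay_const₃ h.smooth_velocity hU hω
  set K : ℕ := 0 + (Module.finrank ℝ (EuclideanSpace ℝ (Fin 2)) + 1) with hK
  have hKr : (Module.finrank ℝ (EuclideanSpace ℝ (Fin 2)) : ℝ) < (K : ℝ) := finrank_lt_weightExp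
  have hK0 : (0 : ℝ) ≤ (K : ℝ) := Nat.cast_nonneg _
  -- abbreviations
  set w : EuclideanSpace ℝ (Fin 2) → ℝ := PlanarEigenmode.vorticity (u t) with hw
  set wt : EuclideanSpace ℝ (Fin 2) → ℝ :=
    timeDerivWithin S (fun s y => PlanarEigenmode.vorticity (u s) y) t with hwt
  set g : EuclideanSpace ℝ (Fin 2) → ℝ := PlanarEigenmode.vorticity (f t) with hg
  set φ₁ : ℝ → ℝ := fun z => z / Real.sqrt (z ^ 2 + ε ^ 2) with hφ₁
  set φ₂ : ℝ → ℝ := fun z => ε ^ 2 / ((z ^ 2 + ε ^ 2) * Real.sqrt (z ^ 2 + ε ^ 2)) with hφ₂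
  have h0 : ∀ x, |w x| ≤ C * (1 + ‖x‖) ^ (-(K : ℝ)) := fun x => (hdec t ht x).1
  have h1 : ∀ x, ‖fderiv ℝ w x‖ ≤ C * (1 + ‖x‖) ^ (-(K : ℝ)) := fun x => (hdec t ht x).2.1
  have h2 : ∀ x, ‖fderiv ℝ (fderiv ℝ w) x‖ ≤ C * (1 + ‖x‖) ^ (-(K : ℝ)) := fun x =>
    (hdec t ht x).2.2.1
  have h3 : ∀ x, |wt x| ≤ C * (1 + ‖x‖) ^ (-(K : ℝ)) := fun x => (hdec t ht x).2.2.2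
  have hw0 : ∀ x : EuclideanSpace ℝ (Fin 2), 0 ≤ (1 + ‖x‖) ^ (-(K : ℝ)) := fun x =>
    Real.rpow_nonneg (by positivity) _
  have hφ₁B : ∀ x, |φ₁ (w x)| ≤ 1 := fun x => abs_div_sqrt_sq_add_le_one hε (w x)
  -- regularity
  have hsm := PlanarEigenmode.isSmoothSpaceTimeOn_vorticity h.smooth_velocity hU
  have hw2 : ContDiff ℝ 2 w := contDiff_infty.1 (hsm.contDiff_slice ht) 2
  have hw1 : ContDiff ℝ 1 w := contDiff_infty.1 (hsm.contDiff_slice ht) 1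
  have hwd : Differentiable ℝ w := hw1.differentiable one_ne_zero
  have hu1 : ContDiff ℝ 1 (u t) := contDiff_infty.1 (h.contDiff_velocity ht) 1
  have huc : Continuous (u t) := hu1.continuous
  have hwc : Continuous w := hw1.continuous
  have hDwc : Continuous (fderiv ℝ w) := hw1.continuous_fderiv one_ne_zero
  have hwtc : Continuous wt := hsm.continuous_timeDerivWithin hU ht
  have hφ₁c : Continuous fun x => φ₁ (w x) := (contDiff_div_sqrt_sq_add hε (n := 1)).continuous.comp hwc
  have hφ₂c : Continuous fun x => φ₂ (w x) := by
    have hc : Continuous φ₂ := by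
      refine continuous_const.div ((((continuous_id.pow 2).add continuous_const)).mul
        (contDiff_sqrt_sq_add hε (n := 1)).continuous) fun z => ?_
      exact (mul_pos (sq_add_sq_pos' hε z) (Real.sqrt_pos.2 (sq_add_sq_pos' hε z))).ne'
    exact hc.comp hwc
  -- integrability of the three products (`|φ₁(ω)| ≤ 1` against decaying factors)
  have hIt : Integrable (fun x => φ₁ (w x) * wt x) (volume : Measure (EuclideanSpace ℝ (Fin 2))) := by
    refine integrable_of_norm_le_rpow_neg (hφ₁c.mul hwtc) (C := 1 * C) hKr fun x => ?_
    rw [norm_mul, Real.norm_eq_abs, Real.norm_eq_abs, mul_assoc]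
    exact mul_le_mul (hφ₁B x) (h3 x) (abs_nonneg _) zero_le_one
  have hIc : Integrable (fun x => φ₁ (w x) * fderiv ℝ w x (u t x))
      (volume : Measure (EuclideanSpace ℝ (Fin 2))) := by
    have hM0 : 0 ≤ M := (norm_nonneg _).trans (hM 0)
    refine integrable_of_norm_le_rpow_neg (hφ₁c.mul (hDwc.clm_apply huc)) (C := 1 * (C * M)) hKr
      fun x => ?_
    rw [norm_mul, Real.norm_eq_abs, Real.norm_eq_abs]
    have hD : |fderiv ℝ w x (u t x)| ≤ C * M * (1 + ‖x‖) ^ (-(K : ℝ)) := by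
      rw [← Real.norm_eq_abs]
      calc ‖fderiv ℝ w x (u t x)‖ ≤ ‖fderiv ℝ w x‖ * ‖u t x‖ := ContinuousLinearMap.le_opNorm _ _
        _ ≤ C * (1 + ‖x‖) ^ (-(K : ℝ)) * M :=
            mul_le_mul (h1 x) (hM x) (norm_nonneg _) (mul_nonneg hC (hw0 x))
        _ = C * M * (1 + ‖x‖) ^ (-(K : ℝ)) := by ring
    calc |φ₁ (w x)| * |fderiv ℝ w x (u t x)| ≤ 1 * (C * M * (1 + ‖x‖) ^ (-(K : ℝ))) :=
          mul_le_mul (hφ₁B x) hD (abs_nonneg _) zero_le_one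
      _ = 1 * (C * M) * (1 + ‖x‖) ^ (-(K : ℝ)) := by ring
  have hIΔ : Integrable (fun x => φ₁ (w x) * (Δ w) x) (volume : Measure (EuclideanSpace ℝ (Fin 2))) := by
    refine integrable_of_norm_le_rpow_neg (hφ₁c.mul (continuous_laplacian hw2))
      (C := 1 * (Module.finrank ℝ (EuclideanSpace ℝ (Fin 2)) * C)) hKr fun x => ?_
    rw [norm_mul, Real.norm_eq_abs]
    have hL : ‖(Δ w) x‖ ≤ Module.finrank ℝ (EuclideanSpace ℝ (Fin 2)) * C * (1 + ‖x‖) ^ (-(K : ℝ)) :=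
      calc ‖(Δ w) x‖ ≤ Module.finrank ℝ (EuclideanSpace ℝ (Fin 2)) * ‖fderiv ℝ (fderiv ℝ w) x‖ :=
            norm_laplacian_le w x
        _ ≤ Module.finrank ℝ (EuclideanSpace ℝ (Fin 2)) * (C * (1 + ‖x‖) ^ (-(K : ℝ))) := by
            gcongr; exact h2 x
        _ = Module.finrank ℝ (EuclideanSpace ℝ (Fin 2)) * C * (1 + ‖x‖) ^ (-(K : ℝ)) := by ring
    calc |φ₁ (w x)| * ‖(Δ w) x‖
        ≤ 1 * (Module.finrank ℝ (EuclideanSpace ℝ (Fin 2)) * C * (1 + ‖x‖) ^ (-(K : ℝ))) :=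
          mul_le_mul (hφ₁B x) hL (norm_nonneg _) zero_le_one
      _ = 1 * (Module.finrank ℝ (EuclideanSpace ℝ (Fin 2)) * C) * (1 + ‖x‖) ^ (-(K : ℝ)) := by ring
  -- the vorticity equation (2.6), weighted by `φ₁(ω)`
  have hpt : ∀ x, φ₁ (w x) * g x =
      φ₁ (w x) * wt x + φ₁ (w x) * fderiv ℝ w x (u t x) - ν * (φ₁ (w x) * (Δ w) x) := by
    intro x
    have he := h.planarVorticity_eq hU ht x
    rw [convect_apply] at he
    linear_combination (-(φ₁ (w x))) * he
  have hIf : Integrable (fun x => φ₁ (w x) * g x) (volume : Measure (EuclideanSpace ℝ (Fin 2))) :=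
    ((hIt.add hIc).sub (hIΔ.const_mul ν)).congr (Eventually.of_forall fun x => (hpt x).symm)
  refine ⟨hIf, ?_⟩
  -- the transport term vanishes: `∫ D(φ_ε(ω) − ε)(u) = 0`
  have htrans : ∫ x, φ₁ (w x) * fderiv ℝ w x (u t x) = 0 := by
    have hθ : ContDiff ℝ 1 (fun y => Real.sqrt (w y ^ 2 + ε ^ 2) - ε) :=
      ((contDiff_sqrt_sq_add hε (n := 1)).comp hw1).sub contDiff_const
    have hθf : ∀ x, HasFDerivAt (fun y => Real.sqrt (w y ^ 2 + ε ^ 2) - ε)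
        (φ₁ (w x) • fderiv ℝ w x) x := fun x =>
      ((hasDerivAt_sqrt_sq_add hε (w x)).comp_hasFDerivAt x (hwd x).hasFDerivAt).sub_const ε
    have hθ0 : ∀ x, |Real.sqrt (w x ^ 2 + ε ^ 2) - ε| ≤ C * (1 + ‖x‖) ^ (-(K : ℝ)) := by
      intro x
      rw [abs_of_nonneg (sub_nonneg.2 (le_sqrt_sq_add hε (w x)))]
      have := sqrt_sq_add_le hε.le (w x)
      linarith [h0 x]
    have hθ1 : ∀ x, ‖fderiv ℝ (fun y => Real.sqrt (w y ^ 2 + ε ^ 2) - ε) x‖ ≤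
        C * (1 + ‖x‖) ^ (-(K : ℝ)) := by
      intro x
      rw [(hθf x).fderiv, norm_smul, Real.norm_eq_abs]
      calc |φ₁ (w x)| * ‖fderiv ℝ w x‖ ≤ 1 * (C * (1 + ‖x‖) ^ (-(K : ℝ))) :=
            mul_le_mul (hφ₁B x) (h1 x) (norm_nonneg _) zero_le_one
        _ = C * (1 + ‖x‖) ^ (-(K : ℝ)) := one_mul _
    have hone : ContDiff ℝ 1 (fun _ : EuclideanSpace ℝ (Fin 2) => (1 : ℝ)) := contDiff_const
    have hone0 : ∀ x : EuclideanSpace ℝ (Fin 2), |(1 : ℝ)| ≤ 1 * (1 + ‖x‖) ^ (0 : ℕ) := fun x => by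
      simp
    have hone1 : ∀ x : EuclideanSpace ℝ (Fin 2),
        ‖gradient (fun _ : EuclideanSpace ℝ (Fin 2) => (1 : ℝ)) x‖ ≤ 1 * (1 + ‖x‖) ^ (0 : ℕ) := by
      intro x
      rw [gradient, fderiv_const_apply, map_zero, norm_zero, pow_zero, mul_one]
      exact zero_le_one
    have H := integral_mul_fderiv_apply_eq_neg_of_decay hu1 hθ hone (h.divFree t ht) hM
      hone0 hone1 hθ0 hθ1
    have hzero : ∫ x, (1 : ℝ) * fderiv ℝ (fun y => Real.sqrt (w y ^ 2 + ε ^ 2) - ε) x (u t x) = 0 := by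
      rw [H]
      simp [gradient, fderiv_const_apply]
    have e : ∫ x, (1 : ℝ) * fderiv ℝ (fun y => Real.sqrt (w y ^ 2 + ε ^ 2) - ε) x (u t x) =
        ∫ x, φ₁ (w x) * fderiv ℝ w x (u t x) := by
      refine integral_congr_ae (Eventually.of_forall fun x => ?_)
      dsimp only
      rw [one_mul, (hθf x).fderiv, _root_.smul_apply, smul_eq_mul]
    rw [e] at hzero
    exact hzero
  -- the viscous term: `∫ φ₁(ω) Δω = −∫ φ₂(ω) ‖∇ω‖²` (Green for the pair `(φ₁ ∘ ω, ω)`)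
  have hvisc : ∫ x, φ₁ (w x) * (Δ w) x = -∫ x, φ₂ (w x) * ‖fderiv ℝ w x‖ ^ 2 := by
    have hφc : ContDiff ℝ 1 (fun y => φ₁ (w y)) := (contDiff_div_sqrt_sq_add hε (n := 1)).comp hw1
    have hφf : ∀ x, HasFDerivAt (fun y => φ₁ (w y)) (φ₂ (w x) • fderiv ℝ w x) x := fun x =>
      (hasDerivAt_div_sqrt_sq_add hε (w x)).comp_hasFDerivAt x (hwd x).hasFDerivAt
    -- one constant for the pair
    set C' : ℝ := C + C / ε with hC'
    have hC'0 : 0 ≤ C' := by positivity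
    have hCC' : C ≤ C' := by rw [hC']; linarith [div_nonneg hC hε.le]
    have hCε : C / ε ≤ C' := by rw [hC']; linarith
    have g0 : ∀ x, ‖φ₁ (w x)‖ ≤ C' * (1 + ‖x‖) ^ (-(K : ℝ)) := by
      intro x
      rw [Real.norm_eq_abs]
      calc |φ₁ (w x)| ≤ |w x| / ε := abs_div_sqrt_sq_add_le_div hε (w x)
        _ ≤ C * (1 + ‖x‖) ^ (-(K : ℝ)) / ε := div_le_div_of_nonneg_right (h0 x) hε.le
        _ = C / ε * (1 + ‖x‖) ^ (-(K : ℝ)) := by ring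
        _ ≤ C' * (1 + ‖x‖) ^ (-(K : ℝ)) := mul_le_mul_of_nonneg_right hCε (hw0 x)
    have g1 : ∀ x, ‖fderiv ℝ (fun y => φ₁ (w y)) x‖ ≤ C' * (1 + ‖x‖) ^ (-(K : ℝ)) := by
      intro x
      rw [(hφf x).fderiv, norm_smul, Real.norm_eq_abs,
        abs_of_nonneg (div_sq_add_mul_sqrt_nonneg_le hε (w x)).1]
      calc φ₂ (w x) * ‖fderiv ℝ w x‖ ≤ 1 / ε * (C * (1 + ‖x‖) ^ (-(K : ℝ))) :=
            mul_le_mul (div_sq_add_mul_sqrt_nonneg_le hε (w x)).2 (h1 x) (norm_nonneg _)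
              (by positivity)
        _ = C / ε * (1 + ‖x‖) ^ (-(K : ℝ)) := by ring
        _ ≤ C' * (1 + ‖x‖) ^ (-(K : ℝ)) := mul_le_mul_of_nonneg_right hCε (hw0 x)
    have h1' : ∀ x, ‖fderiv ℝ w x‖ ≤ C' * (1 + ‖x‖) ^ (-(K : ℝ)) := fun x =>
      (h1 x).trans (mul_le_mul_of_nonneg_right hCC' (hw0 x))
    have h2' : ∀ x, ‖fderiv ℝ (fderiv ℝ w) x‖ ≤ C' * (1 + ‖x‖) ^ (-(K : ℝ)) := fun x =>
      (h2 x).trans (mul_le_mul_of_nonneg_right hCC' (hw0 x))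
    rw [integral_mul_laplacian_eq_neg_integral_sum_fderiv_mul_fderiv hw2 hφc hC'0 hKr h1' h2' g0 g1
      (EuclideanSpace.basisFun (Fin 2) ℝ)]
    congr 1
    refine integral_congr_ae (Eventually.of_forall fun x => ?_)
    dsimp only
    simp_rw [(hφf x).fderiv, _root_.smul_apply, smul_eq_mul, mul_assoc, ← Finset.mul_sum, ← sq]
    rw [sum_sq_fderiv_apply_eq_norm_sq]
  -- assemble
  have hkey : ∀ x, φ₁ (w x) * wt x =
      -(φ₁ (w x) * fderiv ℝ w x (u t x)) + ν * (φ₁ (w x) * (Δ w) x) + φ₁ (w x) * g x := fun x => by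
    linear_combination (-1 : ℝ) * hpt x
  have hI1 : Integrable (fun x => -(φ₁ (w x) * fderiv ℝ w x (u t x)))
      (volume : Measure (EuclideanSpace ℝ (Fin 2))) := hIc.neg
  have hI2 : Integrable (fun x => ν * (φ₁ (w x) * (Δ w) x))
      (volume : Measure (EuclideanSpace ℝ (Fin 2))) := hIΔ.const_mul _
  have hI12 : Integrable (fun x => -(φ₁ (w x) * fderiv ℝ w x (u t x)) + ν * (φ₁ (w x) * (Δ w) x))
      (volume : Measure (EuclideanSpace ℝ (Fin 2))) := hI1.add hI2
  have eI : ∫ x, φ₁ (w x) * wt x =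
      -(∫ x, φ₁ (w x) * fderiv ℝ w x (u t x)) + ν * (∫ x, φ₁ (w x) * (Δ w) x) +
        ∫ x, φ₁ (w x) * g x := by
    rw [integral_congr_ae (Eventually.of_forall hkey), integral_add hI12 hIf,
      integral_add hI1 hI2, integral_neg, integral_const_mul]
  rw [eI, htrans, hvisc]
  ring

/-- **The `φ_ε` law within a convex time set**: `s ↦ ∫ (φ_ε(ω(s)) − ε)` has within `S` at `t`
the derivative `−ν ∫ φ_ε''(ω(t))‖∇ω(t)‖² + ∫ φ_ε'(ω(t)) curl f(t)` (differentiation under the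
integral sign, dominated by the uniform decay of `∂ₜω` and `|φ_ε'| ≤ 1`; then the fixed-time
balance). [cite: GallayWayne2005, Thm. 1.1 (L¹ bound, after Ben-Artzi 1994); MajdaBertozziCUP2002, §2.1 eq. (2.6)] -/
theorem IsClassicalNSSolutionOn.hasDerivWithinAt_integral_smoothAbs_planarVorticity
    (h : IsClassicalNSSolutionOn S ν f u p) (hS : Convex ℝ S)
    (hω : HasUniformRapidDecayOn S (fun t x => PlanarEigenmode.vorticity (u t) x)) {t : ℝ}
    (ht : t ∈ S) {M : ℝ} (hM : ∀ x, ‖u t x‖ ≤ M) {ε : ℝ} (hε : 0 < ε) :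
    HasDerivWithinAt
      (fun s => ∫ x, (Real.sqrt (PlanarEigenmode.vorticity (u s) x ^ 2 + ε ^ 2) - ε))
      (-(ν * ∫ x, ε ^ 2 / ((PlanarEigenmode.vorticity (u t) x ^ 2 + ε ^ 2) *
            Real.sqrt (PlanarEigenmode.vorticity (u t) x ^ 2 + ε ^ 2)) *
            ‖fderiv ℝ (PlanarEigenmode.vorticity (u t)) x‖ ^ 2) +
          ∫ x, PlanarEigenmode.vorticity (u t) x /
            Real.sqrt (PlanarEigenmode.vorticity (u t) x ^ 2 + ε ^ 2) *
            PlanarEigenmode.vorticity (f t) x) S t := by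
  by_cases hacc : AccPt t (𝓟 S)
  swap
  · exact hasDerivWithinAt_iff_hasFDerivWithinAt.2 (HasFDerivWithinAt.of_not_accPt hacc)
  have hU : UniqueDiffOn ℝ S := uniqueDiffOn_of_convex_of_accPt hS ht hacc
  have hsm := PlanarEigenmode.isSmoothSpaceTimeOn_vorticity h.smooth_velocity hU
  obtain ⟨C, hC, hdec⟩ := exists_planarVorticity_decay_const₃ h.smooth_velocity hU hω
  set K : ℕ := 0 + (Module.finrank ℝ (EuclideanSpace ℝ (Fin 2)) + 1) with hK
  have hKr : (Module.finrank ℝ (EuclideanSpace ℝ (Fin 2)) : ℝ) < (K : ℝ) := finrank_lt_weightExp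
  -- the dominating function `C (1 + |x|)^{-K}`
  set bound : EuclideanSpace ℝ (Fin 2) → ℝ := fun x => C * (1 + ‖x‖) ^ (-(K : ℝ)) with hbound
  have hbc : Continuous bound := by
    have h1 : Continuous fun x : EuclideanSpace ℝ (Fin 2) => (1 + ‖x‖) := by fun_prop
    exact continuous_const.mul (h1.rpow_const fun x => Or.inl (by positivity))
  have hbi : Integrable bound (volume : Measure (EuclideanSpace ℝ (Fin 2))) :=
    integrable_of_norm_le_rpow_neg hbc (C := C) hKr fun x => by
      rw [Real.norm_of_nonneg (by positivity)]
  have hφc : Continuous fun z : ℝ => Real.sqrt (z ^ 2 + ε ^ 2) - ε :=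
    (contDiff_sqrt_sq_add hε (n := 1)).continuous.sub continuous_const
  have hF_meas : ∀ s ∈ S, AEStronglyMeasurable
      (fun x => Real.sqrt (PlanarEigenmode.vorticity (u s) x ^ 2 + ε ^ 2) - ε)
      (volume : Measure (EuclideanSpace ℝ (Fin 2))) :=
    fun s hs => (hφc.comp (hsm.continuous_slice hs)).aestronglyMeasurable
  have hF_int : Integrable (fun x => Real.sqrt (PlanarEigenmode.vorticity (u t) x ^ 2 + ε ^ 2) - ε)
      (volume : Measure (EuclideanSpace ℝ (Fin 2))) := by
    refine integrable_of_norm_le_rpow_neg (hφc.comp (hsm.continuous_slice ht)) (C := C) hKr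
      fun x => ?_
    rw [Real.norm_eq_abs, abs_of_nonneg (sub_nonneg.2 (le_sqrt_sq_add hε _))]
    have := sqrt_sq_add_le hε.le (PlanarEigenmode.vorticity (u t) x)
    linarith [(hdec t ht x).1]
  have h_bound : ∀ s ∈ S, ∀ x,
      ‖PlanarEigenmode.vorticity (u s) x / Real.sqrt (PlanarEigenmode.vorticity (u s) x ^ 2 + ε ^ 2) *
        timeDerivWithin S (fun r y => PlanarEigenmode.vorticity (u r) y) s x‖ ≤ bound x := by
    intro s hs x
    rw [hbound, norm_mul, Real.norm_eq_abs, Real.norm_eq_abs]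
    calc _ ≤ 1 * (C * (1 + ‖x‖) ^ (-(K : ℝ))) :=
          mul_le_mul (abs_div_sqrt_sq_add_le_one hε _) (hdec s hs x).2.2.2 (abs_nonneg _) zero_le_one
      _ = C * (1 + ‖x‖) ^ (-(K : ℝ)) := one_mul _
  have h_diff : ∀ s ∈ S, ∀ x, HasDerivWithinAt
      (fun r => Real.sqrt (PlanarEigenmode.vorticity (u r) x ^ 2 + ε ^ 2) - ε)
      (PlanarEigenmode.vorticity (u s) x / Real.sqrt (PlanarEigenmode.vorticity (u s) x ^ 2 + ε ^ 2) *
        timeDerivWithin S (fun r y => PlanarEigenmode.vorticity (u r) y) s x) S s := by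
    intro s hs x
    exact ((hasDerivAt_sqrt_sq_add hε _).comp_hasDerivWithinAt s
      (hsm.hasDerivWithinAt_timeDerivWithin hU hs x)).sub_const ε
  have hD := hasDerivWithinAt_integral_of_dominated_convex hS ht
    (F := fun s x => Real.sqrt (PlanarEigenmode.vorticity (u s) x ^ 2 + ε ^ 2) - ε)
    (F' := fun s x => PlanarEigenmode.vorticity (u s) x /
      Real.sqrt (PlanarEigenmode.vorticity (u s) x ^ 2 + ε ^ 2) *
        timeDerivWithin S (fun r y => PlanarEigenmode.vorticity (u r) y) s x)
    hF_meas hF_int h_bound hbi h_diff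
  exact hD.congr_deriv
    (h.integral_smoothSign_mul_timeDerivWithin_planarVorticity_eq hU hω ht hM hε).2

/-! #### §7.3 The contraction -/

/-- **THE `L¹` CONTRACTION OF THE PLANAR VORTICITY EQUATION** (Ben-Artzi 1994; Gallay–Wayne 2005,
Thm. 1.1: `ω ∈ C⁰([0,∞), L¹)` with `|ω(t)|₁ ≤ |ω₀|₁`). Let `(u, p)` be a classical planar
Navier–Stokes solution on a CONVEX time set `S` with `ν ≥ 0` and curl-free force, whose vorticity
has uniform rapid decay on `S` and with `u(t)` bounded at each time. Then for `t₀ ≤ s` in `S`: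
`∫ |ω(s)| ≤ ∫ |ω(t₀)|` — SIGNED data. Proof: for every `ε > 0`, `∫ (φ_ε(ω) − ε)` is
non-increasing (`φ_ε'' ≥ 0` in the `φ_ε` law) and `φ_ε(y) − ε ≤ |y|`; then `ε → 0` by dominated
convergence. This discharges the running `L¹` bound `m = ‖ω(t₀)‖₁` of §4 and §6.
[cite: GallayWayne2005, Thm. 1.1 (L¹ bound, after Ben-Artzi 1994)] -/
theorem IsClassicalNSSolutionOn.integral_abs_planarVorticity_le
    (h : IsClassicalNSSolutionOn S ν f u p) (hS : Convex ℝ S) (hν : 0 ≤ ν)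
    (hcurl : ∀ t ∈ S, ∀ x, PlanarEigenmode.vorticity (f t) x = 0)
    (hω : HasUniformRapidDecayOn S (fun t x => PlanarEigenmode.vorticity (u t) x))
    (hbdd : ∀ t ∈ S, ∃ M : ℝ, ∀ x, ‖u t x‖ ≤ M) {t₀ s : ℝ} (ht₀ : t₀ ∈ S) (hs : s ∈ S)
    (hts : t₀ ≤ s) :
    ∫ x, |PlanarEigenmode.vorticity (u s) x| ≤ ∫ x, |PlanarEigenmode.vorticity (u t₀) x| := by
  rcases hts.eq_or_lt with rfl | hlt
  · exact le_rfl
  have hU : UniqueDiffOn ℝ S := uniqueDiffOn_of_convex_of_lt hS ht₀ hs hlt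
  have hsm := PlanarEigenmode.isSmoothSpaceTimeOn_vorticity h.smooth_velocity hU
  obtain ⟨C, hC, hdec⟩ := exists_planarVorticity_decay_const₃ h.smooth_velocity hU hω
  set K : ℕ := 0 + (Module.finrank ℝ (EuclideanSpace ℝ (Fin 2)) + 1) with hK
  have hKr : (Module.finrank ℝ (EuclideanSpace ℝ (Fin 2)) : ℝ) < (K : ℝ) := finrank_lt_weightExp
  have hsub : Icc t₀ s ⊆ S := hS.ordConnected.out ht₀ hs
  -- integrability of `|ω(r)|`
  have hIabs : ∀ r ∈ S, Integrable (fun x => |PlanarEigenmode.vorticity (u r) x|)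
      (volume : Measure (EuclideanSpace ℝ (Fin 2))) := fun r hr =>
    integrable_of_norm_le_rpow_neg (continuous_abs.comp (hsm.continuous_slice hr)) (C := C) hKr
      fun x => by rw [Real.norm_eq_abs, abs_abs]; exact (hdec r hr x).1
  -- Step 1: for every `ε > 0`, `∫ (φ_ε(ω(s)) − ε) ≤ ∫ |ω(t₀)|`
  have hstep : ∀ ε : ℝ, 0 < ε →
      ∫ x, (Real.sqrt (PlanarEigenmode.vorticity (u s) x ^ 2 + ε ^ 2) - ε) ≤
        ∫ x, |PlanarEigenmode.vorticity (u t₀) x| := by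
    intro ε hε
    set G : ℝ → ℝ := fun r => ∫ x, (Real.sqrt (PlanarEigenmode.vorticity (u r) x ^ 2 + ε ^ 2) - ε)
      with hG
    -- `G` is non-increasing on `[t₀, s]`
    have hGd : ∀ r ∈ Icc t₀ s, HasDerivWithinAt G
        (-(ν * ∫ x, ε ^ 2 / ((PlanarEigenmode.vorticity (u r) x ^ 2 + ε ^ 2) *
            Real.sqrt (PlanarEigenmode.vorticity (u r) x ^ 2 + ε ^ 2)) *
            ‖fderiv ℝ (PlanarEigenmode.vorticity (u r)) x‖ ^ 2)) (Icc t₀ s) r := by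
      intro r hr
      obtain ⟨M, hM⟩ := hbdd r (hsub hr)
      have h1 := h.hasDerivWithinAt_integral_smoothAbs_planarVorticity hS hω (hsub hr) hM hε
      have e0 : ∫ x, PlanarEigenmode.vorticity (u r) x /
          Real.sqrt (PlanarEigenmode.vorticity (u r) x ^ 2 + ε ^ 2) *
          PlanarEigenmode.vorticity (f r) x = 0 := by
        simp [hcurl r (hsub hr)]
      rw [e0, add_zero] at h1
      exact h1.mono hsub
    have hanti : AntitoneOn G (Icc t₀ s) := by
      refine antitoneOn_of_hasDerivWithinAt_nonpos (convex_Icc t₀ s)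
        (f' := fun r => -(ν * ∫ x, ε ^ 2 / ((PlanarEigenmode.vorticity (u r) x ^ 2 + ε ^ 2) *
            Real.sqrt (PlanarEigenmode.vorticity (u r) x ^ 2 + ε ^ 2)) *
            ‖fderiv ℝ (PlanarEigenmode.vorticity (u r)) x‖ ^ 2))
        (fun r hr => (hGd r hr).continuousWithinAt) (fun r hr => ?_) (fun r hr => ?_)
      · exact (hGd r (interior_subset hr)).mono interior_subset
      · rw [neg_nonpos]
        exact mul_nonneg hν (integral_nonneg fun x =>
          mul_nonneg (div_sq_add_mul_sqrt_nonneg_le hε _).1 (sq_nonneg _))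
    have hG1 : G s ≤ G t₀ := hanti (left_mem_Icc.2 hts) (right_mem_Icc.2 hts) hts
    -- `φ_ε(y) − ε ≤ |y|`
    have hG2 : G t₀ ≤ ∫ x, |PlanarEigenmode.vorticity (u t₀) x| := by
      rw [hG]
      refine integral_mono_of_nonneg (Eventually.of_forall fun x => ?_) (hIabs t₀ ht₀)
        (Eventually.of_forall fun x => ?_)
      · exact sub_nonneg.2 (le_sqrt_sq_add hε _)
      · have := sqrt_sq_add_le hε.le (PlanarEigenmode.vorticity (u t₀) x)
        dsimp only
        linarith
    exact hG1.trans hG2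
  -- Step 2: `ε = 1/(n+1) → 0`, dominated convergence
  have hlim : Tendsto (fun n : ℕ => ∫ x, (Real.sqrt (PlanarEigenmode.vorticity (u s) x ^ 2 +
      (1 / ((n : ℝ) + 1)) ^ 2) - 1 / ((n : ℝ) + 1))) atTop
      (𝓝 (∫ x, |PlanarEigenmode.vorticity (u s) x|)) := by
    refine tendsto_integral_of_dominated_convergence (fun x => |PlanarEigenmode.vorticity (u s) x|)
      (fun n => ?_) (hIabs s hs) (fun n => Eventually.of_forall fun x => ?_)
      (Eventually.of_forall fun x => ?_)
    · have hn : (0 : ℝ) < 1 / ((n : ℝ) + 1) := by positivity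
      exact (((contDiff_sqrt_sq_add hn (n := 1)).continuous.sub continuous_const).comp
        (hsm.continuous_slice hs)).aestronglyMeasurable
    · have hn : (0 : ℝ) < 1 / ((n : ℝ) + 1) := by positivity
      rw [Real.norm_eq_abs, abs_of_nonneg (sub_nonneg.2 (le_sqrt_sq_add hn _))]
      have := sqrt_sq_add_le hn.le (PlanarEigenmode.vorticity (u s) x)
      linarith
    · -- pointwise: `√(y² + ε_n²) − ε_n → √(y²) − 0 = |y|`
      set y : ℝ := PlanarEigenmode.vorticity (u s) x with hy
      have hε0 : Tendsto (fun n : ℕ => 1 / ((n : ℝ) + 1)) atTop (𝓝 0) :=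
        tendsto_one_div_add_atTop_nhds_zero_nat
      have hcont : Continuous fun ε : ℝ => Real.sqrt (y ^ 2 + ε ^ 2) - ε := by fun_prop
      have h1 := (hcont.tendsto 0).comp hε0
      rw [show Real.sqrt (y ^ 2 + 0 ^ 2) - 0 = |y| by simp [Real.sqrt_sq_eq_abs]] at h1
      exact h1
  exact le_of_tendsto' hlim fun n => hstep _ (by positivity)

/-! #### §7.4 Signed data: the decay estimates with `m = ‖ω(t₀)‖₁` -/

/-- **Gallay–Wayne (1.2), `p = 2`, signed data**: `‖ω(t)‖₂² ≤ 2 C_GNS ‖ω(t₀)‖₁² / (ν (t − t₀))`.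
[cite: GallayWayne2005, Thm. 1.1 eq. (1.2) (p = 2)] -/
theorem IsClassicalNSSolutionOn.integral_sq_planarVorticity_le
    (h : IsClassicalNSSolutionOn S ν f u p) (hS : Convex ℝ S) (hν : 0 < ν)
    (hcurl : ∀ t ∈ S, ∀ x, PlanarEigenmode.vorticity (f t) x = 0)
    (hω : HasUniformRapidDecayOn S (fun t x => PlanarEigenmode.vorticity (u t) x))
    (hbdd : ∀ t ∈ S, ∃ M : ℝ, ∀ x, ‖u t x‖ ≤ M) {t₀ t : ℝ} (ht₀ : t₀ ∈ S) (ht : t ∈ S)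
    (htt : t₀ < t) :
    ∫ x, PlanarEigenmode.vorticity (u t) x ^ 2 ≤
      2 * (lintegralPowLePowLIntegralFDerivConst (volume : Measure (EuclideanSpace ℝ (Fin 2))) 2 : ℝ) *
        (∫ x, |PlanarEigenmode.vorticity (u t₀) x|) ^ 2 / (ν * (t - t₀)) :=
  h.integral_sq_planarVorticity_le_of_integral_abs_le hS hν hcurl hω hbdd ht₀ ht htt fun _ hs =>
    h.integral_abs_planarVorticity_le hS hν.le hcurl hω hbdd ht₀ (hS.ordConnected.out ht₀ ht hs) hs.1

/-- **Gallay–Wayne (1.2), `p = 4`, signed data**: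
`‖ω(t)‖₄⁴ ≤ (128/3) C_GNS³ ‖ω(t₀)‖₁⁴ / (ν (t − t₀))³`. [cite: GallayWayne2005, Thm. 1.1 eq. (1.2) (p = 4)] -/
theorem IsClassicalNSSolutionOn.integral_pow_four_planarVorticity_le
    (h : IsClassicalNSSolutionOn S ν f u p) (hS : Convex ℝ S) (hν : 0 < ν)
    (hcurl : ∀ t ∈ S, ∀ x, PlanarEigenmode.vorticity (f t) x = 0)
    (hω : HasUniformRapidDecayOn S (fun t x => PlanarEigenmode.vorticity (u t) x))
    (hbdd : ∀ t ∈ S, ∃ M : ℝ, ∀ x, ‖u t x‖ ≤ M) {t₀ t : ℝ} (ht₀ : t₀ ∈ S) (ht : t ∈ S)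
    (htt : t₀ < t) :
    ∫ x, PlanarEigenmode.vorticity (u t) x ^ 4 ≤
      128 / 3 * (lintegralPowLePowLIntegralFDerivConst
        (volume : Measure (EuclideanSpace ℝ (Fin 2))) 2 : ℝ) ^ 3 *
        (∫ x, |PlanarEigenmode.vorticity (u t₀) x|) ^ 4 / (ν * (t - t₀)) ^ 3 :=
  h.integral_pow_four_planarVorticity_le_of_integral_abs_le hS hν hcurl hω hbdd ht₀ ht htt
    fun _ hs => h.integral_abs_planarVorticity_le hS hν.le hcurl hω hbdd ht₀
      (hS.ordConnected.out ht₀ ht hs) hs.1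

/-- **Gallay–Wayne (1.2), `p = ∞`, signed data**: `‖ω(t)‖_∞ ≤ 8 C_GNS ‖ω(t₀)‖₁ / (ν (t − t₀))`.
[cite: GallayWayne2005, Thm. 1.1 eq. (1.2) (p = ∞); CarlenLoss1995, Thm. 1] -/
theorem IsClassicalNSSolutionOn.abs_planarVorticity_le
    (h : IsClassicalNSSolutionOn S ν f u p) (hS : Convex ℝ S) (hν : 0 < ν)
    (hcurl : ∀ t ∈ S, ∀ x, PlanarEigenmode.vorticity (f t) x = 0)
    (hω : HasUniformRapidDecayOn S (fun t x => PlanarEigenmode.vorticity (u t) x))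
    (hbdd : ∀ t ∈ S, ∃ M : ℝ, ∀ x, ‖u t x‖ ≤ M) {t₀ t : ℝ} (ht₀ : t₀ ∈ S) (ht : t ∈ S)
    (htt : t₀ < t) (x : EuclideanSpace ℝ (Fin 2)) :
    |PlanarEigenmode.vorticity (u t) x| ≤
      8 * (lintegralPowLePowLIntegralFDerivConst (volume : Measure (EuclideanSpace ℝ (Fin 2))) 2 : ℝ) *
        (∫ y, |PlanarEigenmode.vorticity (u t₀) y|) / (ν * (t - t₀)) :=
  h.abs_planarVorticity_le_of_integral_abs_le hS hν hcurl hω hbdd ht₀ ht htt (fun _ hs =>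
    h.integral_abs_planarVorticity_le hS hν.le hcurl hω hbdd ht₀ (hS.ordConnected.out ht₀ ht hs) hs.1) x

/-! #### §7.5 All exponents `r ∈ [1, ∞)` by interpolation between `L¹` and `L^∞` -/

/-- **All exponents `r ≥ 1`, generic Nash constant** (v5): for signed data,
`∫ |ω(t)|^r ≤ (8 Cg ‖ω(t₀)‖₁/(ν (t − t₀)))^{r−1} ‖ω(t₀)‖₁` for any admissible Nash constant `Cg`
(hypothesis `hNash`), by interpolation between the `L^∞` endpoint and the `L¹` contraction.
[cite: GallayWayne2005, Thm. 1.1 eq. (1.2) (all p)] -/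
theorem IsClassicalNSSolutionOn.integral_abs_rpow_planarVorticity_le_of_nashConst
    (h : IsClassicalNSSolutionOn S ν f u p) (hS : Convex ℝ S) (hν : 0 < ν)
    (hcurl : ∀ t ∈ S, ∀ x, PlanarEigenmode.vorticity (f t) x = 0)
    (hω : HasUniformRapidDecayOn S (fun t x => PlanarEigenmode.vorticity (u t) x))
    (hbdd : ∀ t ∈ S, ∃ M : ℝ, ∀ x, ‖u t x‖ ≤ M) {Cg : ℝ} (hCg0 : 0 ≤ Cg)
    (hNash : ∀ ⦃g : EuclideanSpace ℝ (Fin 2) → ℝ⦄, ContDiff ℝ 1 g → ∀ ⦃A r : ℝ⦄, 2 < r →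
      (∀ x, |g x| ≤ A * (1 + ‖x‖) ^ (-r)) → (∀ x, ‖fderiv ℝ g x‖ ≤ A * (1 + ‖x‖) ^ (-r)) →
      (∫ x, g x ^ 2) ^ 2 ≤ 4 * Cg * (∫ x, |g x|) ^ 2 * ∫ x, ‖fderiv ℝ g x‖ ^ 2)
    {t₀ t : ℝ} (ht₀ : t₀ ∈ S) (ht : t ∈ S)
    (htt : t₀ < t) {r : ℝ} (hr : 1 ≤ r) :
    ∫ x, |PlanarEigenmode.vorticity (u t) x| ^ r ≤
      (8 * Cg *
        (∫ y, |PlanarEigenmode.vorticity (u t₀) y|) / (ν * (t - t₀))) ^ (r - 1) *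
        ∫ y, |PlanarEigenmode.vorticity (u t₀) y| := by
  set A : ℝ := 8 * Cg *
    (∫ y, |PlanarEigenmode.vorticity (u t₀) y|) / (ν * (t - t₀)) with hA
  have hm0 : 0 ≤ ∫ y, |PlanarEigenmode.vorticity (u t₀) y| := integral_nonneg fun y => abs_nonneg _
  have hA0 : 0 ≤ A := by
    have := sub_pos.2 htt
    positivity
  have hU : UniqueDiffOn ℝ S := uniqueDiffOn_of_convex_of_lt hS ht₀ ht htt
  have hsm := PlanarEigenmode.isSmoothSpaceTimeOn_vorticity h.smooth_velocity hU
  obtain ⟨C, hC, hdec⟩ := exists_planarVorticity_decay_const₃ h.smooth_velocity hU hω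
  have hwc : Continuous (PlanarEigenmode.vorticity (u t)) := hsm.continuous_slice ht
  have hsup : ∀ x, |PlanarEigenmode.vorticity (u t) x| ≤ A := fun x => by
    rw [hA]
    exact h.abs_planarVorticity_le_of_integral_abs_le_of_nashConst hS hν hcurl hω hbdd hCg0 hNash
      ht₀ ht htt (fun _ hs => h.integral_abs_planarVorticity_le hS hν.le hcurl hω hbdd ht₀
        (hS.ordConnected.out ht₀ ht hs) hs.1) x
  -- pointwise interpolation `|ω|^r = |ω|^{r-1} |ω| ≤ A^{r-1} |ω|`
  have hpt : ∀ x, |PlanarEigenmode.vorticity (u t) x| ^ r ≤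
      A ^ (r - 1) * |PlanarEigenmode.vorticity (u t) x| := by
    intro x
    have ha := abs_nonneg (PlanarEigenmode.vorticity (u t) x)
    have e : |PlanarEigenmode.vorticity (u t) x| ^ r =
        |PlanarEigenmode.vorticity (u t) x| ^ (r - 1) * |PlanarEigenmode.vorticity (u t) x| := by
      rw [← Real.rpow_add_one' ha (by linarith), sub_add_cancel]
    rw [e]
    exact mul_le_mul_of_nonneg_right (Real.rpow_le_rpow ha (hsup x) (by linarith)) ha
  have hI1 : Integrable (fun x => |PlanarEigenmode.vorticity (u t) x|)
      (volume : Measure (EuclideanSpace ℝ (Fin 2))) :=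
    integrable_of_norm_le_rpow_neg (continuous_abs.comp hwc) (C := C) finrank_lt_weightExp
      fun x => by rw [Real.norm_eq_abs, abs_abs]; exact (hdec t ht x).1
  have hIr : Integrable (fun x => |PlanarEigenmode.vorticity (u t) x| ^ r)
      (volume : Measure (EuclideanSpace ℝ (Fin 2))) := by
    refine (hI1.const_mul (A ^ (r - 1))).mono'
      (((continuous_abs.comp hwc).rpow_const fun x => Or.inr (by linarith))).aestronglyMeasurable
      (Eventually.of_forall fun x => ?_)
    rw [Real.norm_of_nonneg (Real.rpow_nonneg (abs_nonneg _) _)]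
    exact hpt x
  calc ∫ x, |PlanarEigenmode.vorticity (u t) x| ^ r
      ≤ ∫ x, A ^ (r - 1) * |PlanarEigenmode.vorticity (u t) x| :=
        integral_mono hIr (hI1.const_mul _) hpt
    _ = A ^ (r - 1) * ∫ x, |PlanarEigenmode.vorticity (u t) x| := integral_const_mul _ _
    _ ≤ A ^ (r - 1) * ∫ y, |PlanarEigenmode.vorticity (u t₀) y| :=
        mul_le_mul_of_nonneg_left (h.integral_abs_planarVorticity_le hS hν.le hcurl hω hbdd ht₀ ht
          htt.le) (Real.rpow_nonneg hA0 _)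

/-- **Gallay–Wayne (1.2) for every real exponent `r ≥ 1`, signed data** (v4):
`∫ |ω(t)|^r ≤ (8 C_GNS ‖ω(t₀)‖₁/(ν (t − t₀)))^{r−1} · ‖ω(t₀)‖₁`, i.e.
`‖ω(t)‖_r ≤ (8 C_GNS)^{1 − 1/r} ‖ω(t₀)‖₁ / (ν (t − t₀))^{1 − 1/r}` — interpolation
`|ω|^r ≤ ‖ω‖_∞^{r−1} |ω|` between the `L^∞` endpoint (`abs_planarVorticity_le`) and the `L¹`
contraction (`integral_abs_planarVorticity_le`). [cite: GallayWayne2005, Thm. 1.1 eq. (1.2) (all p)] -/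
theorem IsClassicalNSSolutionOn.integral_abs_rpow_planarVorticity_le
    (h : IsClassicalNSSolutionOn S ν f u p) (hS : Convex ℝ S) (hν : 0 < ν)
    (hcurl : ∀ t ∈ S, ∀ x, PlanarEigenmode.vorticity (f t) x = 0)
    (hω : HasUniformRapidDecayOn S (fun t x => PlanarEigenmode.vorticity (u t) x))
    (hbdd : ∀ t ∈ S, ∃ M : ℝ, ∀ x, ‖u t x‖ ≤ M) {t₀ t : ℝ} (ht₀ : t₀ ∈ S) (ht : t ∈ S)
    (htt : t₀ < t) {r : ℝ} (hr : 1 ≤ r) :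
    ∫ x, |PlanarEigenmode.vorticity (u t) x| ^ r ≤
      (8 * (lintegralPowLePowLIntegralFDerivConst (volume : Measure (EuclideanSpace ℝ (Fin 2))) 2 : ℝ) *
        (∫ y, |PlanarEigenmode.vorticity (u t₀) y|) / (ν * (t - t₀))) ^ (r - 1) *
        ∫ y, |PlanarEigenmode.vorticity (u t₀) y|  :=
  h.integral_abs_rpow_planarVorticity_le_of_nashConst hS hν hcurl hω hbdd (NNReal.coe_nonneg _)
    nash_of_decay_mathlib ht₀ ht htt hr

/-! ### §8 (v5) EXPLICIT CONSTANTS: the chain at the Nash constant `1/8` (lit3 g9, p491674)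

With `PlanarSobolev.sq_integral_sq_le_half_of_decay` (`(∫g²)² ≤ ½(∫|g|)²∫‖∇g‖²`, i.e. `Cg = 1/8` in
the generic hypothesis) the dictionary is `2 C_GNS ↦ 1/4`, `(128/3) C_GNS³ ↦ 1/12`, `8 C_GNS ↦ 1`:
**`‖ω(t)‖₂² ≤ m²/(4ν(t−t₀))`, `‖ω(t)‖₄⁴ ≤ m⁴/(12(ν(t−t₀))³)`, `‖ω(t)‖_∞ ≤ m/(ν(t−t₀))`**
(the heat kernel / Lamb–Oseen values are `m²/(8πνt)`, `m⁴/(256π³(νt)³)·…`, `m/(4πνt)`; the sharp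
`L^∞` constant `1/(4π)` is Carlen–Loss 1995, not reached by Nash's iteration). -/

/-- **`L²` decay, explicit constant**: under a running `L¹` bound `m` on `[t₀, t]`,
`∫ ω(t)² ≤ m² / (4 ν (t − t₀))`. [cite: GallayWayne2005, Thm. 1.1 eq. (1.2) (p = 2); Nash1958] -/
theorem IsClassicalNSSolutionOn.integral_sq_planarVorticity_le_of_integral_abs_le_explicit
    (h : IsClassicalNSSolutionOn S ν f u p) (hS : Convex ℝ S) (hν : 0 < ν)
    (hcurl : ∀ t ∈ S, ∀ x, PlanarEigenmode.vorticity (f t) x = 0)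
    (hω : HasUniformRapidDecayOn S (fun t x => PlanarEigenmode.vorticity (u t) x))
    (hbdd : ∀ t ∈ S, ∃ M : ℝ, ∀ x, ‖u t x‖ ≤ M) {t₀ t : ℝ} (ht₀ : t₀ ∈ S) (ht : t ∈ S)
    (htt : t₀ < t) {m : ℝ}
    (hm : ∀ s ∈ Icc t₀ t, ∫ x, |PlanarEigenmode.vorticity (u s) x| ≤ m) :
    ∫ x, PlanarEigenmode.vorticity (u t) x ^ 2 ≤ m ^ 2 / (4 * (ν * (t - t₀))) := by
  have h1 := h.integral_sq_planarVorticity_le_of_integral_abs_le_of_nashConst hS hν hcurl hω hbdd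
    (by norm_num : (0 : ℝ) ≤ 1 / 8) nash_of_decay_eighth ht₀ ht htt hm
  refine h1.trans (le_of_eq ?_)
  have hτ : ν * (t - t₀) ≠ 0 := (mul_pos hν (sub_pos.2 htt)).ne'
  field_simp
  ring

/-- **`L⁴` decay, explicit constant**: under a running `L¹` bound `m` on `[t₀, t]`,
`∫ ω(t)⁴ ≤ m⁴ / (12 (ν (t − t₀))³)`. [cite: GallayWayne2005, Thm. 1.1 eq. (1.2) (p = 4); Nash1958] -/
theorem IsClassicalNSSolutionOn.integral_pow_four_planarVorticity_le_of_integral_abs_le_explicit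
    (h : IsClassicalNSSolutionOn S ν f u p) (hS : Convex ℝ S) (hν : 0 < ν)
    (hcurl : ∀ t ∈ S, ∀ x, PlanarEigenmode.vorticity (f t) x = 0)
    (hω : HasUniformRapidDecayOn S (fun t x => PlanarEigenmode.vorticity (u t) x))
    (hbdd : ∀ t ∈ S, ∃ M : ℝ, ∀ x, ‖u t x‖ ≤ M) {t₀ t : ℝ} (ht₀ : t₀ ∈ S) (ht : t ∈ S)
    (htt : t₀ < t) {m : ℝ}
    (hm : ∀ s ∈ Icc t₀ t, ∫ x, |PlanarEigenmode.vorticity (u s) x| ≤ m) :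
    ∫ x, PlanarEigenmode.vorticity (u t) x ^ 4 ≤ m ^ 4 / (12 * (ν * (t - t₀)) ^ 3) := by
  have h1 := h.integral_pow_four_planarVorticity_le_of_integral_abs_le_of_nashConst hS hν hcurl hω
    hbdd (by norm_num : (0 : ℝ) ≤ 1 / 8) nash_of_decay_eighth ht₀ ht htt hm
  refine h1.trans (le_of_eq ?_)
  have hτ : ν * (t - t₀) ≠ 0 := (mul_pos hν (sub_pos.2 htt)).ne'
  field_simp
  ring

/-- **`L^∞` decay, explicit constant**: under a running `L¹` bound `m` on `[t₀, t]`,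
`|ω(t, x)| ≤ m / (ν (t − t₀))` for every `x` — the any-profile peak ceiling of the cell's MODEL
lane as a NUMBER (`×4π` above the heat-kernel value `m/(4πν(t−t₀))`).
[cite: GallayWayne2005, Thm. 1.1 eq. (1.2) (p = ∞); CarlenLoss1995, Thm. 1; Nash1958] -/
theorem IsClassicalNSSolutionOn.abs_planarVorticity_le_of_integral_abs_le_explicit
    (h : IsClassicalNSSolutionOn S ν f u p) (hS : Convex ℝ S) (hν : 0 < ν)
    (hcurl : ∀ t ∈ S, ∀ x, PlanarEigenmode.vorticity (f t) x = 0)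
    (hω : HasUniformRapidDecayOn S (fun t x => PlanarEigenmode.vorticity (u t) x))
    (hbdd : ∀ t ∈ S, ∃ M : ℝ, ∀ x, ‖u t x‖ ≤ M) {t₀ t : ℝ} (ht₀ : t₀ ∈ S) (ht : t ∈ S)
    (htt : t₀ < t) {m : ℝ} (hm : ∀ s ∈ Icc t₀ t, ∫ x, |PlanarEigenmode.vorticity (u s) x| ≤ m)
    (x : EuclideanSpace ℝ (Fin 2)) :
    |PlanarEigenmode.vorticity (u t) x| ≤ m / (ν * (t - t₀)) := by
  have h1 := h.abs_planarVorticity_le_of_integral_abs_le_of_nashConst hS hν hcurl hω hbdd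
    (by norm_num : (0 : ℝ) ≤ 1 / 8) nash_of_decay_eighth ht₀ ht htt hm x
  refine h1.trans (le_of_eq ?_)
  ring

/-- **Non-negative vorticity, explicit constant**: `0 ≤ ω(t, x) ≤ Γ / (ν (t − t₀))`,
`Γ = ∫ ω(t₀)` the conserved circulation (`ω(t₀) ≥ 0`, `t₀ < t`).
[cite: GallayWayne2005, Thm. 1.1 eq. (1.2) (p = ∞); CarlenLoss1995, Thm. 1; MajdaBertozziCUP2002, §1.7 Prop. 1.14 (i)] -/
theorem IsClassicalNSSolutionOn.planarVorticity_le_of_nonneg_explicit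
    (h : IsClassicalNSSolutionOn S ν f u p) (hS : Convex ℝ S) (hν : 0 < ν)
    (hcurl : ∀ t ∈ S, ∀ x, PlanarEigenmode.vorticity (f t) x = 0)
    (hω : HasUniformRapidDecayOn S (fun t x => PlanarEigenmode.vorticity (u t) x))
    (hbdd : ∀ t ∈ S, ∃ M : ℝ, ∀ x, ‖u t x‖ ≤ M) {t₀ t : ℝ} (ht₀ : t₀ ∈ S)
    (h0 : ∀ x, 0 ≤ PlanarEigenmode.vorticity (u t₀) x) (ht : t ∈ S) (htt : t₀ < t)
    (x : EuclideanSpace ℝ (Fin 2)) :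
    0 ≤ PlanarEigenmode.vorticity (u t) x ∧
      PlanarEigenmode.vorticity (u t) x ≤
        (∫ y, PlanarEigenmode.vorticity (u t₀) y) / (ν * (t - t₀)) := by
  refine ⟨(h.integral_abs_planarVorticity_eq_of_nonneg hS hν.le hcurl hω hbdd ht₀ h0 ht htt.le).1 x,
    (le_abs_self _).trans ?_⟩
  exact h.abs_planarVorticity_le_of_integral_abs_le_explicit hS hν hcurl hω hbdd ht₀ ht htt
    (fun _ hs => ((h.integral_abs_planarVorticity_eq_of_nonneg hS hν.le hcurl hω hbdd ht₀ h0
      (hS.ordConnected.out ht₀ ht hs) hs.1).2).le) x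

/-- **Signed data, explicit constant, `p = 2`**: `∫ ω(t)² ≤ ‖ω(t₀)‖₁² / (4 ν (t − t₀))`
(`L¹` contraction `integral_abs_planarVorticity_le` feeds the running bound).
[cite: GallayWayne2005, Thm. 1.1 eq. (1.2) (p = 2)] -/
theorem IsClassicalNSSolutionOn.integral_sq_planarVorticity_le_explicit
    (h : IsClassicalNSSolutionOn S ν f u p) (hS : Convex ℝ S) (hν : 0 < ν)
    (hcurl : ∀ t ∈ S, ∀ x, PlanarEigenmode.vorticity (f t) x = 0)
    (hω : HasUniformRapidDecayOn S (fun t x => PlanarEigenmode.vorticity (u t) x))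
    (hbdd : ∀ t ∈ S, ∃ M : ℝ, ∀ x, ‖u t x‖ ≤ M) {t₀ t : ℝ} (ht₀ : t₀ ∈ S) (ht : t ∈ S)
    (htt : t₀ < t) :
    ∫ x, PlanarEigenmode.vorticity (u t) x ^ 2 ≤
      (∫ x, |PlanarEigenmode.vorticity (u t₀) x|) ^ 2 / (4 * (ν * (t - t₀))) :=
  h.integral_sq_planarVorticity_le_of_integral_abs_le_explicit hS hν hcurl hω hbdd ht₀ ht htt
    fun _ hs => h.integral_abs_planarVorticity_le hS hν.le hcurl hω hbdd ht₀
      (hS.ordConnected.out ht₀ ht hs) hs.1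

/-- **Signed data, explicit constant, `p = 4`**: `∫ ω(t)⁴ ≤ ‖ω(t₀)‖₁⁴ / (12 (ν (t − t₀))³)`.
[cite: GallayWayne2005, Thm. 1.1 eq. (1.2) (p = 4)] -/
theorem IsClassicalNSSolutionOn.integral_pow_four_planarVorticity_le_explicit
    (h : IsClassicalNSSolutionOn S ν f u p) (hS : Convex ℝ S) (hν : 0 < ν)
    (hcurl : ∀ t ∈ S, ∀ x, PlanarEigenmode.vorticity (f t) x = 0)
    (hω : HasUniformRapidDecayOn S (fun t x => PlanarEigenmode.vorticity (u t) x))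
    (hbdd : ∀ t ∈ S, ∃ M : ℝ, ∀ x, ‖u t x‖ ≤ M) {t₀ t : ℝ} (ht₀ : t₀ ∈ S) (ht : t ∈ S)
    (htt : t₀ < t) :
    ∫ x, PlanarEigenmode.vorticity (u t) x ^ 4 ≤
      (∫ x, |PlanarEigenmode.vorticity (u t₀) x|) ^ 4 / (12 * (ν * (t - t₀)) ^ 3) :=
  h.integral_pow_four_planarVorticity_le_of_integral_abs_le_explicit hS hν hcurl hω hbdd ht₀ ht htt
    fun _ hs => h.integral_abs_planarVorticity_le hS hν.le hcurl hω hbdd ht₀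
      (hS.ordConnected.out ht₀ ht hs) hs.1

/-- **Signed data, explicit constant, `p = ∞`**: `|ω(t, x)| ≤ ‖ω(t₀)‖₁ / (ν (t − t₀))`.
[cite: GallayWayne2005, Thm. 1.1 eq. (1.2) (p = ∞); CarlenLoss1995, Thm. 1] -/
theorem IsClassicalNSSolutionOn.abs_planarVorticity_le_explicit
    (h : IsClassicalNSSolutionOn S ν f u p) (hS : Convex ℝ S) (hν : 0 < ν)
    (hcurl : ∀ t ∈ S, ∀ x, PlanarEigenmode.vorticity (f t) x = 0)
    (hω : HasUniformRapidDecayOn S (fun t x => PlanarEigenmode.vorticity (u t) x))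
    (hbdd : ∀ t ∈ S, ∃ M : ℝ, ∀ x, ‖u t x‖ ≤ M) {t₀ t : ℝ} (ht₀ : t₀ ∈ S) (ht : t ∈ S)
    (htt : t₀ < t) (x : EuclideanSpace ℝ (Fin 2)) :
    |PlanarEigenmode.vorticity (u t) x| ≤
      (∫ y, |PlanarEigenmode.vorticity (u t₀) y|) / (ν * (t - t₀)) :=
  h.abs_planarVorticity_le_of_integral_abs_le_explicit hS hν hcurl hω hbdd ht₀ ht htt (fun _ hs =>
    h.integral_abs_planarVorticity_le hS hν.le hcurl hω hbdd ht₀ (hS.ordConnected.out ht₀ ht hs) hs.1) x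

/-- **Signed data, explicit constant, every exponent `r ≥ 1`**:
`∫ |ω(t)|^r ≤ (‖ω(t₀)‖₁/(ν (t − t₀)))^{r−1} ‖ω(t₀)‖₁`.
[cite: GallayWayne2005, Thm. 1.1 eq. (1.2) (all p)] -/
theorem IsClassicalNSSolutionOn.integral_abs_rpow_planarVorticity_le_explicit
    (h : IsClassicalNSSolutionOn S ν f u p) (hS : Convex ℝ S) (hν : 0 < ν)
    (hcurl : ∀ t ∈ S, ∀ x, PlanarEigenmode.vorticity (f t) x = 0)
    (hω : HasUniformRapidDecayOn S (fun t x => PlanarEigenmode.vorticity (u t) x))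
    (hbdd : ∀ t ∈ S, ∃ M : ℝ, ∀ x, ‖u t x‖ ≤ M) {t₀ t : ℝ} (ht₀ : t₀ ∈ S) (ht : t ∈ S)
    (htt : t₀ < t) {r : ℝ} (hr : 1 ≤ r) :
    ∫ x, |PlanarEigenmode.vorticity (u t) x| ^ r ≤
      ((∫ y, |PlanarEigenmode.vorticity (u t₀) y|) / (ν * (t - t₀))) ^ (r - 1) *
        ∫ y, |PlanarEigenmode.vorticity (u t₀) y| := by
  have h1 := h.integral_abs_rpow_planarVorticity_le_of_nashConst hS hν hcurl hω hbdd
    (by norm_num : (0 : ℝ) ≤ 1 / 8) nash_of_decay_eighth ht₀ ht htt hr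
  rw [show 8 * (1 / 8 : ℝ) * (∫ y, |PlanarEigenmode.vorticity (u t₀) y|) =
    ∫ y, |PlanarEigenmode.vorticity (u t₀) y| by ring] at h1
  exact h1

end Planar

end Literature.Analysis.FluidPDE
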